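import Summits.ValiantsHypothesis.ValiantsHypothesis.Theorems.SymPencilSingSixClassificationZeroLine
import Summits.ValiantsHypothesis.ValiantsHypothesis.Theorems.SymPencilPerFourCrossPairNoJoint
import Summits.ValiantsHypothesis.ValiantsHypothesis.Theorems.SymPencilPerFourRowPairNoJoint
import Summits.ValiantsHypothesis.ValiantsHypothesis.Theorems.SymPencilPerFourRowPairSkewNoJoint
import Summits.ValiantsHypothesis.ValiantsHypothesis.Theorems.SymPencilPerFourRowPairSumNoJoint
import Summits.ValiantsHypothesis.ValiantsHypothesis.Theorems.SymPencilPerFourJointFamilyTransport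
import Summits.ValiantsHypothesis.ValiantsHypothesis.Theorems.SymPencilPerFourCrossKronecker
import Summits.ValiantsHypothesis.ValiantsHypothesis.Theorems.SymPencilPerFourPairingHyperplane
import Summits.ValiantsHypothesis.ValiantsHypothesis.Theorems.SymPencilPerFourLowRankSeven
import Summits.ValiantsHypothesis.ValiantsHypothesis.Theorems.SymPencilPerFourTwoRowCorankTwo

/-!
# Crux `SdcSuperquadratic` (stmt-ValiantsHypothesis-5674) — workfile `Lines/sing_five_classification.lean`
# THE V-SIDE OF THE SIZE-27 CELL `(11, 5, 4)` AS A CASCADE ON TOP OF `zeroLine` (T5, ✓ p632876)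

val-idea-18 g5 (planner ideator, lens = cascade), 2026-08-28.  Rung currency only: the crux is OPEN,
the window `27 ≤ sdc(per₄) ≤ 29` is UNCHANGED, `VP ≠ VNP` is not moved, no summit statement is proved
here.  Companion memo (all paper proofs, identities, censuses, revision log):
`Cruxes/SdcSuperquadratic/SING-FIVE-CLASSIFICATION.md`; line card `Lines/sing_five_classification.md`.

TARGET (CELLS-27.md § (11,5,4) (iii) «LIST₅», TORIC-SIX.md §X (d)–(f) H115₄ʲ): a `5`-dimensional linear
`W ⊆ Sing Z(per₄)` carries NO JOINT bilinear family of four squares (`noJointFamily_five_four`).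
The dispatch `noJointFamily_five_four_of` is KERNEL-CHECKED from NAMED LEAVES (top split = ✓
`SymPencilSingSixClassification.zeroLine`; zero column ↦ zero row by `transposeL`):
* leaf X   `stub_crossFive`     — PROVED (rev 3, §2a; memo §3), then ✓ p605739 cross-pair brick BY NAME;
* leaf R2  `stub_twoZeroRows`   — PROVED (rev 5, §2c; memo §4, Lemma TwoRows);
* leaf E   `stub_wcolFive`      — PROVED (rev 4, §2b; memo §5), then bricks ✓ p605861/p606014/p606066
  via `stub_torusDispatch` (plumbing, PROVED rev 2);
* leaf R1C `stub_threeByThree`  — PROVED (revs 6–8, §2d–2g: union step, `3 × 3` point lemma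
  `concl3_of_rankOne`, Hessian reading `cofRankLeOne_of_famAt`);
* leaf R1N `stub_threeRowsFourCols` — DERIVED (rev 9, §2h: normal form, branch `n_r = 4`, tools
  (T1′)/(T2)) from the residual, which is itself DERIVED (rev 10, §2i–2k: memo §6.4 kernel-plane
  dispatch — (K1) `permOrth_of_ker3`, (K2) `ker_permOrth`, ✓ `perpPlanes permOrthPairs` splits
  PURE / GRAPH / PRODUCT; GRAPH refuted `graph_false`, PURE refuted `pure_false`) from the ONE sorry.

Honest sorry count (rev 10): 1 = `stub_R1N_residual : R1NToric K ∧ R1NProduct K` (leaf R1N's two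
remaining branches: TORIC = memo §6.6 (all live rows of rank ≤ 2), PRODUCT = memo §6.5 (a rank-3 live
row whose kernel plane is of product type) — the porting debt, owned after this seat's HANDOFF by
val-lit-p8 (R253)).  Everything else — leaves X, R2, E, R1C, the torus plumbing, R1N's normalisation,
`n_r = 4`, the kernel-plane dispatch — is PROVED in-file; `noJointFamily_five_four_of_open₂` certifies
TORIC → PRODUCT → cell statement.  ON PAPER all of it holds (memo §6.5–6.6), i.e. LIST₅ / `H115₄ʲ` /
cell `(11,5,4) = ∅` modulo porting these two branches.  No definitions land in Theorems from here; no
items, no routes. [folklore]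
-/

noncomputable section

-- single-conjunct layout: Sub = Summit, duplicated namespace component intended
set_option linter.dupNamespace false

namespace Summit.ValiantsHypothesis.ValiantsHypothesis.Cruxes.SdcSuperquadratic.SingFive

open MvPolynomial Module Matrix
open scoped Polynomial
open Literature.Computability.AlgebraicComplexity
open Summit.ValiantsHypothesis.ValiantsHypothesis.Theorems
open Summit.ValiantsHypothesis.ValiantsHypothesis.Theorems.SymPencilSingSixClassification
open Summit.ValiantsHypothesis.ValiantsHypothesis.Theorems.SymPencilPerFourJointFamilyTransport

variable {K : Type*} [Field K]

/-! ## 0. Predicates -/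

/-- A JOINT bilinear family of four squares on `W` with data `(c, β)` — VERBATIM the shape of the
bricks (`not_jointFamily_four_of_cross_pair` …) and of `jointFamily_map`. -/
def JointFour (W : Submodule K (Fin 4 × Fin 4 → K)) (c : Fin 4 → K)
    (β : Fin 4 → ((Fin 4 × Fin 4 → K) →ₗ[K] (Fin 4 × Fin 4 → K) →ₗ[K] K)) : Prop :=
  ∀ u : Fin 4 × Fin 4 → K, ∀ y ∈ W, ∃ e₀ e₁ : K, ∀ s : K,
    eval (u + s • y) (perPoly (Fin 4) K) = e₀ + s * e₁ + s ^ 2 * ∑ k, c k * (β k u y) ^ 2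

/-- `W` carries some joint family of four squares. -/
def HasJointFour (W : Submodule K (Fin 4 × Fin 4 → K)) : Prop :=
  ∃ (c : Fin 4 → K) (β : Fin 4 → ((Fin 4 × Fin 4 → K) →ₗ[K] (Fin 4 × Fin 4 → K) →ₗ[K] K)),
    JointFour W c β

/-- Per-DIRECTION family of `≤ 4` squares (`PerDirSix` of the Defs file with `6 ↦ 4`): for every
`y ∈ W` the `s²`-coefficient of `per₄ (u + s y)` is a combination of four squares … (memo). -/
def PerDirFour (W : Submodule K (Fin 4 × Fin 4 → K)) : Prop :=
  ∀ y ∈ W, ∃ (c : Fin 4 → K) (Λ : Fin 4 → ((Fin 4 × Fin 4 → K) →ₗ[K] K)),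
    ∀ u : Fin 4 × Fin 4 → K, ∃ e₀ e₁ : K, ∀ s : K,
      eval (u + s • y) (perPoly (Fin 4) K) = e₀ + s * e₁ + s ^ 2 * ∑ k, c k * (Λ k u) ^ 2

/-- Per-POINT family of `≤ 4` squares: for every base point `u` the quadratic form
`y ↦ s²-coeff of per₄ (u + s y)` on `W` is a combination of four squares of linear forms in `y`. -/
def PerPointFour (W : Submodule K (Fin 4 × Fin 4 → K)) : Prop :=
  ∀ u : Fin 4 × Fin 4 → K, ∃ (c : Fin 4 → K) (Λ : Fin 4 → ((Fin 4 × Fin 4 → K) →ₗ[K] K)),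
    ∀ y ∈ W, ∃ e₀ e₁ : K, ∀ s : K,
      eval (u + s • y) (perPoly (Fin 4) K) = e₀ + s * e₁ + s ^ 2 * ∑ k, c k * (Λ k y) ^ 2

/-- `W ⊆ W_col(p,q;m)`: only rows `p, q` are live and their column `m` vanishes. -/
def InWCol (W : Submodule K (Fin 4 × Fin 4 → K)) (p q m : Fin 4) : Prop :=
  ∀ x ∈ W, (∀ i j : Fin 4, i ≠ p → i ≠ q → x (i, j) = 0) ∧ x (p, m) = 0 ∧ x (q, m) = 0

/-- `V₅×`-type: `W = X_{lc} ∩ {x_(l,a) = 0} ∩ {x_(b,c) = 0}` — the cross with ONE row-arm cell and ONE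
column-arm cell removed (`SymPencilPerFourFiveDimFamilies`: `l = c = 0`, `a = b = 3`). -/
def VFiveCrossType (W : Submodule K (Fin 4 × Fin 4 → K)) : Prop :=
  ∃ l c a b : Fin 4, a ≠ c ∧ b ≠ l ∧
    ∀ x : Fin 4 × Fin 4 → K, x ∈ W ↔
      ((∀ i j : Fin 4, i ≠ l → j ≠ c → x (i, j) = 0) ∧ x (l, a) = 0 ∧ x (b, c) = 0)

/-- Torus product type `V(L)` (rows): rows `σ 2, σ 3` zero, column `τ 3` of rows `σ 0, σ 1` zero,
row `σ 0` otherwise free, row `σ 1` in the plane `Σ_j θ_j x_(σ1, τ j) = 0` … (memo). -/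
def VTorusType (W : Submodule K (Fin 4 × Fin 4 → K)) : Prop :=
  ∃ (σ τ : Equiv.Perm (Fin 4)) (θ : Fin 4 → K), θ 3 = 0 ∧ θ ≠ 0 ∧
    ∀ x : Fin 4 × Fin 4 → K, x ∈ W ↔
      ((∀ j, x (σ 2, j) = 0) ∧ (∀ j, x (σ 3, j) = 0) ∧ x (σ 0, τ 3) = 0 ∧ x (σ 1, τ 3) = 0 ∧
        ∑ j, θ j * x (σ 1, τ j) = 0)

/-! ## 1. Joint ⇒ per-direction and per-point (trivial projections) -/

/-- A joint family is a per-direction family for every `y` (`Λ_k = β_k(·, y)`). [folklore] -/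
theorem perDirFour_of_jointFour {W : Submodule K (Fin 4 × Fin 4 → K)} {c : Fin 4 → K}
    {β : Fin 4 → ((Fin 4 × Fin 4 → K) →ₗ[K] (Fin 4 × Fin 4 → K) →ₗ[K] K)}
    (h : JointFour W c β) : PerDirFour W := by
  intro y hy
  refine ⟨c, fun k => (β k).flip y, fun u => ?_⟩
  obtain ⟨e₀, e₁, he⟩ := h u y hy
  exact ⟨e₀, e₁, fun s => by simpa only [LinearMap.flip_apply] using he s⟩

/-- A joint family is a per-point family for every `u` (`Λ_k = β_k(u, ·)`). [folklore] -/
theorem perPointFour_of_jointFour {W : Submodule K (Fin 4 × Fin 4 → K)} {c : Fin 4 → K}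
    {β : Fin 4 → ((Fin 4 × Fin 4 → K) →ₗ[K] (Fin 4 × Fin 4 → K) →ₗ[K] K)}
    (h : JointFour W c β) : PerPointFour W := by
  intro u
  refine ⟨c, fun k => β k u, fun y hy => ?_⟩
  obtain ⟨e₀, e₁, he⟩ := h u y hy
  exact ⟨e₀, e₁, fun s => he s⟩

/-! ## 2. The leaves -/

/-! ## 2a. Leaf X — PROVED (rev 3): the Kronecker form with four squares -/

/-- Coordinate span: vectors vanishing off a finite set `T` of cells lie in a submodule of
dimension `≤ |T|` (cf. `SymPencilPerFourCrossFilter.exists_crossSpan_erase`). [folklore] -/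
theorem exists_span_of_support (T : Finset (Fin 4 × Fin 4)) :
    ∃ C : Submodule K (Fin 4 × Fin 4 → K), finrank K C ≤ T.card ∧
      ∀ z : Fin 4 × Fin 4 → K, (∀ p, p ∉ T → z p = 0) → z ∈ C := by
  classical
  refine ⟨Submodule.span K ↑(T.image fun p => (Pi.single p (1 : K) : Fin 4 × Fin 4 → K)),
    (finrank_span_finset_le_card _).trans Finset.card_image_le, ?_⟩
  intro z hz0
  have hdecomp : z = ∑ p ∈ T, z p • (Pi.single p (1 : K) : Fin 4 × Fin 4 → K) :=
    calc z = ∑ p, (Pi.single p (z p) : Fin 4 × Fin 4 → K) := (Finset.univ_sum_single z).symm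
      _ = ∑ p ∈ T, (Pi.single p (z p) : Fin 4 × Fin 4 → K) := by
        symm
        refine Finset.sum_subset (Finset.subset_univ T) fun p _ hp => ?_
        rw [hz0 p hp, Pi.single_zero]
      _ = ∑ p ∈ T, z p • (Pi.single p (1 : K) : Fin 4 × Fin 4 → K) :=
        Finset.sum_congr rfl fun p _ => by
          ext p'
          by_cases hp : p' = p
          · subst hp; simp
          · simp [hp]
  rw [hdecomp]
  exact Submodule.sum_mem _ fun p hp => Submodule.smul_mem _ _
    (Submodule.subset_span (Finset.mem_coe.2 (Finset.mem_image_of_mem _ hp)))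

/-- **Kronecker form with four squares** (pointwise core of leaf X, memo §3): for `y ∈ X₃₃` with a
per-direction family of `≤ 4` squares, a row arm with non-zero product forces … (memo). [folklore] -/
theorem colArm_eq_zero_of_sum_sq_four [CharZero K] (y : Fin 4 × Fin 4 → K)
    (hy : ∀ i j : Fin 4, i ≠ 3 → j ≠ 3 → y (i, j) = 0) (c : Fin 4 → K)
    (Λ : Fin 4 → ((Fin 4 × Fin 4 → K) →ₗ[K] K))
    (hfam : ∀ u : Fin 4 × Fin 4 → K, ∃ e₀ e₁ : K, ∀ s : K,
      eval (u + s • y) (perPoly (Fin 4) K) = e₀ + s * e₁ + s ^ 2 * ∑ k, c k * (Λ k u) ^ 2)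
    (ha : y (3, 0) * y (3, 1) * y (3, 2) ≠ 0) :
    y (0, 3) = 0 ∧ y (1, 3) = 0 ∧ y (2, 3) = 0 := by
  classical
  have ha' : y (3, 2) * y (3, 1) * y (3, 0) ≠ 0 := by
    intro h; apply ha; linear_combination h
  obtain ⟨f01, f02, f10, f12, f20, f21⟩ :
      (((0 : Fin 3) = 1) = False) ∧ (((0 : Fin 3) = 2) = False) ∧
      (((1 : Fin 3) = 0) = False) ∧ (((1 : Fin 3) = 2) = False) ∧
      (((2 : Fin 3) = 0) = False) ∧ (((2 : Fin 3) = 1) = False) := by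
    refine ⟨?_, ?_, ?_, ?_, ?_, ?_⟩ <;> decide
  obtain ⟨U, hU⟩ := SymPencilPerFourCrossKronecker.exists_blockEmbedding (K := K)
  obtain ⟨Q, hQ⟩ : ∃ Q : (Fin 3 × Fin 3 → K) → K, ∀ w, Q w =
      y (0, 3) * y (3, 0) * (w (1, 1) * w (2, 2) + w (1, 2) * w (2, 1)) +
        y (0, 3) * y (3, 1) * (w (1, 0) * w (2, 2) + w (1, 2) * w (2, 0)) +
        y (0, 3) * y (3, 2) * (w (1, 0) * w (2, 1) + w (1, 1) * w (2, 0)) +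
        y (1, 3) * y (3, 0) * (w (0, 1) * w (2, 2) + w (0, 2) * w (2, 1)) +
        y (1, 3) * y (3, 1) * (w (0, 0) * w (2, 2) + w (0, 2) * w (2, 0)) +
        y (1, 3) * y (3, 2) * (w (0, 0) * w (2, 1) + w (0, 1) * w (2, 0)) +
        y (2, 3) * y (3, 0) * (w (0, 1) * w (1, 2) + w (0, 2) * w (1, 1)) +
        y (2, 3) * y (3, 1) * (w (0, 0) * w (1, 2) + w (0, 2) * w (1, 0)) +
        y (2, 3) * y (3, 2) * (w (0, 0) * w (1, 1) + w (0, 1) * w (1, 0)) := ⟨_, fun _ => rfl⟩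
  have hB : ∀ w : Fin 3 × Fin 3 → K, ∑ k, c k * (Λ k (U w)) ^ 2 = Q w := by
    intro w
    obtain ⟨e₀, e₁, he⟩ := hfam (U w)
    have hA := SymPencilPerFourCrossKronecker.eval_cross_block y hy U hU w
    rw [hQ]
    exact SymPencilPerFourCrossPairNoJoint.coeff_two_eq_of_forall₂ (fun s => (he s).symm.trans (hA s))
  let M : (Fin 3 × Fin 3 → K) →ₗ[K] (Fin 4 → K) := LinearMap.pi fun k => (Λ k).comp U
  have hM : ∀ n k, M n k = Λ k (U n) := fun n k => rfl
  have hker5 : 5 ≤ finrank K (LinearMap.ker M) := by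
    have h := LinearMap.finrank_range_add_finrank_ker M
    have hr : finrank K (LinearMap.range M) ≤ 4 :=
      calc finrank K (LinearMap.range M) ≤ finrank K (Fin 4 → K) := Submodule.finrank_le _
        _ = 4 := by rw [Module.finrank_fintype_fun_eq_card, Fintype.card_fin]
    rw [Module.finrank_fintype_fun_eq_card, Fintype.card_prod, Fintype.card_fin] at h
    omega
  obtain ⟨E, hE⟩ : ∃ E : Fin 3 × Fin 3 → (Fin 3 × Fin 3 → K), ∀ P p, E P p = if p = P then 1 else 0 :=
    ⟨fun P p => if p = P then 1 else 0, fun _ _ => rfl⟩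
  have key : ∀ n ∈ LinearMap.ker M,
      (y (2, 3) * n (1, 0) + y (1, 3) * n (2, 0) = 0 ∧ y (2, 3) * n (1, 1) + y (1, 3) * n (2, 1) = 0 ∧
        y (2, 3) * n (1, 2) + y (1, 3) * n (2, 2) = 0) ∧
      (y (2, 3) * n (0, 0) + y (0, 3) * n (2, 0) = 0 ∧ y (2, 3) * n (0, 1) + y (0, 3) * n (2, 1) = 0 ∧
        y (2, 3) * n (0, 2) + y (0, 3) * n (2, 2) = 0) ∧
      (y (1, 3) * n (0, 0) + y (0, 3) * n (1, 0) = 0 ∧ y (1, 3) * n (0, 1) + y (0, 3) * n (1, 1) = 0 ∧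
        y (1, 3) * n (0, 2) + y (0, 3) * n (1, 2) = 0) := by
    intro n hn
    have hΛ0 : ∀ k, Λ k (U n) = 0 := fun k => by
      have := congr_fun (LinearMap.mem_ker.1 hn) k
      rwa [hM] at this
    have hQn : Q n = 0 := by
      rw [← hB n]
      exact Finset.sum_eq_zero fun k _ => by rw [hΛ0 k]; ring
    have hQadd : ∀ e : Fin 3 × Fin 3 → K, Q (n + e) = Q e := by
      intro e
      rw [← hB (n + e), ← hB e]
      exact Finset.sum_congr rfl fun k _ => by rw [map_add, map_add, hΛ0 k, zero_add]
    have r00 := hQadd (E (0, 0))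
    have r01 := hQadd (E (0, 1))
    have r02 := hQadd (E (0, 2))
    have r10 := hQadd (E (1, 0))
    have r11 := hQadd (E (1, 1))
    have r12 := hQadd (E (1, 2))
    have r20 := hQadd (E (2, 0))
    have r21 := hQadd (E (2, 1))
    have r22 := hQadd (E (2, 2))
    simp only [hQ, hE, Pi.add_apply, Prod.mk.injEq, f01, f02, f10, f12, f20, f21, and_true,
      and_false, if_true, if_false] at r00 r01 r02 r10 r11 r12 r20 r21 r22 hQn
    refine ⟨?_, ?_, ?_⟩
    · exact SymPencilPerFourHessianMinors.eq_zero_of_pairing₃ ha'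
        (z₀ := y (2, 3) * n (1, 0) + y (1, 3) * n (2, 0))
        (z₁ := y (2, 3) * n (1, 1) + y (1, 3) * n (2, 1))
        (z₂ := y (2, 3) * n (1, 2) + y (1, 3) * n (2, 2))
        (by linear_combination r00 - hQn) (by linear_combination r01 - hQn)
        (by linear_combination r02 - hQn)
    · exact SymPencilPerFourHessianMinors.eq_zero_of_pairing₃ ha'
        (z₀ := y (2, 3) * n (0, 0) + y (0, 3) * n (2, 0))
        (z₁ := y (2, 3) * n (0, 1) + y (0, 3) * n (2, 1))
        (z₂ := y (2, 3) * n (0, 2) + y (0, 3) * n (2, 2))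
        (by linear_combination r10 - hQn) (by linear_combination r11 - hQn)
        (by linear_combination r12 - hQn)
    · exact SymPencilPerFourHessianMinors.eq_zero_of_pairing₃ ha'
        (z₀ := y (1, 3) * n (0, 0) + y (0, 3) * n (1, 0))
        (z₁ := y (1, 3) * n (0, 1) + y (0, 3) * n (1, 1))
        (z₂ := y (1, 3) * n (0, 2) + y (0, 3) * n (1, 2))
        (by linear_combination r20 - hQn) (by linear_combination r21 - hQn)
        (by linear_combination r22 - hQn)
  have hproj : ∀ i : Fin 3, (∀ n ∈ LinearMap.ker M, (∀ j, n (i, j) = 0) → n = 0) →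
      finrank K (LinearMap.ker M) ≤ 3 := by
    intro i hi
    let ρ : (Fin 3 × Fin 3 → K) →ₗ[K] (Fin 3 → K) := LinearMap.funLeft K K fun j => (i, j)
    have hρ : ∀ n j, ρ n j = n (i, j) := fun _ _ => rfl
    have hinj : Function.Injective (ρ.domRestrict (LinearMap.ker M)) := by
      intro n n' h
      apply Subtype.ext
      have h2 : ρ (n : Fin 3 × Fin 3 → K) = ρ n' := by
        simpa only [LinearMap.domRestrict_apply] using h
      have h3 := hi ((n : Fin 3 × Fin 3 → K) - n') (Submodule.sub_mem _ n.2 n'.2) fun j => by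
        have := congr_fun h2 j
        rw [hρ, hρ] at this
        rw [Pi.sub_apply, this, sub_self]
      exact sub_eq_zero.mp h3
    calc finrank K (LinearMap.ker M) ≤ finrank K (Fin 3 → K) :=
        LinearMap.finrank_le_finrank_of_injective hinj
      _ = 3 := by rw [Module.finrank_fintype_fun_eq_card, Fintype.card_fin]
  by_contra hb
  have hcases : y (0, 3) ≠ 0 ∨ y (1, 3) ≠ 0 ∨ y (2, 3) ≠ 0 := by
    by_contra h
    push Not at h
    exact hb ⟨h.1, h.2.1, h.2.2⟩
  have h3 : finrank K (LinearMap.ker M) ≤ 3 := by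
    rcases hcases with h0 | h1 | h2
    · -- `b₀ ≠ 0`: rows `1, 2` are determined by row `0`
      refine hproj 0 fun n hn hz => ?_
      obtain ⟨⟨-, -, -⟩, ⟨m10, m11, m12⟩, ⟨m20, m21, m22⟩⟩ := key n hn
      have z0 := hz 0
      have z1 := hz 1
      have z2 := hz 2
      have e20 : y (0, 3) * n (2, 0) = 0 := by linear_combination m10 - y (2, 3) * z0
      have e21 : y (0, 3) * n (2, 1) = 0 := by linear_combination m11 - y (2, 3) * z1
      have e22 : y (0, 3) * n (2, 2) = 0 := by linear_combination m12 - y (2, 3) * z2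
      have e10 : y (0, 3) * n (1, 0) = 0 := by linear_combination m20 - y (1, 3) * z0
      have e11 : y (0, 3) * n (1, 1) = 0 := by linear_combination m21 - y (1, 3) * z1
      have e12 : y (0, 3) * n (1, 2) = 0 := by linear_combination m22 - y (1, 3) * z2
      have n20 := (mul_eq_zero.1 e20).resolve_left h0
      have n21 := (mul_eq_zero.1 e21).resolve_left h0
      have n22 := (mul_eq_zero.1 e22).resolve_left h0
      have n10 := (mul_eq_zero.1 e10).resolve_left h0
      have n11 := (mul_eq_zero.1 e11).resolve_left h0
      have n12 := (mul_eq_zero.1 e12).resolve_left h0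
      funext p
      obtain ⟨i, j⟩ := p
      fin_cases i <;> fin_cases j
      · exact z0
      · exact z1
      · exact z2
      · exact n10
      · exact n11
      · exact n12
      · exact n20
      · exact n21
      · exact n22
    · -- `b₁ ≠ 0`: rows `0, 2` are determined by row `1`
      refine hproj 1 fun n hn hz => ?_
      obtain ⟨⟨m00, m01, m02⟩, ⟨-, -, -⟩, ⟨m20, m21, m22⟩⟩ := key n hn
      have z0 := hz 0
      have z1 := hz 1
      have z2 := hz 2
      have e20 : y (1, 3) * n (2, 0) = 0 := by linear_combination m00 - y (2, 3) * z0
      have e21 : y (1, 3) * n (2, 1) = 0 := by linear_combination m01 - y (2, 3) * z1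
      have e22 : y (1, 3) * n (2, 2) = 0 := by linear_combination m02 - y (2, 3) * z2
      have e00 : y (1, 3) * n (0, 0) = 0 := by linear_combination m20 - y (0, 3) * z0
      have e01 : y (1, 3) * n (0, 1) = 0 := by linear_combination m21 - y (0, 3) * z1
      have e02 : y (1, 3) * n (0, 2) = 0 := by linear_combination m22 - y (0, 3) * z2
      have n20 := (mul_eq_zero.1 e20).resolve_left h1
      have n21 := (mul_eq_zero.1 e21).resolve_left h1
      have n22 := (mul_eq_zero.1 e22).resolve_left h1
      have n00 := (mul_eq_zero.1 e00).resolve_left h1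
      have n01 := (mul_eq_zero.1 e01).resolve_left h1
      have n02 := (mul_eq_zero.1 e02).resolve_left h1
      funext p
      obtain ⟨i, j⟩ := p
      fin_cases i <;> fin_cases j
      · exact n00
      · exact n01
      · exact n02
      · exact z0
      · exact z1
      · exact z2
      · exact n20
      · exact n21
      · exact n22
    · -- `b₂ ≠ 0`: rows `0, 1` are determined by row `2`
      refine hproj 2 fun n hn hz => ?_
      obtain ⟨⟨m00, m01, m02⟩, ⟨m10, m11, m12⟩, ⟨-, -, -⟩⟩ := key n hn
      have z0 := hz 0
      have z1 := hz 1
      have z2 := hz 2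
      have e10 : y (2, 3) * n (1, 0) = 0 := by linear_combination m00 - y (1, 3) * z0
      have e11 : y (2, 3) * n (1, 1) = 0 := by linear_combination m01 - y (1, 3) * z1
      have e12 : y (2, 3) * n (1, 2) = 0 := by linear_combination m02 - y (1, 3) * z2
      have e00 : y (2, 3) * n (0, 0) = 0 := by linear_combination m10 - y (0, 3) * z0
      have e01 : y (2, 3) * n (0, 1) = 0 := by linear_combination m11 - y (0, 3) * z1
      have e02 : y (2, 3) * n (0, 2) = 0 := by linear_combination m12 - y (0, 3) * z2
      have n10 := (mul_eq_zero.1 e10).resolve_left h2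
      have n11 := (mul_eq_zero.1 e11).resolve_left h2
      have n12 := (mul_eq_zero.1 e12).resolve_left h2
      have n00 := (mul_eq_zero.1 e00).resolve_left h2
      have n01 := (mul_eq_zero.1 e01).resolve_left h2
      have n02 := (mul_eq_zero.1 e02).resolve_left h2
      funext p
      obtain ⟨i, j⟩ := p
      fin_cases i <;> fin_cases j
      · exact n00
      · exact n01
      · exact n02
      · exact n10
      · exact n11
      · exact n12
      · exact z0
      · exact z1
      · exact z2
  omega

/-- **A row-arm coordinate vanishes** on a `5`-dimensional `W ⊆ X₃₃` with `PerDirFour`: otherwise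
(prime avoidance for the products `a₀a₁a₂ · b_i` … (memo). [folklore] -/
theorem exists_rowArm_vanish [CharZero K] (W : Submodule K (Fin 4 × Fin 4 → K))
    (hX : ∀ x ∈ W, ∀ i j : Fin 4, i ≠ 3 → j ≠ 3 → x (i, j) = 0) (h5 : finrank K W = 5)
    (hW : ∀ y ∈ W, ∃ (c : Fin 4 → K) (Λ : Fin 4 → ((Fin 4 × Fin 4 → K) →ₗ[K] K)),
      ∀ u : Fin 4 × Fin 4 → K, ∃ e₀ e₁ : K, ∀ s : K,
        eval (u + s • y) (perPoly (Fin 4) K) = e₀ + s * e₁ + s ^ 2 * ∑ k, c k * (Λ k u) ^ 2) :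
    ∃ a : Fin 4, a ≠ 3 ∧ ∀ y ∈ W, y (3, a) = 0 := by
  classical
  by_contra hnot
  push Not at hnot
  have hb : ∀ i : Fin 4, i ≠ 3 → ∀ y ∈ W, y (i, 3) = 0 := by
    intro i hi
    let f : Fin 4 → ((Fin 4 × Fin 4 → K) →ₗ[K] K) := fun t =>
      if t = 3 then LinearMap.proj ((i, 3) : Fin 4 × Fin 4)
      else LinearMap.proj (((3 : Fin 4), t) : Fin 4 × Fin 4)
    have hf3 : ∀ y : Fin 4 × Fin 4 → K, f 3 y = y (i, 3) := fun y => by simp [f]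
    have hft : ∀ t, t ≠ 3 → ∀ y : Fin 4 × Fin 4 → K, f t y = y (3, t) := fun t ht y => by
      simp [f, ht]
    have hprod : ∀ y ∈ W, ∏ t ∈ (Finset.univ : Finset (Fin 4)), f t y = 0 := by
      intro y hy
      obtain ⟨c, Λ, hfam⟩ := hW y hy
      rw [Fin.prod_univ_four, hft 0 (by decide), hft 1 (by decide), hft 2 (by decide), hf3]
      by_cases ha : y (3, 0) * y (3, 1) * y (3, 2) = 0
      · rw [ha, zero_mul]
      · have hcol := colArm_eq_zero_of_sum_sq_four y (hX y hy) c Λ hfam ha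
        have hi0 : y (i, 3) = 0 := by
          rcases (by decide : ∀ i : Fin 4, i ≠ 3 → i = 0 ∨ i = 1 ∨ i = 2) i hi with
            rfl | rfl | rfl
          · exact hcol.1
          · exact hcol.2.1
          · exact hcol.2.2
        rw [hi0, mul_zero]
    obtain ⟨t, -, ht⟩ :=
      SymPencilPerFourPairingHyperplane.exists_forall_eq_zero_of_prod_eq_zero W f Finset.univ hprod
    by_cases ht3 : t = 3
    · subst ht3
      intro y hy
      rw [← hf3 y]
      exact ht y hy
    · obtain ⟨y, hy, hne⟩ := hnot t ht3
      exact (hne ((hft t ht3 y).symm.trans (ht y hy))).elim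
  obtain ⟨C, hC, hCmem⟩ := exists_span_of_support (K := K)
    (Finset.univ.filter fun p : Fin 4 × Fin 4 => p.1 = 3)
  have hcard : (Finset.univ.filter fun p : Fin 4 × Fin 4 => p.1 = 3).card = 4 := by decide
  have hWC : W ≤ C := fun y hy => hCmem y fun p hp => by
    have hp1 : p.1 ≠ 3 := fun h => hp (Finset.mem_filter.2 ⟨Finset.mem_univ _, h⟩)
    by_cases hp2 : p.2 = 3
    · have h := hb p.1 hp1 y hy
      rw [← hp2, Prod.mk.eta] at h
      exact h
    · have h := hX y hy p.1 p.2 hp1 hp2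
      rwa [Prod.mk.eta] at h
  have hle := Submodule.finrank_mono hWC
  omega

/-- **A column-arm coordinate vanishes** (transpose of `exists_rowArm_vanish`). [folklore] -/
theorem exists_colArm_vanish [CharZero K] (W : Submodule K (Fin 4 × Fin 4 → K))
    (hX : ∀ x ∈ W, ∀ i j : Fin 4, i ≠ 3 → j ≠ 3 → x (i, j) = 0) (h5 : finrank K W = 5)
    (hW : ∀ y ∈ W, ∃ (c : Fin 4 → K) (Λ : Fin 4 → ((Fin 4 × Fin 4 → K) →ₗ[K] K)),
      ∀ u : Fin 4 × Fin 4 → K, ∃ e₀ e₁ : K, ∀ s : K,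
        eval (u + s • y) (perPoly (Fin 4) K) = e₀ + s * e₁ + s ^ 2 * ∑ k, c k * (Λ k u) ^ 2) :
    ∃ b : Fin 4, b ≠ 3 ∧ ∀ y ∈ W, y (b, 3) = 0 := by
  set W' := W.map (transposeL (K := K) : (Fin 4 × Fin 4 → K) →ₗ[K] (Fin 4 × Fin 4 → K)) with hW'
  have hmem : ∀ y ∈ W, transposeL (K := K) y ∈ W' := fun y hy => Submodule.mem_map_of_mem hy
  have hX' : ∀ x ∈ W', ∀ i j : Fin 4, i ≠ 3 → j ≠ 3 → x (i, j) = 0 := by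
    rintro _ ⟨x, hx, rfl⟩ i j hi hj
    change transposeL (K := K) x (i, j) = 0
    rw [transposeL_apply]
    exact hX x hx j i hj hi
  have h5' : finrank K W' = 5 := by rw [hW', LinearEquiv.finrank_map_eq, h5]
  have hWf' := SymPencilPerFourLowRankSeven.sqFamilySwap_map W (transposeL (K := K))
    (fun z => SymPencilPerFourTwoRowsRadical.eval_perPoly_transpose z) hW
  obtain ⟨a, ha3, ha⟩ := exists_rowArm_vanish W' hX' h5' hWf'
  refine ⟨a, ha3, fun y hy => ?_⟩
  have h := ha _ (hmem y hy)
  rwa [transposeL_apply] at h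

/-- **Leaf X at the cross `X₃₃`**: a `5`-dimensional `W ⊆ X₃₃` with `PerDirFour` is
`X₃₃ ∩ {x_(3,a) = 0} ∩ {x_(b,3) = 0}` (`a, b ≠ 3`). [folklore] -/
theorem crossFive33 [CharZero K] (W : Submodule K (Fin 4 × Fin 4 → K))
    (hX : ∀ x ∈ W, ∀ i j : Fin 4, i ≠ 3 → j ≠ 3 → x (i, j) = 0) (h5 : finrank K W = 5)
    (hW : ∀ y ∈ W, ∃ (c : Fin 4 → K) (Λ : Fin 4 → ((Fin 4 × Fin 4 → K) →ₗ[K] K)),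
      ∀ u : Fin 4 × Fin 4 → K, ∃ e₀ e₁ : K, ∀ s : K,
        eval (u + s • y) (perPoly (Fin 4) K) = e₀ + s * e₁ + s ^ 2 * ∑ k, c k * (Λ k u) ^ 2) :
    ∃ a b : Fin 4, a ≠ 3 ∧ b ≠ 3 ∧ ∀ x : Fin 4 × Fin 4 → K, x ∈ W ↔
      ((∀ i j : Fin 4, i ≠ 3 → j ≠ 3 → x (i, j) = 0) ∧ x (3, a) = 0 ∧ x (b, 3) = 0) := by
  classical
  obtain ⟨a, ha3, haW⟩ := exists_rowArm_vanish W hX h5 hW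
  obtain ⟨b, hb3, hbW⟩ := exists_colArm_vanish W hX h5 hW
  set T : Finset (Fin 4 × Fin 4) := Finset.univ.filter fun p : Fin 4 × Fin 4 =>
    (p.1 = 3 ∨ p.2 = 3) ∧ p ≠ (3, a) ∧ p ≠ (b, 3) with hT
  have hcard : T.card = 5 := by
    have key : ∀ a b : Fin 4, a ≠ 3 → b ≠ 3 → (Finset.univ.filter fun p : Fin 4 × Fin 4 =>
        (p.1 = 3 ∨ p.2 = 3) ∧ p ≠ (3, a) ∧ p ≠ (b, 3)).card = 5 := by decide
    exact key a b ha3 hb3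
  obtain ⟨C, hC, hCmem⟩ := exists_span_of_support (K := K) T
  have hsuppT : ∀ z : Fin 4 × Fin 4 → K, (∀ i j : Fin 4, i ≠ 3 → j ≠ 3 → z (i, j) = 0) →
      z (3, a) = 0 → z (b, 3) = 0 → ∀ p, p ∉ T → z p = 0 := by
    intro z hz hza hzb p hp
    by_cases hpa : p = (3, a)
    · rw [hpa]; exact hza
    by_cases hpb : p = (b, 3)
    · rw [hpb]; exact hzb
    have hnc : ¬ (p.1 = 3 ∨ p.2 = 3) := fun hc =>
      hp (Finset.mem_filter.2 ⟨Finset.mem_univ _, hc, hpa, hpb⟩)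
    push Not at hnc
    have h := hz p.1 p.2 hnc.1 hnc.2
    rwa [Prod.mk.eta] at h
  have hWC : W ≤ C := fun y hy => hCmem y (hsuppT y (hX y hy) (haW y hy) (hbW y hy))
  have hWeq : W = C :=
    Submodule.eq_of_le_of_finrank_le hWC (hC.trans (by rw [hcard, h5]))
  refine ⟨a, b, ha3, hb3, fun x => ⟨fun hx => ⟨hX x hx, haW x hx, hbW x hx⟩, fun hx => ?_⟩⟩
  rw [hWeq]
  exact hCmem x (hsuppT x hx.1 hx.2.1 hx.2.2)

/-- **Leaf X at a general cross `X_{lc}`** (transport by the swaps `3 ↔ l`, `3 ↔ c`, as in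
`SymPencilPerFourCrossFilter.crossFilter`). [folklore] -/
theorem crossFive [CharZero K] (W : Submodule K (Fin 4 × Fin 4 → K)) {l c : Fin 4}
    (hX : ∀ x ∈ W, ∀ i j : Fin 4, i ≠ l → j ≠ c → x (i, j) = 0) (h5 : finrank K W = 5)
    (hW : ∀ y ∈ W, ∃ (c : Fin 4 → K) (Λ : Fin 4 → ((Fin 4 × Fin 4 → K) →ₗ[K] K)),
      ∀ u : Fin 4 × Fin 4 → K, ∃ e₀ e₁ : K, ∀ s : K,
        eval (u + s • y) (perPoly (Fin 4) K) = e₀ + s * e₁ + s ^ 2 * ∑ k, c k * (Λ k u) ^ 2) :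
    ∃ a b : Fin 4, a ≠ c ∧ b ≠ l ∧ ∀ x : Fin 4 × Fin 4 → K, x ∈ W ↔
      ((∀ i j : Fin 4, i ≠ l → j ≠ c → x (i, j) = 0) ∧ x (l, a) = 0 ∧ x (b, c) = 0) := by
  set σ : Equiv.Perm (Fin 4) := Equiv.swap 3 l with hσ
  set τ : Equiv.Perm (Fin 4) := Equiv.swap 3 c with hτ
  set Φ : (Fin 4 × Fin 4 → K) ≃ₗ[K] (Fin 4 × Fin 4 → K) :=
    LinearEquiv.funCongrLeft K K (Equiv.prodCongr σ τ) with hΦ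
  have hΦa : ∀ (x : Fin 4 × Fin 4 → K) (i j : Fin 4), Φ x (i, j) = x (σ i, τ j) := fun x i j => rfl
  have hσ3 : σ 3 = l := by rw [hσ, Equiv.swap_apply_left]
  have hτ3 : τ 3 = c := by rw [hτ, Equiv.swap_apply_left]
  have hW' := SymPencilPerFourLowRankSeven.sqFamilySwap_map W Φ
    (fun z => SymPencilPerFourBlocks.eval_perPoly_comp_prodCongr σ τ z) hW
  set W' := W.map Φ.toLinearMap with hW'def
  have hfin : finrank K W' = 5 := by rw [hW'def, LinearEquiv.finrank_map_eq, h5]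
  have hsupp : ∀ x : Fin 4 × Fin 4 → K, (∀ i j : Fin 4, i ≠ l → j ≠ c → x (i, j) = 0) ↔
      (∀ i j : Fin 4, i ≠ 3 → j ≠ 3 → Φ x (i, j) = 0) := by
    intro x
    constructor
    · intro h i j hi hj
      rw [hΦa]
      refine h (σ i) (τ j) (fun h' => hi ?_) (fun h' => hj ?_)
      · exact σ.injective (h'.trans hσ3.symm)
      · exact τ.injective (h'.trans hτ3.symm)
    · intro h i j hi hj
      have h' := h (σ.symm i) (τ.symm j) (fun h'' => hi ?_) (fun h'' => hj ?_)
      · rwa [hΦa, Equiv.apply_symm_apply, Equiv.apply_symm_apply] at h'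
      · rw [← hσ3, ← h'', Equiv.apply_symm_apply]
      · rw [← hτ3, ← h'', Equiv.apply_symm_apply]
  have hX' : ∀ x ∈ W', ∀ i j : Fin 4, i ≠ 3 → j ≠ 3 → x (i, j) = 0 := by
    rintro _ ⟨x, hx, rfl⟩
    exact (hsupp x).1 (hX x hx)
  obtain ⟨a', b', ha', hb', hmem'⟩ := crossFive33 W' hX' hfin hW'
  have hmemW : ∀ x : Fin 4 × Fin 4 → K, x ∈ W ↔ Φ x ∈ W' := fun x => by
    rw [hW'def, Submodule.mem_map_equiv, LinearEquiv.symm_apply_apply]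
  refine ⟨τ a', σ b', ?_, ?_, fun x => ?_⟩
  · intro h
    exact ha' (τ.injective (h.trans hτ3.symm))
  · intro h
    exact hb' (σ.injective (h.trans hσ3.symm))
  · rw [hmemW x, hmem' (Φ x), ← hsupp x, hΦa, hΦa, hσ3, hτ3]

/-- **Leaf X** (PROVED in rev 3 — `crossFive33` / `crossFive` above; memo §3).  On the cross
`X_{lc}` the `s²`-coefficient of `per₄ (u + s y)` restricted to the nine block cells … (memo). -/
theorem stub_crossFive [CharZero K] :
    ∀ W : Submodule K (Fin 4 × Fin 4 → K), finrank K W = 5 → InCross W → PerDirFour W →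
      VFiveCrossType W := by
  intro W h5 hX hW
  obtain ⟨l, c, hX⟩ := hX
  obtain ⟨a, b, hac, hbl, hmem⟩ := crossFive W hX h5 hW
  exact ⟨l, c, a, b, hac, hbl, hmem⟩

/-! ## 2c. Leaf R2 — two zero rows (Lemma TwoRows, memo §4) — PROVED (rev 5): pointwise STAR/BIPARTITE
(✓ `star_or_bipartite_of_sum_sq_swap_rows`), prime avoidance along lines, claw-or-matching, two rank counts. -/

/-- The pairing entry `x_{km}(y) = y_{p,k} y_{q,m} + y_{p,m} y_{q,k}` of the live rows `p, q`. -/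
def xf (p q k m : Fin 4) (y : Fin 4 × Fin 4 → K) : K := y (p, k) * y (q, m) + y (p, m) * y (q, k)

theorem xf_comm (p q k m : Fin 4) (y : Fin 4 × Fin 4 → K) : xf p q k m y = xf p q m k y := by
  unfold xf; ring

theorem xf_swap (p q k m : Fin 4) (y : Fin 4 × Fin 4 → K) : xf q p k m y = xf p q k m y := by
  unfold xf; ring

/-- Polarisation of `x_{km}`. [folklore] -/
theorem xf_add (p q k m : Fin 4) (y y' : Fin 4 × Fin 4 → K) :
    xf p q k m (y + y') = xf p q k m y + xf p q k m y' +
      (y (p, k) * y' (q, m) + y' (p, k) * y (q, m) + y (p, m) * y' (q, k) + y' (p, m) * y (q, k)) := by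
  unfold xf; simp only [Pi.add_apply]; ring

/-- `x_{km}` is polynomial along lines. [folklore] -/
theorem xf_line (p q k m : Fin 4) (y₀ y : Fin 4 × Fin 4 → K) :
    ∃ P : K[X], ∀ t : K, xf p q k m (y₀ + t • y) = P.eval t := by
  refine ⟨Polynomial.C (xf p q k m y₀) +
      Polynomial.C (y₀ (p, k) * y (q, m) + y (p, k) * y₀ (q, m) + y₀ (p, m) * y (q, k) +
        y (p, m) * y₀ (q, k)) * Polynomial.X +
      Polynomial.C (xf p q k m y) * Polynomial.X ^ 2, fun t => ?_⟩
  simp only [xf, Pi.add_apply, Pi.smul_apply, smul_eq_mul, Polynomial.eval_add,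
    Polynomial.eval_mul, Polynomial.eval_C, Polynomial.eval_X, Polynomial.eval_pow]
  ring

/-- Products of two functions polynomial along lines are polynomial along lines. [folklore] -/
theorem mul_line {M : Type*} [AddCommGroup M] [Module K M] {f g : M → K}
    (hf : ∀ y₀ y : M, ∃ P : K[X], ∀ t : K, f (y₀ + t • y) = P.eval t)
    (hg : ∀ y₀ y : M, ∃ P : K[X], ∀ t : K, g (y₀ + t • y) = P.eval t) :
    ∀ y₀ y : M, ∃ P : K[X], ∀ t : K, f (y₀ + t • y) * g (y₀ + t • y) = P.eval t := by
  intro y₀ y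
  obtain ⟨P, hP⟩ := hf y₀ y
  obtain ⟨Q, hQ⟩ := hg y₀ y
  exact ⟨P * Q, fun t => by rw [hP, hQ, Polynomial.eval_mul]⟩

/-- **Prime avoidance for three functions polynomial along lines** (over an infinite field): if
`f g h ≡ 0` on a subspace `W` then one factor vanishes on `W`. [folklore] -/
theorem vanish_of_prod_three [Infinite K] {M : Type*} [AddCommGroup M] [Module K M]
    (W : Submodule K M) {f g h : M → K}
    (hf : ∀ y₀ y : M, ∃ P : K[X], ∀ t : K, f (y₀ + t • y) = P.eval t)
    (hg : ∀ y₀ y : M, ∃ P : K[X], ∀ t : K, g (y₀ + t • y) = P.eval t)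
    (hh : ∀ y₀ y : M, ∃ P : K[X], ∀ t : K, h (y₀ + t • y) = P.eval t)
    (H : ∀ y ∈ W, f y * g y * h y = 0) :
    (∀ y ∈ W, f y = 0) ∨ (∀ y ∈ W, g y = 0) ∨ (∀ y ∈ W, h y = 0) := by
  by_contra hcon
  push Not at hcon
  obtain ⟨⟨y₁, hy₁, hf₁⟩, ⟨y₂, hy₂, hg₂⟩, ⟨y₃, hy₃, hh₃⟩⟩ := hcon
  obtain ⟨y₄, hy₄, hf₄, hg₄⟩ :=
    SymPencilPerFourHessianMinors.exists_ne_zero_and_ne_zero W hf hg hy₁ hy₂ hf₁ hg₂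
  obtain ⟨y₅, hy₅, hfg₅, hh₅⟩ :=
    SymPencilPerFourHessianMinors.exists_ne_zero_and_ne_zero W (f := fun y => f y * g y)
      (mul_line hf hg) hh hy₄ hy₃ (mul_ne_zero hf₄ hg₄) hh₃
  exact mul_ne_zero hfg₅ hh₅ (H y₅ hy₅)

set_option linter.unusedSimpArgs false in
/-- **(I3) pointwise** — for a two-row `y` (live rows `p, q`) with a per-direction family of four
squares, each of the four products `∏_{m ≠ k} x_{km}(y)` vanishes … (details: memo `SING-FIVE-CLASSIFICATION.md`). [folklore] -/
theorem prods_eq_zero [CharZero K] {p q : Fin 4} (hpq : p ≠ q) (y : Fin 4 × Fin 4 → K)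
    (hy : ∀ i j : Fin 4, i ≠ p → i ≠ q → y (i, j) = 0) (c : Fin 4 → K)
    (Λ : Fin 4 → ((Fin 4 × Fin 4 → K) →ₗ[K] K))
    (h : ∀ u : Fin 4 × Fin 4 → K, ∃ e₀ e₁ : K, ∀ s : K,
      eval (u + s • y) (perPoly (Fin 4) K) = e₀ + s * e₁ + s ^ 2 * ∑ k, c k * (Λ k u) ^ 2) :
    xf p q 0 1 y * xf p q 0 2 y * xf p q 0 3 y = 0 ∧
    xf p q 0 1 y * xf p q 1 2 y * xf p q 1 3 y = 0 ∧
    xf p q 0 2 y * xf p q 1 2 y * xf p q 2 3 y = 0 ∧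
    xf p q 0 3 y * xf p q 1 3 y * xf p q 2 3 y = 0 := by
  have H := SymPencilPerFourTwoRowCorankTwo.star_or_bipartite_of_sum_sq_swap_rows
    (ι := Fin 4) (by simp) hpq y hy c Λ h
  dsimp only at H
  simp only [xf]
  rcases H with (⟨h1, h2, h3⟩ | ⟨h1, h2, h3⟩ | ⟨h1, h2, h3⟩ | ⟨h1, h2, h3⟩) |
    (⟨h1, h2, -⟩ | ⟨h1, h2, -⟩ | ⟨h1, h2, -⟩)
  · simp only [h1, h2, h3, zero_mul, mul_zero, and_self]
  · simp only [h1, h2, h3, zero_mul, mul_zero, and_self]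
  · simp only [h1, h2, h3, zero_mul, mul_zero, and_self]
  · simp only [h1, h2, h3, zero_mul, mul_zero, and_self]
  · simp only [h1, h2, zero_mul, mul_zero, and_self]
  · simp only [h1, h2, zero_mul, mul_zero, and_self]
  · simp only [h1, h2, zero_mul, mul_zero, and_self]

/-- **(I4), step 1** — on `W`, for every column `k` some `x_{k m(k)}` vanishes identically
(prime avoidance in the domain of polynomial functions on `W`). [folklore] -/
theorem zeroPairs [CharZero K] (W : Submodule K (Fin 4 × Fin 4 → K)) {p q : Fin 4} (hpq : p ≠ q)
    (hsupp : ∀ y ∈ W, ∀ i j : Fin 4, i ≠ p → i ≠ q → y (i, j) = 0)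
    (hP : ∀ y ∈ W, ∃ (c : Fin 4 → K) (Λ : Fin 4 → ((Fin 4 × Fin 4 → K) →ₗ[K] K)),
      ∀ u : Fin 4 × Fin 4 → K, ∃ e₀ e₁ : K, ∀ s : K,
        eval (u + s • y) (perPoly (Fin 4) K) = e₀ + s * e₁ + s ^ 2 * ∑ k, c k * (Λ k u) ^ 2) :
    ((∀ y ∈ W, xf p q 0 1 y = 0) ∨ (∀ y ∈ W, xf p q 0 2 y = 0) ∨ (∀ y ∈ W, xf p q 0 3 y = 0)) ∧
    ((∀ y ∈ W, xf p q 0 1 y = 0) ∨ (∀ y ∈ W, xf p q 1 2 y = 0) ∨ (∀ y ∈ W, xf p q 1 3 y = 0)) ∧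
    ((∀ y ∈ W, xf p q 0 2 y = 0) ∨ (∀ y ∈ W, xf p q 1 2 y = 0) ∨ (∀ y ∈ W, xf p q 2 3 y = 0)) ∧
    ((∀ y ∈ W, xf p q 0 3 y = 0) ∨ (∀ y ∈ W, xf p q 1 3 y = 0) ∨ (∀ y ∈ W, xf p q 2 3 y = 0)) := by
  have H : ∀ y ∈ W,
      xf p q 0 1 y * xf p q 0 2 y * xf p q 0 3 y = 0 ∧
      xf p q 0 1 y * xf p q 1 2 y * xf p q 1 3 y = 0 ∧
      xf p q 0 2 y * xf p q 1 2 y * xf p q 2 3 y = 0 ∧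
      xf p q 0 3 y * xf p q 1 3 y * xf p q 2 3 y = 0 := by
    intro y hy
    obtain ⟨c, Λ, h⟩ := hP y hy
    exact prods_eq_zero hpq y (hsupp y hy) c Λ h
  refine ⟨?_, ?_, ?_, ?_⟩
  · exact vanish_of_prod_three W (xf_line p q 0 1) (xf_line p q 0 2) (xf_line p q 0 3)
      fun y hy => (H y hy).1
  · exact vanish_of_prod_three W (xf_line p q 0 1) (xf_line p q 1 2) (xf_line p q 1 3)
      fun y hy => (H y hy).2.1
  · exact vanish_of_prod_three W (xf_line p q 0 2) (xf_line p q 1 2) (xf_line p q 2 3)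
      fun y hy => (H y hy).2.2.1
  · exact vanish_of_prod_three W (xf_line p q 0 3) (xf_line p q 1 3) (xf_line p q 2 3)
      fun y hy => (H y hy).2.2.2

set_option linter.unusedSimpArgs false in
/-- A graph on four vertices with minimum degree `≥ 1` contains a claw `K_{1,3}` or a perfect
matching. [folklore] -/
theorem claw_or_matching {Z01 Z02 Z03 Z12 Z13 Z23 : Prop} (h0 : Z01 ∨ Z02 ∨ Z03)
    (h1 : Z01 ∨ Z12 ∨ Z13) (h2 : Z02 ∨ Z12 ∨ Z23) (h3 : Z03 ∨ Z13 ∨ Z23) :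
    (Z01 ∧ Z02 ∧ Z03) ∨ (Z01 ∧ Z12 ∧ Z13) ∨ (Z02 ∧ Z12 ∧ Z23) ∨ (Z03 ∧ Z13 ∧ Z23) ∨
    (Z01 ∧ Z23) ∨ (Z02 ∧ Z13) ∨ (Z03 ∧ Z12) := by
  rcases h0 with a | a | a
  · rcases h2 with c | c | c <;> rcases h3 with d | d | d <;>
      simp only [a, c, d, and_self, true_and, and_true, true_or, or_true]
  · rcases h1 with c | c | c <;> rcases h3 with d | d | d <;>
      simp only [a, c, d, and_self, true_and, and_true, true_or, or_true]
  · rcases h1 with c | c | c <;> rcases h2 with d | d | d <;>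
      simp only [a, c, d, and_self, true_and, and_true, true_or, or_true]

/-- A two-row matrix with both live rows zero is zero. -/
theorem eq_zero_of_rows {p q : Fin 4} {z : Fin 4 × Fin 4 → K}
    (hz : ∀ i j : Fin 4, i ≠ p → i ≠ q → z (i, j) = 0) (hp : ∀ j, z (p, j) = 0)
    (hq : ∀ j, z (q, j) = 0) : z = 0 := by
  funext ⟨i, j⟩
  by_cases hip : i = p
  · subst hip; exact hp j
  by_cases hiq : i = q
  · subst hiq; exact hq j
  exact hz i j hip hiq

/-- **(I4), CLAW** — if `x_{km} ≡ 0` on `W` for all `m ≠ k` and some element of `W` has a non-zero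
`(p,k)` entry, then `dim W ≤ 4`: rank count on `ℓ_k = (y_{p,k}, y_{q,k})`. [folklore] -/
theorem claw_aux [CharZero K] (W : Submodule K (Fin 4 × Fin 4 → K)) (h5 : finrank K W = 5)
    {p q : Fin 4} (hsupp : ∀ y ∈ W, ∀ i j : Fin 4, i ≠ p → i ≠ q → y (i, j) = 0)
    (k : Fin 4) (hZ : ∀ m, m ≠ k → ∀ y ∈ W, xf p q k m y = 0)
    {y₀ : Fin 4 × Fin 4 → K} (hy₀ : y₀ ∈ W) (ha : y₀ (p, k) ≠ 0) : False := by
  classical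
  have pol : ∀ y ∈ W, ∀ y' ∈ W, ∀ m, m ≠ k →
      y (p, k) * y' (q, m) + y' (p, k) * y (q, m) + y (p, m) * y' (q, k) + y' (p, m) * y (q, k)
        = 0 := by
    intro y hy y' hy' m hm
    have h1 := hZ m hm y hy
    have h2 := hZ m hm y' hy'
    have h3 := hZ m hm (y + y') (W.add_mem hy hy')
    rw [xf_add] at h3
    linear_combination h3 - h1 - h2
  set a := y₀ (p, k) with ha_def
  set b := y₀ (q, k) with hb_def
  by_cases hB : ∀ y ∈ W, a * y (q, k) = b * y (p, k)
  · -- rank one: `a y_{q,m} + b y_{p,m} ≡ 0` for `m ≠ k`, so `y ↦ y_p` is injective on `W`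
    have hlin : ∀ m, m ≠ k → ∀ y ∈ W, a * y (q, m) + b * y (p, m) = 0 := by
      intro m hm
      have hprod : ∀ y ∈ W, ∏ i ∈ (Finset.univ : Finset (Fin 2)),
          (![LinearMap.proj (p, k), a • LinearMap.proj (q, m) + b • LinearMap.proj (p, m)] :
            Fin 2 → ((Fin 4 × Fin 4 → K) →ₗ[K] K)) i y = 0 := by
        intro y hy
        have h1 := hZ m hm y hy
        have h2 := hB y hy
        unfold xf at h1
        simp only [Fin.prod_univ_two, Matrix.cons_val_zero, Matrix.cons_val_one,
          LinearMap.proj_apply, LinearMap.add_apply, LinearMap.smul_apply, smul_eq_mul]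
        linear_combination a * h1 - y (p, m) * h2
      obtain ⟨i, -, hi⟩ :=
        SymPencilPerFourPairingHyperplane.exists_forall_eq_zero_of_prod_eq_zero W _ _ hprod
      fin_cases i
      · exact (ha (by simpa using hi y₀ hy₀)).elim
      · intro y hy
        simpa using hi y hy
    have hinj : Function.Injective ((LinearMap.pi fun m : Fin 4 =>
        (LinearMap.proj (p, m) : (Fin 4 × Fin 4 → K) →ₗ[K] K)).comp W.subtype) := by
      rw [injective_iff_map_eq_zero]
      intro z hz
      have hzp : ∀ j, (z : Fin 4 × Fin 4 → K) (p, j) = 0 := fun j => by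
        have := congr_fun hz j
        simpa using this
      have hzq : ∀ j, (z : Fin 4 × Fin 4 → K) (q, j) = 0 := by
        intro j
        by_cases hj : j = k
        · subst hj
          have := hB z z.2
          rw [hzp, mul_zero] at this
          exact (mul_eq_zero.1 this).resolve_left ha
        · have := hlin j hj z z.2
          rw [hzp, mul_zero, add_zero] at this
          exact (mul_eq_zero.1 this).resolve_left ha
      have : (z : Fin 4 × Fin 4 → K) = 0 := eq_zero_of_rows (hsupp z z.2) hzp hzq
      exact (Submodule.coe_eq_zero).1 this
    have hle := LinearMap.finrank_le_finrank_of_injective hinj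
    simp [h5] at hle
  · -- rank two: the kernel of `ℓ_k` on `W` is trivial, but `dim W = 5 > 2`
    push Not at hB
    obtain ⟨y₁, hy₁, hne⟩ := hB
    set ℓ : ↥W →ₗ[K] (Fin 2 → K) := LinearMap.pi
      (![(LinearMap.proj (p, k)).comp W.subtype, (LinearMap.proj (q, k)).comp W.subtype] :
        Fin 2 → (↥W →ₗ[K] K)) with hℓ
    have hker : LinearMap.ker ℓ ≠ ⊥ := LinearMap.ker_ne_bot_of_finrank_lt (by simp [h5])
    obtain ⟨z, hzker, hz0⟩ := Submodule.exists_mem_ne_zero_of_ne_bot hker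
    have hzk := LinearMap.mem_ker.1 hzker
    have hzp : (z : Fin 4 × Fin 4 → K) (p, k) = 0 := by
      have := congr_fun hzk 0; simpa [hℓ] using this
    have hzq : (z : Fin 4 × Fin 4 → K) (q, k) = 0 := by
      have := congr_fun hzk 1; simpa [hℓ] using this
    have hrow : ∀ m, (z : Fin 4 × Fin 4 → K) (p, m) = 0 ∧ (z : Fin 4 × Fin 4 → K) (q, m) = 0 := by
      intro m
      by_cases hm : m = k
      · subst hm; exact ⟨hzp, hzq⟩
      have e0 := pol y₀ hy₀ z z.2 m hm
      have e1 := pol y₁ hy₁ z z.2 m hm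
      rw [hzp, hzq] at e0 e1
      have d0 : (z : Fin 4 × Fin 4 → K) (q, m) * (a * y₁ (q, k) - b * y₁ (p, k)) = 0 := by
        linear_combination y₁ (q, k) * e0 - b * e1
      have d1 : (z : Fin 4 × Fin 4 → K) (p, m) * (a * y₁ (q, k) - b * y₁ (p, k)) = 0 := by
        linear_combination (-(y₁ (p, k))) * e0 + a * e1
      exact ⟨(mul_eq_zero.1 d1).resolve_right (sub_ne_zero.2 hne),
        (mul_eq_zero.1 d0).resolve_right (sub_ne_zero.2 hne)⟩
    have : (z : Fin 4 × Fin 4 → K) = 0 :=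
      eq_zero_of_rows (hsupp z z.2) (fun m => (hrow m).1) (fun m => (hrow m).2)
    exact hz0 ((Submodule.coe_eq_zero).1 this)

/-- **Totally isotropic subspaces of the split rank-four form `v₀w₁ + v₁w₀ + v₂w₃ + v₃w₂` have
dimension `≤ 2`** (duality: `I ↪ I^⊥ = ann I`). [folklore] -/
theorem finrank_le_two_of_isotropic (I : Submodule K (Fin 4 → K))
    (h : ∀ v ∈ I, ∀ w ∈ I, v 0 * w 1 + v 1 * w 0 + v 2 * w 3 + v 3 * w 2 = 0) :
    finrank K I ≤ 2 := by
  classical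
  let D : (Fin 4 → K) →ₗ[K] Module.Dual K (Fin 4 → K) :=
    LinearMap.mk₂ K (fun v w => v 0 * w 1 + v 1 * w 0 + v 2 * w 3 + v 3 * w 2)
      (fun v v' w => by simp only [Pi.add_apply]; ring)
      (fun c v w => by simp only [Pi.smul_apply, smul_eq_mul]; ring)
      (fun v w w' => by simp only [Pi.add_apply]; ring)
      (fun c v w => by simp only [Pi.smul_apply, smul_eq_mul]; ring)
  have hDapp : ∀ v w, D v w = v 0 * w 1 + v 1 * w 0 + v 2 * w 3 + v 3 * w 2 := fun v w => rfl
  have hD : Function.Injective D := by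
    rw [injective_iff_map_eq_zero]
    intro v hv
    have e : ∀ i, D v (Pi.single i 1) = 0 := fun i => by rw [hv]; rfl
    funext i
    fin_cases i
    · have := e 1; simpa [hDapp] using this
    · have := e 0; simpa [hDapp] using this
    · have := e 3; simpa [hDapp] using this
    · have := e 2; simpa [hDapp] using this
  have hle : I.map D ≤ I.dualAnnihilator := by
    rintro φ ⟨v, hv, rfl⟩
    rw [Submodule.mem_dualAnnihilator]
    intro w hw
    rw [hDapp]
    exact h v hv w hw
  have h1 : finrank K (I.map D) = finrank K I :=
    (Submodule.equivMapOfInjective D hD I).finrank_eq.symm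
  have h2 := Subspace.finrank_add_finrank_dualAnnihilator_eq I
  have h3 := Submodule.finrank_mono hle
  have h4 : finrank K (Fin 4 → K) = 4 := by simp
  omega

/-- **(I4), MATCHING** — `x_{ab} ≡ x_{cd} ≡ 0` on `W` with `{a,b,c,d} = Fin 4` forces
`dim W ≤ 2 + 2 < 5`. [folklore] -/
theorem matching_absurd [CharZero K] (W : Submodule K (Fin 4 × Fin 4 → K)) (h5 : finrank K W = 5)
    {p q : Fin 4} (hsupp : ∀ y ∈ W, ∀ i j : Fin 4, i ≠ p → i ≠ q → y (i, j) = 0)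
    {a b c d : Fin 4} (hcover : ∀ i : Fin 4, i = a ∨ i = b ∨ i = c ∨ i = d)
    (hab : ∀ y ∈ W, xf p q a b y = 0) (hcd : ∀ y ∈ W, xf p q c d y = 0) : False := by
  classical
  let L : Fin 4 → Fin 4 → ((Fin 4 × Fin 4 → K) →ₗ[K] (Fin 4 → K)) := fun a b =>
    LinearMap.pi (![LinearMap.proj (p, a), LinearMap.proj (q, b), LinearMap.proj (p, b),
      LinearMap.proj (q, a)] : Fin 4 → ((Fin 4 × Fin 4 → K) →ₗ[K] K))
  have hL0 : ∀ a b y, L a b y 0 = y (p, a) := fun a b y => rfl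
  have hL1 : ∀ a b y, L a b y 1 = y (q, b) := fun a b y => rfl
  have hL2 : ∀ a b y, L a b y 2 = y (p, b) := fun a b y => rfl
  have hL3 : ∀ a b y, L a b y 3 = y (q, a) := fun a b y => rfl
  have hiso : ∀ a b, (∀ y ∈ W, xf p q a b y = 0) → ∀ y ∈ W, ∀ y' ∈ W,
      L a b y 0 * L a b y' 1 + L a b y 1 * L a b y' 0 + L a b y 2 * L a b y' 3 +
        L a b y 3 * L a b y' 2 = 0 := by
    intro a b hZ y hy y' hy'
    have h1 := hZ y hy
    have h2 := hZ y' hy'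
    have h3 := hZ (y + y') (W.add_mem hy hy')
    rw [xf_add] at h3
    simp only [hL0, hL1, hL2, hL3]
    linear_combination h3 - h1 - h2
  set L₁W : ↥W →ₗ[K] (Fin 4 → K) := (L a b).comp W.subtype with hL₁W
  have hr₁ : finrank K (LinearMap.range L₁W) ≤ 2 :=
    finrank_le_two_of_isotropic _ (by
      rintro v ⟨y, rfl⟩ w ⟨y', rfl⟩
      exact hiso a b hab y y.2 y' y'.2)
  set L₂K : ↥(LinearMap.ker L₁W) →ₗ[K] (Fin 4 → K) :=
    ((L c d).comp W.subtype).comp (LinearMap.ker L₁W).subtype with hL₂K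
  have hr₂ : finrank K (LinearMap.range L₂K) ≤ 2 :=
    finrank_le_two_of_isotropic _ (by
      rintro v ⟨z, rfl⟩ w ⟨z', rfl⟩
      exact hiso c d hcd (z : ↥W) (z : ↥W).2 (z' : ↥W) (z' : ↥W).2)
  have hinj : Function.Injective L₂K := by
    rw [injective_iff_map_eq_zero]
    intro z hz
    have hz1 : L a b ((z : ↥W) : Fin 4 × Fin 4 → K) = 0 := LinearMap.mem_ker.1 z.2
    have hz2 : L c d ((z : ↥W) : Fin 4 × Fin 4 → K) = 0 := hz
    have H8 : ∀ i, ((z : ↥W) : Fin 4 × Fin 4 → K) (p, i) = 0 ∧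
        ((z : ↥W) : Fin 4 × Fin 4 → K) (q, i) = 0 := by
      have e1 := fun i => congr_fun hz1 i
      have e2 := fun i => congr_fun hz2 i
      intro i
      rcases hcover i with rfl | rfl | rfl | rfl
      · exact ⟨by simpa [hL0] using e1 0, by simpa [hL3] using e1 3⟩
      · exact ⟨by simpa [hL2] using e1 2, by simpa [hL1] using e1 1⟩
      · exact ⟨by simpa [hL0] using e2 0, by simpa [hL3] using e2 3⟩
      · exact ⟨by simpa [hL2] using e2 2, by simpa [hL1] using e2 1⟩
    have hz0 : ((z : ↥W) : Fin 4 × Fin 4 → K) = 0 :=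
      eq_zero_of_rows (hsupp _ (z : ↥W).2) (fun j => (H8 j).1) (fun j => (H8 j).2)
    exact Subtype.ext ((Submodule.coe_eq_zero).1 hz0)
  have hk : finrank K (LinearMap.range L₂K) = finrank K (LinearMap.ker L₁W) :=
    LinearMap.finrank_range_of_inj hinj
  have hrn := LinearMap.finrank_range_add_finrank_ker L₁W
  omega

/-- **(I4) = Lemma TwoRows** — a `5`-dimensional two-row space (live rows `p ≠ q`) with a
per-direction family of four squares has a common zero column of its live rows. [folklore] -/
theorem twoRows_common_col [CharZero K] (W : Submodule K (Fin 4 × Fin 4 → K))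
    (h5 : finrank K W = 5) {p q : Fin 4} (hpq : p ≠ q)
    (hsupp : ∀ y ∈ W, ∀ i j : Fin 4, i ≠ p → i ≠ q → y (i, j) = 0)
    (hP : ∀ y ∈ W, ∃ (c : Fin 4 → K) (Λ : Fin 4 → ((Fin 4 × Fin 4 → K) →ₗ[K] K)),
      ∀ u : Fin 4 × Fin 4 → K, ∃ e₀ e₁ : K, ∀ s : K,
        eval (u + s • y) (perPoly (Fin 4) K) = e₀ + s * e₁ + s ^ 2 * ∑ k, c k * (Λ k u) ^ 2) :
    ∃ m : Fin 4, ∀ y ∈ W, y (p, m) = 0 ∧ y (q, m) = 0 := by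
  obtain ⟨h0, h1, h2, h3⟩ := zeroPairs W hpq hsupp hP
  have claw : ∀ k, (∀ m, m ≠ k → ∀ y ∈ W, xf p q k m y = 0) →
      ∃ m : Fin 4, ∀ y ∈ W, y (p, m) = 0 ∧ y (q, m) = 0 := by
    intro k hZ
    refine ⟨k, fun y hy => ?_⟩
    by_contra hne
    rcases not_and_or.1 hne with h | h
    · exact claw_aux W h5 hsupp k hZ hy h
    · exact claw_aux W h5 (fun y hy i j hiq hip => hsupp y hy i j hip hiq) k
        (fun m hm y hy => by rw [xf_swap]; exact hZ m hm y hy) hy h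
  have hmatch : ∀ a b c d : Fin 4, (∀ i : Fin 4, i = a ∨ i = b ∨ i = c ∨ i = d) →
      (∀ y ∈ W, xf p q a b y = 0) → (∀ y ∈ W, xf p q c d y = 0) →
      ∃ m : Fin 4, ∀ y ∈ W, y (p, m) = 0 ∧ y (q, m) = 0 :=
    fun a b c d hc hab hcd => (matching_absurd W h5 hsupp hc hab hcd).elim
  have sy : ∀ k m, (∀ y ∈ W, xf p q k m y = 0) → ∀ y ∈ W, xf p q m k y = 0 :=
    fun k m hz y hy => by rw [xf_comm]; exact hz y hy
  rcases claw_or_matching h0 h1 h2 h3 with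
    ⟨z1, z2, z3⟩ | ⟨z1, z2, z3⟩ | ⟨z1, z2, z3⟩ | ⟨z1, z2, z3⟩ | ⟨z1, z2⟩ | ⟨z1, z2⟩ | ⟨z1, z2⟩
  · refine claw 0 fun m hm => ?_
    fin_cases m
    · exact absurd rfl hm
    · exact z1
    · exact z2
    · exact z3
  · refine claw 1 fun m hm => ?_
    fin_cases m
    · exact sy 0 1 z1
    · exact absurd rfl hm
    · exact z2
    · exact z3
  · refine claw 2 fun m hm => ?_
    fin_cases m
    · exact sy 0 2 z1
    · exact sy 1 2 z2
    · exact absurd rfl hm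
    · exact z3
  · refine claw 3 fun m hm => ?_
    fin_cases m
    · exact sy 0 3 z1
    · exact sy 1 3 z2
    · exact sy 2 3 z3
    · exact absurd rfl hm
  · exact hmatch 0 1 2 3 (by decide) z1 z2
  · exact hmatch 0 2 1 3 (by decide) z1 z2
  · exact hmatch 0 3 1 2 (by decide) z1 z2

/-- the two live rows complementary to two given zero rows -/
theorem live_rows : ∀ p' q' : Fin 4, p' ≠ q' → ∃ p q : Fin 4, p ≠ q ∧ p ≠ p' ∧ p ≠ q' ∧ q ≠ p' ∧
    q ≠ q' ∧ ∀ i : Fin 4, i = p' ∨ i = q' ∨ i = p ∨ i = q := by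
  decide

/-- **Leaf R2** (`stub_twoZeroRows` unfolded). [folklore] -/
theorem twoZeroRows_leaf [CharZero K] (W : Submodule K (Fin 4 × Fin 4 → K))
    (h5 : finrank K W = 5) (h2 : TwoZeroRows W)
    (hP : ∀ y ∈ W, ∃ (c : Fin 4 → K) (Λ : Fin 4 → ((Fin 4 × Fin 4 → K) →ₗ[K] K)),
      ∀ u : Fin 4 × Fin 4 → K, ∃ e₀ e₁ : K, ∀ s : K,
        eval (u + s • y) (perPoly (Fin 4) K) = e₀ + s * e₁ + s ^ 2 * ∑ k, c k * (Λ k u) ^ 2) :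
    ∃ p q m : Fin 4, p ≠ q ∧
      ∀ x ∈ W, (∀ i j : Fin 4, i ≠ p → i ≠ q → x (i, j) = 0) ∧ x (p, m) = 0 ∧ x (q, m) = 0 := by
  obtain ⟨p', q', hp'q', hrows⟩ := h2
  obtain ⟨p, q, hpq, hpp', hpq', hqp', hqq', hcov⟩ := live_rows p' q' hp'q'
  have hsupp : ∀ y ∈ W, ∀ i j : Fin 4, i ≠ p → i ≠ q → y (i, j) = 0 := by
    intro y hy i j hip hiq
    rcases hcov i with rfl | rfl | rfl | rfl
    · exact (hrows y hy j).1
    · exact (hrows y hy j).2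
    · exact absurd rfl hip
    · exact absurd rfl hiq
  obtain ⟨m, hm⟩ := twoRows_common_col W h5 hpq hsupp hP
  exact ⟨p, q, m, hpq, fun x hx => ⟨hsupp x hx, (hm x hx).1, (hm x hx).2⟩⟩

/-- **Leaf R2 = Lemma TwoRows** (PROVED in rev 5, §2c above; memo §4).  Two live rows `α, β`; with
`x_{km} := α_kβ_m + α_mβ_k` the Hessian block is `P(α,β) = (x_{∁{k,l}})_{k≠l}` … (memo). -/
theorem stub_twoZeroRows [CharZero K] :
    ∀ W : Submodule K (Fin 4 × Fin 4 → K), finrank K W = 5 → TwoZeroRows W → PerDirFour W →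
      ∃ p q m : Fin 4, p ≠ q ∧ InWCol W p q m := by
  intro W h5 h2 hP
  exact twoZeroRows_leaf W h5 h2 hP

/-! ## 2b. Leaf E — PROVED (rev 4): hyperplanes of `W_col` with a per-point family of four squares -/

/-- `per₄` at the base point `u = E₂₃ + ν₀E₃₀ + ν₁E₃₁ + ν₂E₃₂` plus `s ·` (an element of
`W_col(0,1;3)`) is exactly `s² · P_ν(y)`, `P_ν(y) = αᵀ N(ν) β` for the live rows `α, β` … (memo). [folklore] -/
theorem eval_wcol_point (y : Fin 4 × Fin 4 → K) (h2 : ∀ j, y (2, j) = 0) (h3 : ∀ j, y (3, j) = 0)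
    (h03 : y (0, 3) = 0) (h13 : y (1, 3) = 0) (ν₀ ν₁ ν₂ : K) (u : Fin 4 × Fin 4 → K)
    (hu : ∀ p, u p = if p = (2, 3) then 1 else if p = (3, 0) then ν₀ else if p = (3, 1) then ν₁
      else if p = (3, 2) then ν₂ else 0) (s : K) :
    eval (u + s • y) (perPoly (Fin 4) K) = 0 + s * 0 + s ^ 2 *
      (ν₀ * (y (0, 1) * y (1, 2) + y (0, 2) * y (1, 1)) +
        ν₁ * (y (0, 0) * y (1, 2) + y (0, 2) * y (1, 0)) +
        ν₂ * (y (0, 0) * y (1, 1) + y (0, 1) * y (1, 0))) := by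
  obtain ⟨f01, f02, f03, f10, f12, f13, f20, f21, f23, f30, f31, f32⟩ :
      (((0 : Fin 4) = 1) = False) ∧ (((0 : Fin 4) = 2) = False) ∧ (((0 : Fin 4) = 3) = False) ∧
      (((1 : Fin 4) = 0) = False) ∧ (((1 : Fin 4) = 2) = False) ∧ (((1 : Fin 4) = 3) = False) ∧
      (((2 : Fin 4) = 0) = False) ∧ (((2 : Fin 4) = 1) = False) ∧ (((2 : Fin 4) = 3) = False) ∧
      (((3 : Fin 4) = 0) = False) ∧ (((3 : Fin 4) = 1) = False) ∧ (((3 : Fin 4) = 2) = False) := by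
    refine ⟨?_, ?_, ?_, ?_, ?_, ?_, ?_, ?_, ?_, ?_, ?_, ?_⟩ <;> decide
  have y20 := h2 0; have y21 := h2 1; have y22 := h2 2; have y23 := h2 3
  have y30 := h3 0; have y31 := h3 1; have y32 := h3 2; have y33 := h3 3
  rw [eval_perPoly, Matrix.permanent_fin_four_row]
  simp only [Matrix.of_apply, Pi.add_apply, Pi.smul_apply, smul_eq_mul, hu, Prod.mk.injEq,
    f01, f02, f03, f10, f12, f13, f20, f21, f23, f30, f31, f32, and_true, and_false, if_true,
    if_false, y20, y21, y22, y23, y30, y31, y32, y33, h03, h13]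
  ring

/-- Decomposition of a live vector of `W_col(0,1;3)` into the six live cells. [folklore] -/
theorem live_decomp (x : Fin 4 × Fin 4 → K) (h2 : ∀ j, x (2, j) = 0) (h3 : ∀ j, x (3, j) = 0)
    (h03 : x (0, 3) = 0) (h13 : x (1, 3) = 0) :
    x = x (0, 0) • (Pi.single ((0 : Fin 4), (0 : Fin 4)) (1 : K) : Fin 4 × Fin 4 → K) +
      x (0, 1) • (Pi.single ((0 : Fin 4), (1 : Fin 4)) (1 : K) : Fin 4 × Fin 4 → K) +
      x (0, 2) • (Pi.single ((0 : Fin 4), (2 : Fin 4)) (1 : K) : Fin 4 × Fin 4 → K) +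
      x (1, 0) • (Pi.single ((1 : Fin 4), (0 : Fin 4)) (1 : K) : Fin 4 × Fin 4 → K) +
      x (1, 1) • (Pi.single ((1 : Fin 4), (1 : Fin 4)) (1 : K) : Fin 4 × Fin 4 → K) +
      x (1, 2) • (Pi.single ((1 : Fin 4), (2 : Fin 4)) (1 : K) : Fin 4 × Fin 4 → K) := by
  have y20 := h2 0; have y21 := h2 1; have y22 := h2 2; have y23 := h2 3
  have y30 := h3 0; have y31 := h3 1; have y32 := h3 2; have y33 := h3 3
  ext ⟨i, j⟩
  fin_cases i <;> fin_cases j <;> simp [y20, y21, y22, y23, y30, y31, y32, y33, h03, h13]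

/-- Coefficients of the adjugate identity `φ₀ᵀ adj N(ν) φ₁ = 0` on the torus: seven evaluations
kill the quadratic in `ν`. [folklore] -/
theorem coeffs_of_adj_identity [CharZero K] {A0 A1 A2 S01 S02 S12 : K}
    (hF : ∀ ν₀ ν₁ ν₂ : K, ν₀ * ν₁ * ν₂ ≠ 0 →
      -(ν₀ ^ 2 * A0) - ν₁ ^ 2 * A1 - ν₂ ^ 2 * A2 + ν₀ * ν₁ * S01 + ν₀ * ν₂ * S02 +
        ν₁ * ν₂ * S12 = 0) :
    A0 = 0 ∧ A1 = 0 ∧ A2 = 0 ∧ S01 = 0 ∧ S02 = 0 ∧ S12 = 0 := by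
  have h2 : (2 : K) ≠ 0 := two_ne_zero
  have hm1 : (-1 : K) ≠ 0 := by norm_num
  have g1 := hF 1 1 1 (by norm_num)
  have g2 := hF (-1) 1 1 (by norm_num)
  have g3 := hF 1 (-1) 1 (by norm_num)
  have g4 := hF 1 1 (-1) (by norm_num)
  have g5 := hF 2 1 1 (by norm_num)
  have g6 := hF 1 2 1 (by norm_num)
  have g7 := hF 1 1 2 (by norm_num)
  have hS01 : S01 = 0 := by linear_combination (g1 - g2 - g3 + g4) / 4
  have hS02 : S02 = 0 := by linear_combination (g1 - g2 + g3 - g4) / 4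
  have hS12 : S12 = 0 := by linear_combination (g1 + g2 - g3 - g4) / 4
  have hA0 : A0 = 0 := by linear_combination (3 * g1 - g2 - 2 * g5) / 6
  have hA1 : A1 = 0 := by linear_combination (3 * g1 - g3 - 2 * g6) / 6
  have hA2 : A2 = 0 := by linear_combination (3 * g1 - g4 - 2 * g7) / 6
  exact ⟨hA0, hA1, hA2, hS01, hS02, hS12⟩

/-- `φ₀ ⊗ φ₁ + φ₁ ⊗ φ₀ = 0` forces `φ₀ = 0 ∨ φ₁ = 0`. [folklore] -/
theorem pureRow_of_symm_prod {φ00 φ01 φ02 φ10 φ11 φ12 : K}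
    (hA0 : φ00 * φ10 = 0) (hA1 : φ01 * φ11 = 0) (hA2 : φ02 * φ12 = 0)
    (hS01 : φ00 * φ11 + φ01 * φ10 = 0) (hS02 : φ00 * φ12 + φ02 * φ10 = 0)
    (hS12 : φ01 * φ12 + φ02 * φ11 = 0) :
    (φ00 = 0 ∧ φ01 = 0 ∧ φ02 = 0) ∨ (φ10 = 0 ∧ φ11 = 0 ∧ φ12 = 0) := by
  by_cases h00 : φ00 = 0
  · by_cases h01 : φ01 = 0
    · by_cases h02 : φ02 = 0
      · exact Or.inl ⟨h00, h01, h02⟩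
      · right
        have h12 : φ12 = 0 := (mul_eq_zero.1 hA2).resolve_left h02
        have h10 : φ10 = 0 := by
          have : φ02 * φ10 = 0 := by linear_combination hS02 - φ12 * h00
          exact (mul_eq_zero.1 this).resolve_left h02
        have h11 : φ11 = 0 := by
          have : φ02 * φ11 = 0 := by linear_combination hS12 - φ12 * h01
          exact (mul_eq_zero.1 this).resolve_left h02
        exact ⟨h10, h11, h12⟩
    · right
      have h11 : φ11 = 0 := (mul_eq_zero.1 hA1).resolve_left h01
      have h10 : φ10 = 0 := by
        have : φ01 * φ10 = 0 := by linear_combination hS01 - φ11 * h00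
        exact (mul_eq_zero.1 this).resolve_left h01
      have h12 : φ12 = 0 := by
        have : φ01 * φ12 = 0 := by linear_combination hS12 - φ02 * h11
        exact (mul_eq_zero.1 this).resolve_left h01
      exact ⟨h10, h11, h12⟩
  · right
    have h10 : φ10 = 0 := (mul_eq_zero.1 hA0).resolve_left h00
    have h11 : φ11 = 0 := by
      have : φ00 * φ11 = 0 := by linear_combination hS01 - φ01 * h10
      exact (mul_eq_zero.1 this).resolve_left h00
    have h12 : φ12 = 0 := by
      have : φ00 * φ12 = 0 := by linear_combination hS02 - φ02 * h10
      exact (mul_eq_zero.1 this).resolve_left h00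
    exact ⟨h10, h11, h12⟩

/-- The elementary matrix of a cell. -/
def cellE (p : Fin 4 × Fin 4) : Fin 4 × Fin 4 → K := Pi.single p 1

theorem cellE_apply (p q : Fin 4 × Fin 4) : cellE (K := K) p q = if q = p then 1 else 0 := by
  simp only [cellE, Pi.single_apply]

/-- **Leaf E in normal position** (`W_col(0,1;3)`: rows `2,3` dead, column `3` dead): a
`5`-dimensional `W ⊆ W_col(0,1;3)` with a per-POINT family of four squares is a torus … (memo). [folklore] -/
theorem wcolFive01 [CharZero K] (W : Submodule K (Fin 4 × Fin 4 → K)) (h5 : finrank K W = 5)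
    (hWc : ∀ x ∈ W, (∀ j, x (2, j) = 0) ∧ (∀ j, x (3, j) = 0) ∧ x (0, 3) = 0 ∧ x (1, 3) = 0)
    (hP : ∀ u : Fin 4 × Fin 4 → K, ∃ (c : Fin 4 → K) (Λ : Fin 4 → ((Fin 4 × Fin 4 → K) →ₗ[K] K)),
      ∀ y ∈ W, ∃ e₀ e₁ : K, ∀ s : K,
        eval (u + s • y) (perPoly (Fin 4) K) = e₀ + s * e₁ + s ^ 2 * ∑ k, c k * (Λ k y) ^ 2) :
    ∃ (i : Fin 4) (θ : Fin 4 → K), (i = 0 ∨ i = 1) ∧ θ 3 = 0 ∧ θ ≠ 0 ∧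
      ∀ x : Fin 4 × Fin 4 → K, x ∈ W ↔
        ((∀ j, x (2, j) = 0) ∧ (∀ j, x (3, j) = 0) ∧ x (0, 3) = 0 ∧ x (1, 3) = 0 ∧
          ∑ j, θ j * x (i, j) = 0) := by
  classical
  obtain ⟨f01, f02, f03, f10, f12, f13, f20, f21, f23, f30, f31, f32⟩ :
      (((0 : Fin 4) = 1) = False) ∧ (((0 : Fin 4) = 2) = False) ∧ (((0 : Fin 4) = 3) = False) ∧
      (((1 : Fin 4) = 0) = False) ∧ (((1 : Fin 4) = 2) = False) ∧ (((1 : Fin 4) = 3) = False) ∧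
      (((2 : Fin 4) = 0) = False) ∧ (((2 : Fin 4) = 1) = False) ∧ (((2 : Fin 4) = 3) = False) ∧
      (((3 : Fin 4) = 0) = False) ∧ (((3 : Fin 4) = 1) = False) ∧ (((3 : Fin 4) = 2) = False) := by
    refine ⟨?_, ?_, ?_, ?_, ?_, ?_, ?_, ?_, ?_, ?_, ?_, ?_⟩ <;> decide
  have hLcard : (Finset.univ.filter fun p : Fin 4 × Fin 4 => (p.1 = 0 ∨ p.1 = 1) ∧ p.2 ≠ 3).card
      = 6 := by decide
  have hLcases : ∀ p ∈ (Finset.univ.filter fun p : Fin 4 × Fin 4 => (p.1 = 0 ∨ p.1 = 1) ∧ p.2 ≠ 3),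
      p = (0, 0) ∨ p = (0, 1) ∨ p = (0, 2) ∨ p = (1, 0) ∨ p = (1, 1) ∨ p = (1, 2) := by decide
  have hLin : ((0, 0) : Fin 4 × Fin 4) ∈ (Finset.univ.filter fun p : Fin 4 × Fin 4 =>
      (p.1 = 0 ∨ p.1 = 1) ∧ p.2 ≠ 3) ∧ ((0, 1) : Fin 4 × Fin 4) ∈ (Finset.univ.filter fun p :
      Fin 4 × Fin 4 => (p.1 = 0 ∨ p.1 = 1) ∧ p.2 ≠ 3) ∧ ((0, 2) : Fin 4 × Fin 4) ∈
      (Finset.univ.filter fun p : Fin 4 × Fin 4 => (p.1 = 0 ∨ p.1 = 1) ∧ p.2 ≠ 3) ∧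
      ((1, 0) : Fin 4 × Fin 4) ∈ (Finset.univ.filter fun p : Fin 4 × Fin 4 =>
      (p.1 = 0 ∨ p.1 = 1) ∧ p.2 ≠ 3) ∧ ((1, 1) : Fin 4 × Fin 4) ∈ (Finset.univ.filter fun p :
      Fin 4 × Fin 4 => (p.1 = 0 ∨ p.1 = 1) ∧ p.2 ≠ 3) ∧ ((1, 2) : Fin 4 × Fin 4) ∈
      (Finset.univ.filter fun p : Fin 4 × Fin 4 => (p.1 = 0 ∨ p.1 = 1) ∧ p.2 ≠ 3) := by decide
  obtain ⟨hL00, hL01, hL02, hL10, hL11, hL12⟩ := hLin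
  set L : Finset (Fin 4 × Fin 4) :=
    Finset.univ.filter fun p : Fin 4 × Fin 4 => (p.1 = 0 ∨ p.1 = 1) ∧ p.2 ≠ 3 with hL
  have live_off : ∀ x : Fin 4 × Fin 4 → K, ((∀ j, x (2, j) = 0) ∧ (∀ j, x (3, j) = 0) ∧
      x (0, 3) = 0 ∧ x (1, 3) = 0) → ∀ p, p ∉ L → x p = 0 := by
    rintro x ⟨h2, h3, h03, h13⟩ ⟨i, j⟩ hp
    have hp' : ¬ ((i = 0 ∨ i = 1) ∧ j ≠ 3) := fun h =>
      hp (Finset.mem_filter.2 ⟨Finset.mem_univ _, h⟩)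
    rcases (by decide : ∀ i : Fin 4, i = 0 ∨ i = 1 ∨ i = 2 ∨ i = 3) i with rfl | rfl | rfl | rfl
    · have hj : j = 3 := by
        by_contra hj
        exact hp' ⟨Or.inl rfl, hj⟩
      rw [hj]; exact h03
    · have hj : j = 3 := by
        by_contra hj
        exact hp' ⟨Or.inr rfl, hj⟩
      rw [hj]; exact h13
    · exact h2 j
    · exact h3 j
  have hcell : ∀ p ∈ L, ∀ q, q ∉ L → cellE (K := K) p q = 0 := by
    intro p hp q hq
    rw [cellE_apply, if_neg]
    rintro rfl
    exact hq hp
  let C6 : Submodule K (Fin 4 × Fin 4 → K) :=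
    Submodule.span K (Set.range fun e : ↥L => cellE (K := K) (e : Fin 4 × Fin 4))
  have hC6mem : ∀ x : Fin 4 × Fin 4 → K, (∀ p, p ∉ L → x p = 0) → x ∈ C6 := by
    intro x hx
    have hdecomp : x = ∑ p ∈ L, x p • cellE (K := K) p :=
      calc x = ∑ p, (Pi.single p (x p) : Fin 4 × Fin 4 → K) := (Finset.univ_sum_single x).symm
        _ = ∑ p ∈ L, (Pi.single p (x p) : Fin 4 × Fin 4 → K) := by
          symm
          refine Finset.sum_subset (Finset.subset_univ L) fun p _ hp => ?_
          rw [hx p hp, Pi.single_zero]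
        _ = ∑ p ∈ L, x p • cellE (K := K) p :=
          Finset.sum_congr rfl fun p _ => by
            ext q
            by_cases hq : q = p
            · subst hq; simp [cellE]
            · simp [cellE, hq]
    rw [hdecomp]
    exact Submodule.sum_mem _ fun p hp =>
      Submodule.smul_mem _ _ (Submodule.subset_span ⟨⟨p, hp⟩, rfl⟩)
  have hli : LinearIndependent K (fun e : ↥L => cellE (K := K) (e : Fin 4 × Fin 4)) := by
    have h := (Pi.basisFun K (Fin 4 × Fin 4)).linearIndependent
    have h' : LinearIndependent K (fun p : Fin 4 × Fin 4 => cellE (K := K) p) := by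
      convert h using 1
      ext p q
      simp [cellE, Pi.basisFun_apply]
    exact h'.comp _ Subtype.val_injective
  have hC6rank : finrank K C6 = 6 := by
    rw [finrank_span_eq_card hli, Fintype.card_coe, hLcard]
  have hWC6 : W ≤ C6 := fun x hx => hC6mem x (live_off x (hWc x hx))
  obtain ⟨e, heL, heW⟩ : ∃ e ∈ L, cellE (K := K) e ∉ W := by
    by_contra hall
    push Not at hall
    have hle : C6 ≤ W := Submodule.span_le.2 (by
      rintro _ ⟨e', rfl⟩
      exact hall e' e'.2)
    have h1 := Submodule.finrank_mono hle
    rw [hC6rank, h5] at h1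
    omega
  obtain ⟨φ, hφe, hφW⟩ := Submodule.exists_dual_map_eq_bot_of_notMem heW inferInstance
  have hφ0 : ∀ x ∈ W, φ x = 0 := fun x hx => by
    have h := Submodule.mem_map_of_mem (f := φ) hx
    rw [hφW, Submodule.mem_bot] at h
    exact h
  have hWmem : ∀ x : Fin 4 × Fin 4 → K, (∀ p, p ∉ L → x p = 0) → φ x = 0 → x ∈ W := by
    have hWle : W ≤ C6 ⊓ LinearMap.ker φ :=
      fun x hx => ⟨hWC6 hx, LinearMap.mem_ker.2 (hφ0 x hx)⟩
    have hlt : C6 ⊓ LinearMap.ker φ < C6 := by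
      refine lt_of_le_of_ne inf_le_left fun h => hφe ?_
      have heC : cellE (K := K) e ∈ C6 := Submodule.subset_span ⟨⟨e, heL⟩, rfl⟩
      rw [← h] at heC
      exact LinearMap.mem_ker.1 heC.2
    have hlt' := Submodule.finrank_lt_finrank_of_lt hlt
    have hWeq : W = C6 ⊓ LinearMap.ker φ :=
      Submodule.eq_of_le_of_finrank_le hWle (by rw [hC6rank] at hlt'; omega)
    intro x hx hφx
    rw [hWeq]
    exact ⟨hC6mem x hx, LinearMap.mem_ker.2 hφx⟩
  have hφx : ∀ x : Fin 4 × Fin 4 → K, ((∀ j, x (2, j) = 0) ∧ (∀ j, x (3, j) = 0) ∧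
      x (0, 3) = 0 ∧ x (1, 3) = 0) →
      φ x = x (0, 0) * φ (cellE (0, 0)) + x (0, 1) * φ (cellE (0, 1)) +
        x (0, 2) * φ (cellE (0, 2)) + x (1, 0) * φ (cellE (1, 0)) +
        x (1, 1) * φ (cellE (1, 1)) + x (1, 2) * φ (cellE (1, 2)) := by
    rintro x ⟨h2, h3, h03, h13⟩
    have hd := live_decomp x h2 h3 h03 h13
    conv_lhs => rw [hd]
    simp only [map_add, map_smul, smul_eq_mul, cellE]
  have hF : ∀ ν₀ ν₁ ν₂ : K, ν₀ * ν₁ * ν₂ ≠ 0 →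
      -(ν₀ ^ 2 * (φ (cellE (0, 0)) * φ (cellE (1, 0)))) -
        ν₁ ^ 2 * (φ (cellE (0, 1)) * φ (cellE (1, 1))) -
        ν₂ ^ 2 * (φ (cellE (0, 2)) * φ (cellE (1, 2))) +
        ν₀ * ν₁ * (φ (cellE (0, 0)) * φ (cellE (1, 1)) + φ (cellE (0, 1)) * φ (cellE (1, 0))) +
        ν₀ * ν₂ * (φ (cellE (0, 0)) * φ (cellE (1, 2)) + φ (cellE (0, 2)) * φ (cellE (1, 0))) +
        ν₁ * ν₂ * (φ (cellE (0, 1)) * φ (cellE (1, 2)) + φ (cellE (0, 2)) * φ (cellE (1, 1)))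
        = 0 := by
    intro ν₀ ν₁ ν₂ hν
    have hν' : ν₂ * ν₁ * ν₀ ≠ 0 := by
      intro h; apply hν; linear_combination h
    obtain ⟨u, hu⟩ : ∃ u : Fin 4 × Fin 4 → K, ∀ p, u p = if p = (2, 3) then 1
        else if p = (3, 0) then ν₀ else if p = (3, 1) then ν₁ else if p = (3, 2) then ν₂ else 0 :=
      ⟨_, fun _ => rfl⟩
    obtain ⟨c, Λ, hfam⟩ := hP u
    obtain ⟨P, hPd⟩ : ∃ P : (Fin 4 × Fin 4 → K) → K, ∀ y, P y =
        ν₀ * (y (0, 1) * y (1, 2) + y (0, 2) * y (1, 1)) +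
          ν₁ * (y (0, 0) * y (1, 2) + y (0, 2) * y (1, 0)) +
          ν₂ * (y (0, 0) * y (1, 1) + y (0, 1) * y (1, 0)) := ⟨_, fun _ => rfl⟩
    have hPP : ∀ y ∈ W, ∑ k, c k * (Λ k y) ^ 2 = P y := by
      intro y hy
      obtain ⟨e₀, e₁, he⟩ := hfam y hy
      obtain ⟨hy2, hy3, hy03, hy13⟩ := hWc y hy
      have hA := eval_wcol_point y hy2 hy3 hy03 hy13 ν₀ ν₁ ν₂ u hu
      rw [hPd]
      exact SymPencilPerFourCrossPairNoJoint.coeff_two_eq_of_forall₂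
        (fun s => (he s).symm.trans (hA s))
    let M : ↥W →ₗ[K] (Fin 4 → K) := LinearMap.pi fun k => (Λ k).comp W.subtype
    have hMk : ∀ (w : ↥W) (k : Fin 4), M w k = Λ k (w : Fin 4 × Fin 4 → K) := fun w k => rfl
    have hker : LinearMap.ker M ≠ ⊥ := LinearMap.ker_ne_bot_of_finrank_lt (by
      rw [Module.finrank_fintype_fun_eq_card, Fintype.card_fin, h5]; norm_num)
    obtain ⟨zW, hzK, hz0⟩ := Submodule.exists_mem_ne_zero_of_ne_bot hker
    have hΛz : ∀ k, Λ k (zW : Fin 4 × Fin 4 → K) = 0 := fun k => by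
      have h := congr_fun (LinearMap.mem_ker.1 hzK) k
      rwa [hMk] at h
    have hzW : (zW : Fin 4 × Fin 4 → K) ∈ W := zW.2
    set z : Fin 4 × Fin 4 → K := (zW : Fin 4 × Fin 4 → K) with hz
    have hzne : z ≠ 0 := by
      intro h
      apply hz0
      have h' : (zW : Fin 4 × Fin 4 → K) = 0 := by rw [← hz]; exact h
      exact (Submodule.coe_eq_zero).1 h'
    have hPz : P z = 0 := by
      rw [← hPP z hzW]
      exact Finset.sum_eq_zero fun k _ => by rw [hΛz k]; ring
    have hPadd : ∀ y ∈ W, P (z + y) = P y := by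
      intro y hy
      rw [← hPP (z + y) (W.add_mem hzW hy), ← hPP y hy]
      exact Finset.sum_congr rfl fun k _ => by rw [map_add, hΛz k, zero_add]
    have hPz' := hPz
    rw [hPd] at hPz'
    set Bst : K := P (z + cellE e) - P z - P (cellE e) with hBst
    have hrel : ∀ y : Fin 4 × Fin 4 → K, (∀ p, p ∉ L → y p = 0) →
        φ (cellE e) * (P (z + y) - P z - P y) = φ y * Bst := by
      intro y hy
      have hmem : φ (cellE e) • y - φ y • cellE (K := K) e ∈ W := by
        refine hWmem _ (fun p hp => ?_) ?_
        · simp only [Pi.sub_apply, Pi.smul_apply, smul_eq_mul, hy p hp, hcell e heL p hp,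
            mul_zero, sub_zero]
        · simp only [map_sub, map_smul, smul_eq_mul]; ring
      have h := hPadd _ hmem
      simp only [hBst, hPd, Pi.add_apply, Pi.sub_apply, Pi.smul_apply, smul_eq_mul] at h ⊢
      linear_combination h - hPz'
    have r00 := hrel (cellE (0, 0)) (hcell _ hL00)
    have r01 := hrel (cellE (0, 1)) (hcell _ hL01)
    have r02 := hrel (cellE (0, 2)) (hcell _ hL02)
    have r10 := hrel (cellE (1, 0)) (hcell _ hL10)
    have r11 := hrel (cellE (1, 1)) (hcell _ hL11)
    have r12 := hrel (cellE (1, 2)) (hcell _ hL12)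
    simp only [hPd, Pi.add_apply, cellE_apply, Prod.mk.injEq, f01, f02, f10, f12, f20, f21,
      and_true, and_false, if_true, if_false] at r00 r01 r02 r10 r11 r12
    have q00 : φ (cellE e) * (ν₂ * z (1, 1) + ν₁ * z (1, 2)) = φ (cellE (0, 0)) * Bst := by
      linear_combination r00
    have q01 : φ (cellE e) * (ν₂ * z (1, 0) + ν₀ * z (1, 2)) = φ (cellE (0, 1)) * Bst := by
      linear_combination r01
    have q02 : φ (cellE e) * (ν₁ * z (1, 0) + ν₀ * z (1, 1)) = φ (cellE (0, 2)) * Bst := by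
      linear_combination r02
    have q10 : φ (cellE e) * (ν₂ * z (0, 1) + ν₁ * z (0, 2)) = φ (cellE (1, 0)) * Bst := by
      linear_combination r10
    have q11 : φ (cellE e) * (ν₂ * z (0, 0) + ν₀ * z (0, 2)) = φ (cellE (1, 1)) * Bst := by
      linear_combination r11
    have q12 : φ (cellE e) * (ν₁ * z (0, 0) + ν₀ * z (0, 1)) = φ (cellE (1, 2)) * Bst := by
      linear_combination r12
    have hBne : Bst ≠ 0 := by
      intro hB
      have k0 : ∀ t : K, φ (cellE e) * t = 0 → t = 0 := fun t ht =>
        (mul_eq_zero.1 ht).resolve_left hφe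
      have b0 := k0 _ (by rw [q00, hB, mul_zero])
      have b1 := k0 _ (by rw [q01, hB, mul_zero])
      have b2 := k0 _ (by rw [q02, hB, mul_zero])
      have a0 := k0 _ (by rw [q10, hB, mul_zero])
      have a1 := k0 _ (by rw [q11, hB, mul_zero])
      have a2 := k0 _ (by rw [q12, hB, mul_zero])
      obtain ⟨z10, z11, z12⟩ := SymPencilPerFourHessianMinors.eq_zero_of_pairing₃ hν'
        (z₀ := z (1, 0)) (z₁ := z (1, 1)) (z₂ := z (1, 2))
        (by linear_combination b0) (by linear_combination b1) (by linear_combination b2)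
      obtain ⟨z00, z01, z02⟩ := SymPencilPerFourHessianMinors.eq_zero_of_pairing₃ hν'
        (z₀ := z (0, 0)) (z₁ := z (0, 1)) (z₂ := z (0, 2))
        (by linear_combination a0) (by linear_combination a1) (by linear_combination a2)
      obtain ⟨hz2, hz3, hz03, hz13⟩ := hWc z hzW
      apply hzne
      rw [live_decomp z hz2 hz3 hz03 hz13, z00, z01, z02, z10, z11, z12]
      simp
    have sol : ∀ {a t : K}, φ (cellE e) * t = a * Bst → a = φ (cellE e) / Bst * t := by
      intro a t h
      rw [div_mul_eq_mul_div, eq_div_iff hBne]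
      linear_combination -h
    rw [sol q00, sol q01, sol q02, sol q10, sol q11, sol q12]
    calc _ = (φ (cellE e) / Bst) ^ 2 * (2 * ν₀ * ν₁ * ν₂) *
          (ν₀ * (z (0, 1) * z (1, 2) + z (0, 2) * z (1, 1)) +
            ν₁ * (z (0, 0) * z (1, 2) + z (0, 2) * z (1, 0)) +
            ν₂ * (z (0, 0) * z (1, 1) + z (0, 1) * z (1, 0))) := by ring
      _ = 0 := by rw [hPz']; ring
  obtain ⟨hA0, hA1, hA2, hS01, hS02, hS12⟩ := coeffs_of_adj_identity hF
  have hpure := pureRow_of_symm_prod hA0 hA1 hA2 hS01 hS02 hS12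
  have heq := hLcases e heL
  rcases hpure with ⟨h00, h01, h02⟩ | ⟨h10, h11, h12⟩
  · -- `φ₀ = 0`: the equation lives on row `1`
    refine ⟨1, fun j => if j = 3 then 0 else φ (cellE (1, j)), Or.inr rfl, by simp, ?_, fun x => ?_⟩
    · intro hθ
      apply hφe
      rcases heq with rfl | rfl | rfl | rfl | rfl | rfl
      · exact h00
      · exact h01
      · exact h02
      · have h := congr_fun hθ 0
        simpa using h
      · have h := congr_fun hθ 1
        simpa using h
      · have h := congr_fun hθ 2
        simpa using h
    · constructor
      · intro hx
        have hl := hWc x hx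
        refine ⟨hl.1, hl.2.1, hl.2.2.1, hl.2.2.2, ?_⟩
        have h := hφ0 x hx
        rw [hφx x hl, h00, h01, h02] at h
        simp only [Fin.sum_univ_four, Fin.isValue, f03, f13, f23, if_true, if_false, zero_mul,
          add_zero]
        linear_combination h
      · rintro ⟨h2, h3, h03, h13, hs⟩
        refine hWmem x (live_off x ⟨h2, h3, h03, h13⟩) ?_
        rw [hφx x ⟨h2, h3, h03, h13⟩, h00, h01, h02]
        simp only [Fin.sum_univ_four, Fin.isValue, f03, f13, f23, if_true, if_false, zero_mul,
          add_zero] at hs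
        linear_combination hs
  · -- `φ₁ = 0`: the equation lives on row `0`
    refine ⟨0, fun j => if j = 3 then 0 else φ (cellE (0, j)), Or.inl rfl, by simp, ?_, fun x => ?_⟩
    · intro hθ
      apply hφe
      rcases heq with rfl | rfl | rfl | rfl | rfl | rfl
      · have h := congr_fun hθ 0
        simpa using h
      · have h := congr_fun hθ 1
        simpa using h
      · have h := congr_fun hθ 2
        simpa using h
      · exact h10
      · exact h11
      · exact h12
    · constructor
      · intro hx
        have hl := hWc x hx
        refine ⟨hl.1, hl.2.1, hl.2.2.1, hl.2.2.2, ?_⟩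
        have h := hφ0 x hx
        rw [hφx x hl, h10, h11, h12] at h
        simp only [Fin.sum_univ_four, Fin.isValue, f03, f13, f23, if_true, if_false, zero_mul,
          add_zero]
        linear_combination h
      · rintro ⟨h2, h3, h03, h13, hs⟩
        refine hWmem x (live_off x ⟨h2, h3, h03, h13⟩) ?_
        rw [hφx x ⟨h2, h3, h03, h13⟩, h10, h11, h12]
        simp only [Fin.sum_univ_four, Fin.isValue, f03, f13, f23, if_true, if_false, zero_mul,
          add_zero] at hs
        linear_combination hs

/-- Transport of a per-point family of four squares along a `per₄`-preserving linear
equivalence. [folklore] -/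
theorem perPointFour_map' (W : Submodule K (Fin 4 × Fin 4 → K))
    (Φ : (Fin 4 × Fin 4 → K) ≃ₗ[K] (Fin 4 × Fin 4 → K))
    (hΦ : ∀ z, eval (Φ z) (perPoly (Fin 4) K) = eval z (perPoly (Fin 4) K))
    (hP : ∀ u : Fin 4 × Fin 4 → K, ∃ (c : Fin 4 → K) (Λ : Fin 4 → ((Fin 4 × Fin 4 → K) →ₗ[K] K)),
      ∀ y ∈ W, ∃ e₀ e₁ : K, ∀ s : K,
        eval (u + s • y) (perPoly (Fin 4) K) = e₀ + s * e₁ + s ^ 2 * ∑ k, c k * (Λ k y) ^ 2) :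
    ∀ u : Fin 4 × Fin 4 → K, ∃ (c : Fin 4 → K) (Λ : Fin 4 → ((Fin 4 × Fin 4 → K) →ₗ[K] K)),
      ∀ y ∈ W.map Φ.toLinearMap, ∃ e₀ e₁ : K, ∀ s : K,
        eval (u + s • y) (perPoly (Fin 4) K) = e₀ + s * e₁ + s ^ 2 * ∑ k, c k * (Λ k y) ^ 2 := by
  intro u'
  obtain ⟨c, Λ, h⟩ := hP (Φ.symm u')
  refine ⟨c, fun k => (Λ k).comp Φ.symm.toLinearMap, ?_⟩
  rintro _ ⟨y, hy, rfl⟩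
  obtain ⟨e₀, e₁, he⟩ := h y hy
  refine ⟨e₀, e₁, fun s => ?_⟩
  have hu : u' + s • Φ.toLinearMap y = Φ (Φ.symm u' + s • y) := by
    rw [map_add, map_smul, LinearEquiv.apply_symm_apply]
    rfl
  rw [hu, hΦ, he s]
  simp only [LinearMap.coe_comp, LinearEquiv.coe_coe, Function.comp_apply,
    LinearEquiv.symm_apply_apply]

/-- Two-point transitivity of `S₄` (rows `0, 1`). [folklore] -/
theorem exists_perm_zero_one : ∀ p q : Fin 4, p ≠ q →
    ∃ σ : Equiv.Perm (Fin 4), σ 0 = p ∧ σ 1 = q := by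
  decide

/-- **Leaf E** (`stub_wcolFive` unfolded): transport to the normal position `p = σ 0, q = σ 1,
m = τ 3` by `funCongrLeft (prodCongr σ τ)` (per-preserving … (memo). [folklore] -/
theorem wcolFive [CharZero K] (W : Submodule K (Fin 4 × Fin 4 → K)) (h5 : finrank K W = 5)
    (p q m : Fin 4) (hpq : p ≠ q)
    (hcol : ∀ x ∈ W, (∀ i j : Fin 4, i ≠ p → i ≠ q → x (i, j) = 0) ∧ x (p, m) = 0 ∧ x (q, m) = 0)
    (hP : ∀ u : Fin 4 × Fin 4 → K, ∃ (c : Fin 4 → K) (Λ : Fin 4 → ((Fin 4 × Fin 4 → K) →ₗ[K] K)),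
      ∀ y ∈ W, ∃ e₀ e₁ : K, ∀ s : K,
        eval (u + s • y) (perPoly (Fin 4) K) = e₀ + s * e₁ + s ^ 2 * ∑ k, c k * (Λ k y) ^ 2) :
    ∃ (σ τ : Equiv.Perm (Fin 4)) (θ : Fin 4 → K), θ 3 = 0 ∧ θ ≠ 0 ∧
      ∀ x : Fin 4 × Fin 4 → K, x ∈ W ↔
        ((∀ j, x (σ 2, j) = 0) ∧ (∀ j, x (σ 3, j) = 0) ∧ x (σ 0, τ 3) = 0 ∧ x (σ 1, τ 3) = 0 ∧
          ∑ j, θ j * x (σ 1, τ j) = 0) := by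
  classical
  obtain ⟨σ, hσ0, hσ1⟩ := exists_perm_zero_one p q hpq
  set τ : Equiv.Perm (Fin 4) := Equiv.swap 3 m with hτ
  have hτ3 : τ 3 = m := by rw [hτ, Equiv.swap_apply_left]
  set Φ : (Fin 4 × Fin 4 → K) ≃ₗ[K] (Fin 4 × Fin 4 → K) :=
    LinearEquiv.funCongrLeft K K (Equiv.prodCongr σ τ) with hΦ
  have hΦa : ∀ (x : Fin 4 × Fin 4 → K) (i j : Fin 4), Φ x (i, j) = x (σ i, τ j) := fun x i j => rfl
  set W' := W.map Φ.toLinearMap with hW'def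
  have hfin : finrank K W' = 5 := by rw [hW'def, LinearEquiv.finrank_map_eq, h5]
  have h20 : (2 : Fin 4) ≠ 0 := by decide
  have h21 : (2 : Fin 4) ≠ 1 := by decide
  have h30 : (3 : Fin 4) ≠ 0 := by decide
  have h31 : (3 : Fin 4) ≠ 1 := by decide
  have hσ2p : σ 2 ≠ p := fun h => h20 (σ.injective (h.trans hσ0.symm))
  have hσ2q : σ 2 ≠ q := fun h => h21 (σ.injective (h.trans hσ1.symm))
  have hσ3p : σ 3 ≠ p := fun h => h30 (σ.injective (h.trans hσ0.symm))
  have hσ3q : σ 3 ≠ q := fun h => h31 (σ.injective (h.trans hσ1.symm))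
  have hWc' : ∀ x ∈ W', (∀ j, x (2, j) = 0) ∧ (∀ j, x (3, j) = 0) ∧ x (0, 3) = 0 ∧
      x (1, 3) = 0 := by
    rintro _ ⟨x, hx, rfl⟩
    obtain ⟨hoff, hpm, hqm⟩ := hcol x hx
    refine ⟨fun j => ?_, fun j => ?_, ?_, ?_⟩
    · show Φ x (2, j) = 0
      rw [hΦa]; exact hoff _ _ hσ2p hσ2q
    · show Φ x (3, j) = 0
      rw [hΦa]; exact hoff _ _ hσ3p hσ3q
    · show Φ x (0, 3) = 0
      rw [hΦa, hσ0, hτ3]; exact hpm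
    · show Φ x (1, 3) = 0
      rw [hΦa, hσ1, hτ3]; exact hqm
  have hP' := perPointFour_map' W Φ
    (fun z => SymPencilPerFourBlocks.eval_perPoly_comp_prodCongr σ τ z) hP
  obtain ⟨i, θ, hi, hθ3, hθne, hmem'⟩ := wcolFive01 W' hfin hWc' hP'
  have hmemW : ∀ x : Fin 4 × Fin 4 → K, x ∈ W ↔ Φ x ∈ W' := fun x => by
    rw [hW'def, Submodule.mem_map_equiv, LinearEquiv.symm_apply_apply]
  have hrow : ∀ (x : Fin 4 × Fin 4 → K) (r : Fin 4),
      (∀ j, x (r, τ j) = 0) ↔ (∀ j, x (r, j) = 0) := by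
    intro x r
    constructor
    · intro h j
      have h' := h (τ.symm j)
      rwa [Equiv.apply_symm_apply] at h'
    · intro h j
      exact h (τ j)
  rcases hi with rfl | rfl
  · -- the equation sits on row `σ 0`: relabel by `σ · (0 1)`
    refine ⟨σ * Equiv.swap 0 1, τ, θ, hθ3, hθne, fun x => ?_⟩
    have e0 : (σ * Equiv.swap (0 : Fin 4) 1) 0 = σ 1 := by
      rw [Equiv.Perm.mul_apply, Equiv.swap_apply_left]
    have e1 : (σ * Equiv.swap (0 : Fin 4) 1) 1 = σ 0 := by
      rw [Equiv.Perm.mul_apply, Equiv.swap_apply_right]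
    have e2 : (σ * Equiv.swap (0 : Fin 4) 1) 2 = σ 2 := by
      rw [Equiv.Perm.mul_apply, Equiv.swap_apply_of_ne_of_ne h20 h21]
    have e3 : (σ * Equiv.swap (0 : Fin 4) 1) 3 = σ 3 := by
      rw [Equiv.Perm.mul_apply, Equiv.swap_apply_of_ne_of_ne h30 h31]
    rw [e0, e1, e2, e3, hmemW x, hmem' (Φ x)]
    simp only [hΦa]
    rw [hrow x (σ 2), hrow x (σ 3)]
    constructor
    · rintro ⟨a, b, c, d, e⟩
      exact ⟨a, b, d, c, e⟩
    · rintro ⟨a, b, c, d, e⟩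
      exact ⟨a, b, d, c, e⟩
  · refine ⟨σ, τ, θ, hθ3, hθne, fun x => ?_⟩
    rw [hmemW x, hmem' (Φ x)]
    simp only [hΦa]
    rw [hrow x (σ 2), hrow x (σ 3)]

/-- **Leaf E** (PROVED in rev 4 — `wcolFive01` / `wcolFive` above; memo §5).  `W` is a
hyperplane `{φ₀·α + φ₁·β = 0}` of `W_col(p,q;m) = K³_α ⊕ K³_β`; for the base point … (memo). [folklore] -/
theorem stub_wcolFive [CharZero K] :
    ∀ W : Submodule K (Fin 4 × Fin 4 → K), finrank K W = 5 → ∀ p q m : Fin 4, p ≠ q →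
      InWCol W p q m → PerPointFour W → VTorusType W := by
  intro W h5 p q m hpq hcol hP
  exact wcolFive W h5 p q m hpq hcol hP

/-! ## 2d. Leaf R1C — one zero row and one zero column: reduction to the point lemma -/

/-- `Sing3` at a single matrix: all `3 × 3` subpermanents vanish. -/
def Sing3At (y : Fin 4 × Fin 4 → K) : Prop :=
  ∀ (r c : Fin 3 → Fin 4), Function.Injective r → Function.Injective c →
    ((Matrix.of fun a b => y (a, b)).submatrix r c).permanent = 0

/-- A per-direction family of four squares of linear forms at the direction `y`. -/
def FamAt (y : Fin 4 × Fin 4 → K) : Prop :=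
  ∃ (c : Fin 4 → K) (Λ : Fin 4 → ((Fin 4 × Fin 4 → K) →ₗ[K] K)),
    ∀ u : Fin 4 × Fin 4 → K, ∃ e₀ e₁ : K, ∀ s : K,
      eval (u + s • y) (perPoly (Fin 4) K) = e₀ + s * e₁ + s ^ 2 * ∑ k, c k * (Λ k u) ^ 2

/-- The pointwise conclusion of leaf R1C for a matrix with zero row `i` and zero column `j`:
a second zero row, a second zero column, or cross support. -/
def PointConcl (i j : Fin 4) (y : Fin 4 × Fin 4 → K) : Prop :=
  (∃ i', i' ≠ i ∧ ∀ m, y (i', m) = 0) ∨ (∃ j', j' ≠ j ∧ ∀ m, y (m, j') = 0) ∨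
    (∃ l c : Fin 4, ∀ a b : Fin 4, a ≠ l → b ≠ c → y (a, b) = 0)

/-- **Normalisation of the point lemma**: it suffices to treat zero row `3` and zero column `3`
(relabel rows and columns by transpositions; `per₄` is invariant, ✓ `eval_perPoly_comp_prodCongr`,
and the family moves by ✓ `sum_sq_swap_map`). [folklore] -/
theorem blockPoint_of_33
    (h33 : ∀ y : Fin 4 × Fin 4 → K, (∀ m, y (3, m) = 0) → (∀ m, y (m, 3) = 0) →
      Sing3At y → FamAt y → PointConcl 3 3 y)
    (i j : Fin 4) (y : Fin 4 × Fin 4 → K) (hrow : ∀ m, y (i, m) = 0) (hcol : ∀ m, y (m, j) = 0)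
    (hS : Sing3At y) (hF : FamAt y) : PointConcl i j y := by
  classical
  set σ : Equiv.Perm (Fin 4) := Equiv.swap 3 i with hσ
  set τ : Equiv.Perm (Fin 4) := Equiv.swap 3 j with hτ
  have hσ3 : σ 3 = i := by rw [hσ, Equiv.swap_apply_left]
  have hτ3 : τ 3 = j := by rw [hτ, Equiv.swap_apply_left]
  set Φ : (Fin 4 × Fin 4 → K) ≃ₗ[K] (Fin 4 × Fin 4 → K) :=
    LinearEquiv.funCongrLeft K K (Equiv.prodCongr σ τ) with hΦ
  have hΦa : ∀ (x : Fin 4 × Fin 4 → K) (a b : Fin 4), Φ x (a, b) = x (σ a, τ b) := fun x a b => rfl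
  have hrow' : ∀ m, Φ y (3, m) = 0 := fun m => by rw [hΦa, hσ3]; exact hrow _
  have hcol' : ∀ m, Φ y (m, 3) = 0 := fun m => by rw [hΦa, hτ3]; exact hcol _
  have hS' : Sing3At (Φ y) := by
    intro r c hr hc
    have hm : (Matrix.of fun a b => Φ y (a, b)).submatrix r c =
        (Matrix.of fun a b => y (a, b)).submatrix (σ ∘ r) (τ ∘ c) := by
      ext a b; rfl
    rw [hm]
    exact hS _ _ (σ.injective.comp hr) (τ.injective.comp hc)
  have hF' : FamAt (Φ y) := by
    obtain ⟨c, Λ, h⟩ := hF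
    exact ⟨c, fun k => (Λ k).comp Φ.symm.toLinearMap,
      SymPencilPerFourTwoRowCorankTwo.sum_sq_swap_map Φ
        (fun z => SymPencilPerFourBlocks.eval_perPoly_comp_prodCongr σ τ z) y c Λ h⟩
  have hback : ∀ a b : Fin 4, y (a, b) = Φ y (σ.symm a, τ.symm b) := fun a b => by
    rw [hΦa, Equiv.apply_symm_apply, Equiv.apply_symm_apply]
  rcases h33 (Φ y) hrow' hcol' hS' hF' with ⟨i', hi', h⟩ | ⟨j', hj', h⟩ | ⟨l, c, h⟩
  · refine Or.inl ⟨σ i', fun he => hi' (σ.injective (he.trans hσ3.symm)), fun m => ?_⟩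
    rw [hback, Equiv.symm_apply_apply]
    exact h _
  · refine Or.inr (Or.inl ⟨τ j', fun he => hj' (τ.injective (he.trans hτ3.symm)), fun m => ?_⟩)
    rw [hback, Equiv.symm_apply_apply]
    exact h _
  · refine Or.inr (Or.inr ⟨σ l, τ c, fun a b ha hb => ?_⟩)
    rw [hback]
    refine h _ _ (fun he => ha ?_) (fun he => hb ?_)
    · rw [← he, Equiv.apply_symm_apply]
    · rw [← he, Equiv.apply_symm_apply]

/-- **Leaf R1C from its point lemma** (the union step (I6)): if every element of `W` with the
per-direction family has a second zero row, a second zero column or cross support … (memo). [folklore] -/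
theorem threeByThree_of_point [CharZero K]
    (hpt : ∀ (i j : Fin 4) (y : Fin 4 × Fin 4 → K), (∀ m, y (i, m) = 0) → (∀ m, y (m, j) = 0) →
      Sing3At y → FamAt y → PointConcl i j y)
    (W : Submodule K (Fin 4 × Fin 4 → K)) (hS : Sing3 W)
    (hi : ∃ i : Fin 4, ∀ x ∈ W, ∀ j : Fin 4, x (i, j) = 0)
    (hj : ∃ j : Fin 4, ∀ x ∈ W, ∀ i : Fin 4, x (i, j) = 0)
    (h2r : ¬ TwoZeroRows W) (h2c : ¬ TwoZeroCols W) (hX : ¬ InCross W)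
    (hP : ∀ y ∈ W, ∃ (c : Fin 4 → K) (Λ : Fin 4 → ((Fin 4 × Fin 4 → K) →ₗ[K] K)),
      ∀ u : Fin 4 × Fin 4 → K, ∃ e₀ e₁ : K, ∀ s : K,
        eval (u + s • y) (perPoly (Fin 4) K) = e₀ + s * e₁ + s ^ 2 * ∑ k, c k * (Λ k u) ^ 2) :
    False := by
  classical
  obtain ⟨i, hi⟩ := hi
  obtain ⟨j, hj⟩ := hj
  let rowS : Fin 4 → Submodule K (Fin 4 × Fin 4 → K) := fun i' =>
    ⨅ m : Fin 4, LinearMap.ker (LinearMap.proj (i', m) : (Fin 4 × Fin 4 → K) →ₗ[K] K)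
  let colS : Fin 4 → Submodule K (Fin 4 × Fin 4 → K) := fun j' =>
    ⨅ m : Fin 4, LinearMap.ker (LinearMap.proj (m, j') : (Fin 4 × Fin 4 → K) →ₗ[K] K)
  let crossS : Fin 4 × Fin 4 → Submodule K (Fin 4 × Fin 4 → K) := fun lc =>
    ⨅ (a : Fin 4) (b : Fin 4) (_ : a ≠ lc.1) (_ : b ≠ lc.2),
      LinearMap.ker (LinearMap.proj (a, b) : (Fin 4 × Fin 4 → K) →ₗ[K] K)
  have mem_rowS : ∀ i' x, x ∈ rowS i' ↔ ∀ m, x (i', m) = 0 := fun i' x => by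
    simp [rowS, Submodule.mem_iInf]
  have mem_colS : ∀ j' x, x ∈ colS j' ↔ ∀ m, x (m, j') = 0 := fun j' x => by
    simp [colS, Submodule.mem_iInf]
  have mem_crossS : ∀ lc x, x ∈ crossS lc ↔ ∀ a b, a ≠ lc.1 → b ≠ lc.2 → x (a, b) = 0 :=
    fun lc x => by simp [crossS, Submodule.mem_iInf]
  let S : ({i' : Fin 4 // i' ≠ i} ⊕ {j' : Fin 4 // j' ≠ j} ⊕ (Fin 4 × Fin 4)) →
      Submodule K (Fin 4 × Fin 4 → K) :=
    Sum.elim (fun i' => rowS i') (Sum.elim (fun j' => colS j') crossS)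
  let p : ({i' : Fin 4 // i' ≠ i} ⊕ {j' : Fin 4 // j' ≠ j} ⊕ (Fin 4 × Fin 4)) → Submodule K ↥W :=
    fun k => (S k).comap W.subtype
  have hne : ∀ k, p k ≠ ⊤ := by
    intro k hk
    have hle : W ≤ S k := Submodule.comap_subtype_eq_top.1 hk
    rcases k with ⟨i', hi'⟩ | ⟨j', hj'⟩ | ⟨l, c⟩
    · refine h2r ⟨i, i', Ne.symm hi', fun x hx m => ⟨hi x hx m, ?_⟩⟩
      have hx' : x ∈ rowS i' := hle hx
      exact (mem_rowS i' x).1 hx' m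
    · refine h2c ⟨j, j', Ne.symm hj', fun x hx m => ⟨hj x hx m, ?_⟩⟩
      have hx' : x ∈ colS j' := hle hx
      exact (mem_colS j' x).1 hx' m
    · refine hX ⟨l, c, fun x hx a b ha hb => ?_⟩
      have hx' : x ∈ crossS (l, c) := hle hx
      exact (mem_crossS (l, c) x).1 hx' a b ha hb
  obtain ⟨x, hx⟩ := Submodule.exists_forall_notMem_of_forall_ne_top p hne
  obtain ⟨c, Λ, hfam⟩ := hP x x.2
  rcases hpt i j x (hi x x.2) (hj x x.2) (hS x x.2) ⟨c, Λ, hfam⟩ with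
    ⟨i', hi', hrow⟩ | ⟨j', hj', hcol⟩ | ⟨l, c', hcr⟩
  · exact hx (Sum.inl ⟨i', hi'⟩) (by
      change (x : Fin 4 × Fin 4 → K) ∈ rowS i'
      exact (mem_rowS i' x).2 hrow)
  · exact hx (Sum.inr (Sum.inl ⟨j', hj'⟩)) (by
      change (x : Fin 4 × Fin 4 → K) ∈ colS j'
      exact (mem_colS j' x).2 hcol)
  · exact hx (Sum.inr (Sum.inr (l, c'))) (by
      change (x : Fin 4 × Fin 4 → K) ∈ crossS (l, c')
      exact (mem_crossS (l, c') x).2 hcr)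

/-! ## 2e. The `3 × 3` point lemma of leaf R1C: `per₃ = 0 ∧ rank C ≤ 1 ⇒ zero row / column / cross` -/

/-- The pair-permanent vector of two rows `v, w ∈ K³`: entry `m` is the permanent of the `2 × 2`
matrix `(v; w)` with column `m` deleted (so the permanental cofactor matrix of … (memo). -/
def pv (v w : Fin 3 → K) : Fin 3 → K :=
  ![v 1 * w 2 + v 2 * w 1, v 0 * w 2 + v 2 * w 0, v 0 * w 1 + v 1 * w 0]

@[simp] theorem pv_zero (v w : Fin 3 → K) : pv v w 0 = v 1 * w 2 + v 2 * w 1 := rfl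
@[simp] theorem pv_one (v w : Fin 3 → K) : pv v w 1 = v 0 * w 2 + v 2 * w 0 := rfl
@[simp] theorem pv_two (v w : Fin 3 → K) : pv v w 2 = v 0 * w 1 + v 1 * w 0 := rfl

/-- The `3 × 3` permanent of the rows `a, b, c`. -/
def per3 (a b c : Fin 3 → K) : K :=
  a 0 * (b 1 * c 2 + b 2 * c 1) + a 1 * (b 0 * c 2 + b 2 * c 0) + a 2 * (b 0 * c 1 + b 1 * c 0)

theorem pv_comm (v w : Fin 3 → K) : pv v w = pv w v := by
  ext m; fin_cases m <;> simp <;> ring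

theorem pv_sub_smul (v w x : Fin 3 → K) (t : K) : pv v (w - t • x) = pv v w - t • pv v x := by
  ext m; fin_cases m <;> simp <;> ring

theorem pv_smul_sub_smul (v w x : Fin 3 → K) (s t : K) :
    pv (s • v - t • w) x = s • pv v x - t • pv w x := by
  ext m; fin_cases m <;> simp <;> ring

theorem pv_smul_right (v w : Fin 3 → K) (t : K) : pv v (t • w) = t • pv v w := by
  ext m; fin_cases m <;> simp <;> ring

/-- Generic entry of `pv`: for pairwise distinct `j, k, k'`, `pv v w k' = v j * w k + v k * w j`. -/
theorem pv_apply (v w : Fin 3 → K) {j k k' : Fin 3} (hjk : j ≠ k) (hjk' : j ≠ k') (hkk' : k ≠ k') :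
    pv v w k' = v j * w k + v k * w j := by
  fin_cases j <;> fin_cases k <;> fin_cases k' <;> simp (config := { decide := true }) at hjk hjk' hkk' ⊢ <;> ring

/-- Laplace along the third row, columns in any order. -/
theorem per3_eq_row3' (a b c : Fin 3 → K) {j k k' : Fin 3} (hjk : j ≠ k) (hjk' : j ≠ k')
    (hkk' : k ≠ k') : per3 a b c = c j * pv a b j + c k * pv a b k + c k' * pv a b k' := by
  fin_cases j <;> fin_cases k <;> fin_cases k' <;>
    simp (config := { decide := true }) [per3] at hjk hjk' hkk' ⊢ <;> ring

theorem per3_swap12 (a b c : Fin 3 → K) : per3 b a c = per3 a b c := by simp [per3]; ring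
theorem per3_swap23 (a b c : Fin 3 → K) : per3 a c b = per3 a b c := by simp [per3]; ring

/-- **Permanent-orthogonality in `K³`** (`char K ≠ 2`): `pv v w = 0` forces `v = 0`, `w = 0`, or a
common zero coordinate. [folklore] -/
theorem permOrth3 [CharZero K] (v w : Fin 3 → K) (h : pv v w = 0) :
    v = 0 ∨ w = 0 ∨ ∃ m, v m = 0 ∧ w m = 0 := by
  have h0 : v 1 * w 2 + v 2 * w 1 = 0 := by simpa using congr_fun h 0
  have h1 : v 0 * w 2 + v 2 * w 0 = 0 := by simpa using congr_fun h 1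
  have h2 : v 0 * w 1 + v 1 * w 0 = 0 := by simpa using congr_fun h 2
  by_cases hv0 : v 0 = 0
  · by_cases hw0 : w 0 = 0
    · exact Or.inr (Or.inr ⟨0, hv0, hw0⟩)
    · have hv1 : v 1 = 0 := by
        have : v 1 * w 0 = 0 := by rw [hv0] at h2; simpa using h2
        exact (mul_eq_zero.1 this).resolve_right hw0
      have hv2 : v 2 = 0 := by
        have : v 2 * w 0 = 0 := by rw [hv0] at h1; simpa using h1
        exact (mul_eq_zero.1 this).resolve_right hw0
      exact Or.inl (by ext m; fin_cases m <;> assumption)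
  · have hk : v 0 * (v 1 * w 2 - v 2 * w 1) = 0 := by
      linear_combination v 1 * h1 - v 2 * h2
    have hk' : v 1 * w 2 - v 2 * w 1 = 0 := (mul_eq_zero.1 hk).resolve_left hv0
    have h12 : v 1 * w 2 = 0 := by linear_combination (h0 + hk') / 2
    have h21 : v 2 * w 1 = 0 := by linear_combination (h0 - hk') / 2
    by_cases hv1 : v 1 = 0
    · have hw1 : w 1 = 0 := by
        have : v 0 * w 1 = 0 := by rw [hv1] at h2; simpa using h2
        exact (mul_eq_zero.1 this).resolve_left hv0
      exact Or.inr (Or.inr ⟨1, hv1, hw1⟩)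
    · have hw2 : w 2 = 0 := (mul_eq_zero.1 h12).resolve_left hv1
      rcases mul_eq_zero.1 h21 with hv2 | hw1
      · exact Or.inr (Or.inr ⟨2, hv2, hw2⟩)
      · have hw0 : w 0 = 0 := by
          have : v 1 * w 0 = 0 := by rw [hw1] at h2; simpa using h2
          exact (mul_eq_zero.1 this).resolve_left hv1
        exact Or.inr (Or.inl (by ext m; fin_cases m <;> assumption))

/-- Two vectors of `K³` with all `2 × 2` minors zero, the second non-zero, are proportional. -/
theorem exists_smul_of_minors (x w : Fin 3 → K) (hw : w ≠ 0)
    (h : ∀ m m', x m * w m' = x m' * w m) : ∃ t : K, x = t • w := by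
  obtain ⟨m₀, hm₀⟩ := Function.ne_iff.1 hw
  have hm₀' : w m₀ ≠ 0 := by simpa using hm₀
  refine ⟨x m₀ / w m₀, funext fun m => ?_⟩
  have := h m m₀
  simp only [Pi.smul_apply, smul_eq_mul]
  rw [div_mul_eq_mul_div, eq_div_iff hm₀']
  exact this

/-- The conclusion of the `3 × 3` lemma for the rows `a, b, c`: a zero row, a zero column, or cross
support (one row arbitrary, the other two inside one column). -/
def Concl3 (a b c : Fin 3 → K) : Prop :=
  a = 0 ∨ b = 0 ∨ c = 0 ∨ (∃ m, a m = 0 ∧ b m = 0 ∧ c m = 0) ∨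
    (∃ m, ∀ m', m' ≠ m → b m' = 0 ∧ c m' = 0) ∨ (∃ m, ∀ m', m' ≠ m → a m' = 0 ∧ c m' = 0) ∨
    (∃ m, ∀ m', m' ≠ m → a m' = 0 ∧ b m' = 0)

theorem concl3_swap12 {a b c : Fin 3 → K} (h : Concl3 b a c) : Concl3 a b c := by
  rcases h with h | h | h | ⟨m, h1, h2, h3⟩ | ⟨m, h⟩ | ⟨m, h⟩ | ⟨m, h⟩
  · exact Or.inr (Or.inl h)
  · exact Or.inl h
  · exact Or.inr (Or.inr (Or.inl h))
  · exact Or.inr (Or.inr (Or.inr (Or.inl ⟨m, h2, h1, h3⟩)))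
  · exact Or.inr (Or.inr (Or.inr (Or.inr (Or.inr (Or.inl ⟨m, h⟩)))))
  · exact Or.inr (Or.inr (Or.inr (Or.inr (Or.inl ⟨m, h⟩))))
  · exact Or.inr (Or.inr (Or.inr (Or.inr (Or.inr (Or.inr ⟨m, fun m' hm' => (h m' hm').symm⟩)))))

theorem concl3_swap23 {a b c : Fin 3 → K} (h : Concl3 a c b) : Concl3 a b c := by
  rcases h with h | h | h | ⟨m, h1, h2, h3⟩ | ⟨m, h⟩ | ⟨m, h⟩ | ⟨m, h⟩
  · exact Or.inl h
  · exact Or.inr (Or.inr (Or.inl h))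
  · exact Or.inr (Or.inl h)
  · exact Or.inr (Or.inr (Or.inr (Or.inl ⟨m, h1, h3, h2⟩)))
  · exact Or.inr (Or.inr (Or.inr (Or.inr (Or.inl ⟨m, fun m' hm' => (h m' hm').symm⟩))))
  · exact Or.inr (Or.inr (Or.inr (Or.inr (Or.inr (Or.inr ⟨m, h⟩)))))
  · exact Or.inr (Or.inr (Or.inr (Or.inr (Or.inr (Or.inl ⟨m, h⟩)))))

/-- Every index of `Fin 3` is one of three pairwise distinct ones. -/
theorem fin3_cover {j k k' : Fin 3} (hjk : j ≠ k) (hjk' : j ≠ k') (hkk' : k ≠ k') (m : Fin 3) :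
    m = j ∨ m = k ∨ m = k' := by
  revert m j k k'; decide

/-- The third index. -/
theorem fin3_third {m m' : Fin 3} (h : m ≠ m') : ∃ j : Fin 3, j ≠ m ∧ j ≠ m' := by
  revert m m'; decide

/-- A vector of `K³` vanishing at three pairwise distinct indices is zero. -/
theorem eq_zero_of_three {v : Fin 3 → K} {j k k' : Fin 3} (hjk : j ≠ k) (hjk' : j ≠ k')
    (hkk' : k ≠ k') (hj : v j = 0) (hk : v k = 0) (hk' : v k' = 0) : v = 0 := by
  funext m
  rcases fin3_cover hjk hjk' hkk' m with rfl | rfl | rfl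
  · exact hj
  · exact hk
  · exact hk'

/-- **Case `C = 0`**: three pairwise permanent-orthogonal rows have a zero row or a common zero
column (or `a ∝ e_j` with `b ⊥ a` forcing more zeros). [folklore] -/
theorem concl3_of_C0 [CharZero K] (a b c : Fin 3 → K) (hab : pv a b = 0) (hac : pv a c = 0)
    (hbc : pv b c = 0) : Concl3 a b c := by
  rcases permOrth3 a b hab with ha | hb | ⟨m₁, ha₁, hb₁⟩
  · exact Or.inl ha
  · exact Or.inr (Or.inl hb)
  rcases permOrth3 a c hac with ha | hc | ⟨m₂, ha₂, hc₂⟩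
  · exact Or.inl ha
  · exact Or.inr (Or.inr (Or.inl hc))
  rcases permOrth3 b c hbc with hb | hc | ⟨m₃, hb₃, hc₃⟩
  · exact Or.inr (Or.inl hb)
  · exact Or.inr (Or.inr (Or.inl hc))
  by_cases h12 : m₁ = m₂
  · subst h12
    exact Or.inr (Or.inr (Or.inr (Or.inl ⟨m₁, ha₁, hb₁, hc₂⟩)))
  by_cases h31 : m₃ = m₁
  · subst h31
    exact Or.inr (Or.inr (Or.inr (Or.inl ⟨m₃, ha₁, hb₁, hc₃⟩)))
  by_cases h32 : m₃ = m₂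
  · subst h32
    exact Or.inr (Or.inr (Or.inr (Or.inl ⟨m₃, ha₂, hb₃, hc₂⟩)))
  have e := congr_fun hab m₁
  rw [pv_apply a b h32 h31 (Ne.symm h12)] at e
  simp only [Pi.zero_apply, ha₂, zero_mul, add_zero] at e
  rcases mul_eq_zero.1 e with ha₃ | hb₂
  · exact Or.inl (eq_zero_of_three h32 h31 (Ne.symm h12) ha₃ ha₂ ha₁)
  · exact Or.inr (Or.inl (eq_zero_of_three h32 h31 (Ne.symm h12) hb₃ hb₂ hb₁))

/-- **Case `c = t • b`** (the third row proportional to the second). [folklore] -/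
theorem concl3_of_collinear [CharZero K] (a b c : Fin 3 → K) (t s : K) (hc : c = t • b)
    (hs : pv b c = s • pv a b) (hper : per3 a b c = 0) : Concl3 a b c := by
  by_cases ht : t = 0
  · rw [ht, zero_smul] at hc
    exact Or.inr (Or.inr (Or.inl hc))
  have hcm : ∀ m, c m = t * b m := fun m => by rw [hc]; rfl
  by_cases hs0 : s = 0
  · -- `pv b b = 0`: two coordinates of `b` vanish, `b, c ∝ e_m`: cross with free row `a`
    have hbb : pv b b = 0 := by
      have h1 : pv b c = t • pv b b := by rw [hc, pv_smul_right]
      rw [hs0, zero_smul] at hs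
      have := h1.symm.trans hs
      exact (smul_eq_zero.1 this).resolve_left ht
    have e0 : b 1 * b 2 = 0 := by have := congr_fun hbb 0; simp at this; linear_combination this / 2
    have e1 : b 0 * b 2 = 0 := by have := congr_fun hbb 1; simp at this; linear_combination this / 2
    have e2 : b 0 * b 1 = 0 := by have := congr_fun hbb 2; simp at this; linear_combination this / 2
    have cross : ∀ m : Fin 3, (∀ m', m' ≠ m → b m' = 0) → Concl3 a b c := fun m hm =>
      Or.inr (Or.inr (Or.inr (Or.inr (Or.inl ⟨m, fun m' hm' => ⟨hm m' hm', by
        rw [hcm, hm m' hm', mul_zero]⟩⟩))))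
    by_cases hb0 : b 0 = 0
    · rcases mul_eq_zero.1 e0 with hb1 | hb2
      · refine cross 2 fun m' hm' => ?_
        fin_cases m' <;> simp_all
      · refine cross 1 fun m' hm' => ?_
        fin_cases m' <;> simp_all
    · have hb2 : b 2 = 0 := (mul_eq_zero.1 e1).resolve_left hb0
      have hb1 : b 1 = 0 := (mul_eq_zero.1 e2).resolve_left hb0
      refine cross 0 fun m' hm' => ?_
      fin_cases m' <;> simp_all
  have h1 : pv b c = t • pv b b := by rw [hc, pv_smul_right]
  have hd : pv (s • a - t • b) b = 0 := by
    rw [pv_smul_sub_smul, ← hs, ← h1, sub_self]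
  rcases permOrth3 _ b hd with h0 | hb | ⟨m, hm, hbm⟩
  · -- `a = (t/s) • b`: rank one, `per3 = 6 (t/s) t b₀b₁b₂ = 0`
    have ham : ∀ m, a m = t / s * b m := fun m => by
      have := congr_fun h0 m
      simp only [Pi.sub_apply, Pi.smul_apply, smul_eq_mul, Pi.zero_apply] at this
      field_simp
      linear_combination this
    have hp : per3 a b c = 6 * (t * t / s) * (b 0 * b 1 * b 2) := by
      simp only [per3, ham, hcm]
      field_simp
      ring
    rw [hper] at hp
    have h6 : (6 : K) * (t * t / s) ≠ 0 := by
      refine mul_ne_zero (by norm_num) ?_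
      exact div_ne_zero (mul_ne_zero ht ht) hs0
    have hb012 : b 0 * b 1 * b 2 = 0 := by
      rcases mul_eq_zero.1 hp.symm with h | h
      · exact absurd h h6
      · exact h
    have col : ∀ m, b m = 0 → Concl3 a b c := fun m hb =>
      Or.inr (Or.inr (Or.inr (Or.inl ⟨m, by rw [ham, hb, mul_zero], hb, by
        rw [hcm, hb, mul_zero]⟩)))
    rcases mul_eq_zero.1 hb012 with h | h
    · rcases mul_eq_zero.1 h with h | h
      · exact col 0 h
      · exact col 1 h
    · exact col 2 h
  · exact Or.inr (Or.inl hb)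
  · have ham : a m = 0 := by
      simp only [Pi.sub_apply, Pi.smul_apply, smul_eq_mul, hbm, mul_zero, sub_zero] at hm
      exact (mul_eq_zero.1 hm).resolve_left hs0
    exact Or.inr (Or.inr (Or.inr (Or.inl ⟨m, ham, hbm, by rw [hcm, hbm, mul_zero]⟩)))

/-- **The off-diagonal case**: `a_{k'} = 0`, `b_k = 0`, `c_k = s a_k`, `c_{k'} = t b_{k'}` and the
three scalar relations from `a ⊥ (c - t b)`, `b ⊥ (c - s a)`, `per3 = 0`. [folklore] -/
theorem concl3_offdiag [CharZero K] (a b c : Fin 3 → K) (t s : K) {j k k' : Fin 3} (hjk : j ≠ k)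
    (hjk' : j ≠ k') (hkk' : k ≠ k') (ha : a k' = 0) (hb : b k = 0) (hck : c k = s * a k)
    (hck' : c k' = t * b k') (R1 : a k * (s * a j + c j - t * b j) = 0)
    (R2 : b k' * (t * b j + c j - s * a j) = 0)
    (R3 : a k * b k' * (c j + s * a j + t * b j) = 0) : Concl3 a b c := by
  by_cases hak : a k = 0
  · exact Or.inr (Or.inr (Or.inr (Or.inl ⟨k, hak, hb, by rw [hck, hak, mul_zero]⟩)))
  by_cases hbk' : b k' = 0
  · exact Or.inr (Or.inr (Or.inr (Or.inl ⟨k', ha, hbk', by rw [hck', hbk', mul_zero]⟩)))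
  have E1 : s * a j + c j - t * b j = 0 := (mul_eq_zero.1 R1).resolve_left hak
  have E2 : t * b j + c j - s * a j = 0 := (mul_eq_zero.1 R2).resolve_left hbk'
  have E3 : c j + s * a j + t * b j = 0 := (mul_eq_zero.1 R3).resolve_left (mul_ne_zero hak hbk')
  have hcj : c j = 0 := by linear_combination (E1 + E2) / 2
  have hsa : s * a j = 0 := by linear_combination (E1 + E3) / 2 - hcj
  have htb : t * b j = 0 := by linear_combination (E3 - E1) / 2
  by_cases hs : s = 0
  · by_cases ht : t = 0
    · refine Or.inr (Or.inr (Or.inl (eq_zero_of_three hjk hjk' hkk' hcj ?_ ?_)))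
      · rw [hck, hs, zero_mul]
      · rw [hck', ht, zero_mul]
    · have hbj : b j = 0 := (mul_eq_zero.1 htb).resolve_left ht
      refine Or.inr (Or.inr (Or.inr (Or.inr (Or.inl ⟨k', fun m' hm' => ?_⟩))))
      rcases fin3_cover hjk hjk' hkk' m' with rfl | rfl | rfl
      · exact ⟨hbj, hcj⟩
      · exact ⟨hb, by rw [hck, hs, zero_mul]⟩
      · exact absurd rfl hm'
  · have haj : a j = 0 := (mul_eq_zero.1 hsa).resolve_left hs
    by_cases ht : t = 0
    · refine Or.inr (Or.inr (Or.inr (Or.inr (Or.inr (Or.inl ⟨k, fun m' hm' => ?_⟩)))))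
      rcases fin3_cover hjk hjk' hkk' m' with rfl | rfl | rfl
      · exact ⟨haj, hcj⟩
      · exact absurd rfl hm'
      · exact ⟨ha, by rw [hck', ht, zero_mul]⟩
    · have hbj : b j = 0 := (mul_eq_zero.1 htb).resolve_left ht
      exact Or.inr (Or.inr (Or.inr (Or.inl ⟨j, haj, hbj, hcj⟩)))

/-- **Core case**: the cofactor rows `pv a c`, `pv b c` are multiples of `pv a b`. [folklore] -/
theorem concl3_core [CharZero K] (a b c : Fin 3 → K)
    (hB : ∃ t : K, pv a c = t • pv a b) (hA : ∃ s : K, pv b c = s • pv a b)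
    (hper : per3 a b c = 0) : Concl3 a b c := by
  obtain ⟨t, ht⟩ := hB
  obtain ⟨s, hs⟩ := hA
  have hd : pv a (c - t • b) = 0 := by rw [pv_sub_smul, ht, sub_self]
  have hd' : pv b (c - s • a) = 0 := by rw [pv_sub_smul, hs, pv_comm b a, sub_self]
  rcases permOrth3 a _ hd with ha0 | hd0 | ⟨m, ham, hdm⟩
  · exact Or.inl ha0
  · exact concl3_of_collinear a b c t s (sub_eq_zero.1 hd0) hs hper
  rcases permOrth3 b _ hd' with hb0 | hd0' | ⟨m', hbm', hdm'⟩
  · exact Or.inr (Or.inl hb0)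
  · refine concl3_swap12 (concl3_of_collinear b a c s t (sub_eq_zero.1 hd0') ?_ ?_)
    · rw [pv_comm b a]; exact ht
    · rw [per3_swap12]; exact hper
  have hcm : c m = t * b m := by
    simp only [Pi.sub_apply, Pi.smul_apply, smul_eq_mul] at hdm; linear_combination hdm
  have hcm' : c m' = s * a m' := by
    simp only [Pi.sub_apply, Pi.smul_apply, smul_eq_mul] at hdm'; linear_combination hdm'
  by_cases hmm : m = m'
  · subst hmm
    exact Or.inr (Or.inr (Or.inr (Or.inl ⟨m, ham, hbm', by rw [hcm, hbm', mul_zero]⟩)))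
  obtain ⟨j, hjm, hjm'⟩ := fin3_third hmm
  have hm'm : m' ≠ m := fun h => hmm h.symm
  have e1 := congr_fun hd m
  rw [pv_apply a _ hjm' hjm hm'm] at e1
  simp only [Pi.sub_apply, Pi.smul_apply, smul_eq_mul, Pi.zero_apply] at e1
  have R1 : a m' * (s * a j + c j - t * b j) = 0 := by
    linear_combination e1 - a j * hcm' + t * a j * hbm'
  have e2 := congr_fun hd' m'
  rw [pv_apply b _ hjm hjm' hmm] at e2
  simp only [Pi.sub_apply, Pi.smul_apply, smul_eq_mul, Pi.zero_apply] at e2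
  have R2 : b m * (t * b j + c j - s * a j) = 0 := by
    linear_combination e2 - b j * hcm + s * b j * ham
  have e3 := hper
  rw [per3_eq_row3' a b c hjm' hjm hm'm, pv_apply a b hm'm (Ne.symm hjm') (Ne.symm hjm),
    pv_apply a b hjm hjm' hmm, pv_apply a b hjm' hjm hm'm] at e3
  have R3 : a m' * b m * (c j + s * a j + t * b j) = 0 := by
    linear_combination e3 - (a j * b m) * hcm' - (a m' * b j) * hcm -
      (c j * b m' + c m' * b j) * ham - (c m * a j) * hbm'
  exact concl3_offdiag a b c t s hjm' hjm hm'm ham hbm' hcm' hcm R1 R2 R3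

/-- **THE `3 × 3` POINT LEMMA OF LEAF R1C** (`char K = 0`): if `per3 (a;b;c) = 0` and the
permanental cofactor matrix (rows `pv b c`, `pv a c`, `pv a b`) has rank `≤ 1` (all … (memo). [folklore] -/
theorem concl3_of_rankOne [CharZero K] (a b c : Fin 3 → K) (hper : per3 a b c = 0)
    (h₁ : ∀ m m', pv a b m * pv a c m' = pv a b m' * pv a c m)
    (h₂ : ∀ m m', pv a b m * pv b c m' = pv a b m' * pv b c m)
    (h₃ : ∀ m m', pv a c m * pv b c m' = pv a c m' * pv b c m) : Concl3 a b c := by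
  by_cases hab : pv a b = 0
  · by_cases hac : pv a c = 0
    · by_cases hbc : pv b c = 0
      · exact concl3_of_C0 a b c hab hac hbc
      · -- core on `(b, c, a)`
        refine concl3_swap12 (concl3_swap23 (a := b) (b := a) (c := c) ?_)
        refine concl3_core b c a ⟨0, ?_⟩ ⟨0, ?_⟩ ?_
        · rw [pv_comm b a, hab, zero_smul]
        · rw [pv_comm c a, hac, zero_smul]
        · rw [per3_swap23 b a c, per3_swap12]; exact hper
    · -- core on `(a, c, b)`
      refine concl3_swap23 (concl3_core a c b ⟨0, ?_⟩ ?_ ?_)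
      · rw [hab, zero_smul]
      · obtain ⟨u, hu⟩ := exists_smul_of_minors (pv b c) (pv a c) hac fun m m' => by
          rw [mul_comm, h₃ m' m, mul_comm]
        exact ⟨u, by rw [pv_comm c b]; exact hu⟩
      · rw [per3_swap23]; exact hper
  · refine concl3_core a b c ?_ ?_ hper
    · exact exists_smul_of_minors (pv a c) (pv a b) hab fun m m' => by
        rw [mul_comm, h₁ m' m, mul_comm]
    · exact exists_smul_of_minors (pv b c) (pv a b) hab fun m m' => by
        rw [mul_comm, h₂ m' m, mul_comm]

/-! ## 2f. From the `3 × 3` lemma to the point lemma: block rows, `Sing3At ⇒ per3 = 0`, index glue -/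

/-- Block row `i` of `y` (rows and columns `0,1,2`). -/
def bRow (y : Fin 4 × Fin 4 → K) (i : Fin 3) : Fin 3 → K :=
  fun m => y (Fin.castSucc i, Fin.castSucc m)

theorem cs0 : (Fin.castSucc (0 : Fin 3) : Fin 4) = 0 := rfl
theorem cs1 : (Fin.castSucc (1 : Fin 3) : Fin 4) = 1 := rfl
theorem cs2 : (Fin.castSucc (2 : Fin 3) : Fin 4) = 2 := rfl
theorem castSucc_ne_three (m : Fin 3) : (Fin.castSucc m : Fin 4) ≠ 3 := by
  fin_cases m <;> decide
theorem fin4_split (m : Fin 4) : m = 3 ∨ ∃ m' : Fin 3, m = Fin.castSucc m' := by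
  fin_cases m
  · exact Or.inr ⟨0, rfl⟩
  · exact Or.inr ⟨1, rfl⟩
  · exact Or.inr ⟨2, rfl⟩
  · exact Or.inl rfl

/-- `Sing3At` contains the vanishing of the block permanent. -/
theorem per3_bRow_eq_zero (y : Fin 4 × Fin 4 → K) (hS : Sing3At y) :
    per3 (bRow y 0) (bRow y 1) (bRow y 2) = 0 := by
  have h := hS Fin.castSucc Fin.castSucc (Fin.castSucc_injective 3) (Fin.castSucc_injective 3)
  rw [Matrix.permanent_fin_three_row] at h
  simp only [Matrix.submatrix_apply, Matrix.of_apply, cs0, cs1, cs2] at h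
  simp only [per3, bRow, cs0, cs1, cs2]
  linear_combination h

/-- The rank-`≤ 1` condition on the permanental cofactor matrix of the block of `y` (all `2 × 2`
minors of the matrix with rows `pv b c`, `pv a c`, `pv a b` vanish; `a, b, c` the block rows). -/
def CofRankLeOne (y : Fin 4 × Fin 4 → K) : Prop :=
  (∀ m m', pv (bRow y 0) (bRow y 1) m * pv (bRow y 0) (bRow y 2) m' =
      pv (bRow y 0) (bRow y 1) m' * pv (bRow y 0) (bRow y 2) m) ∧
  (∀ m m', pv (bRow y 0) (bRow y 1) m * pv (bRow y 1) (bRow y 2) m' =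
      pv (bRow y 0) (bRow y 1) m' * pv (bRow y 1) (bRow y 2) m) ∧
  (∀ m m', pv (bRow y 0) (bRow y 2) m * pv (bRow y 1) (bRow y 2) m' =
      pv (bRow y 0) (bRow y 2) m' * pv (bRow y 1) (bRow y 2) m)

/-- Index glue: the `3 × 3` conclusion for the block rows gives `PointConcl 3 3 y`. -/
theorem pointConcl_of_concl3 (y : Fin 4 × Fin 4 → K) (hrow : ∀ m, y (3, m) = 0)
    (hcol : ∀ m, y (m, 3) = 0) (h : Concl3 (bRow y 0) (bRow y 1) (bRow y 2)) :
    PointConcl 3 3 y := by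
  have zrow : ∀ i : Fin 3, bRow y i = 0 → PointConcl 3 3 y := fun i hi =>
    Or.inl ⟨Fin.castSucc i, castSucc_ne_three i, fun m => by
      rcases fin4_split m with rfl | ⟨m', rfl⟩
      · exact hcol _
      · exact congr_fun hi m'⟩
  have zcol : ∀ m : Fin 3, bRow y 0 m = 0 → bRow y 1 m = 0 → bRow y 2 m = 0 → PointConcl 3 3 y :=
    fun m h0 h1 h2 => Or.inr (Or.inl ⟨Fin.castSucc m, castSucc_ne_three m, fun i => by
      rcases fin4_split i with rfl | ⟨i', rfl⟩
      · exact hrow _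
      · fin_cases i'
        · exact h0
        · exact h1
        · exact h2⟩)
  have cross : ∀ (r : Fin 3) (m : Fin 3), (∀ i : Fin 3, i ≠ r → ∀ m', m' ≠ m → bRow y i m' = 0) →
      PointConcl 3 3 y := fun r m h =>
    Or.inr (Or.inr ⟨Fin.castSucc r, Fin.castSucc m, fun a b ha hb => by
      rcases fin4_split a with rfl | ⟨a', rfl⟩
      · exact hrow _
      rcases fin4_split b with rfl | ⟨b', rfl⟩
      · exact hcol _
      exact h a' (fun he => ha (by rw [he])) b' (fun he => hb (by rw [he]))⟩)
  rcases h with h | h | h | ⟨m, h0, h1, h2⟩ | ⟨m, h⟩ | ⟨m, h⟩ | ⟨m, h⟩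
  · exact zrow 0 h
  · exact zrow 1 h
  · exact zrow 2 h
  · exact zcol m h0 h1 h2
  · refine cross 0 m fun i hi m' hm' => ?_
    fin_cases i
    · exact absurd rfl hi
    · exact (h m' hm').1
    · exact (h m' hm').2
  · refine cross 1 m fun i hi m' hm' => ?_
    fin_cases i
    · exact (h m' hm').1
    · exact absurd rfl hi
    · exact (h m' hm').2
  · refine cross 2 m fun i hi m' hm' => ?_
    fin_cases i
    · exact (h m' hm').1
    · exact (h m' hm').2
    · exact absurd rfl hi

/-- **The point lemma from the cofactor-rank reading** (the reading is the remaining stub). -/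
theorem blockPoint33_of_reading [CharZero K]
    (hread : ∀ y : Fin 4 × Fin 4 → K, (∀ m, y (3, m) = 0) → (∀ m, y (m, 3) = 0) → FamAt y →
      CofRankLeOne y)
    (y : Fin 4 × Fin 4 → K) (hrow : ∀ m, y (3, m) = 0) (hcol : ∀ m, y (m, 3) = 0)
    (hS : Sing3At y) (hF : FamAt y) : PointConcl 3 3 y := by
  obtain ⟨h₁, h₂, h₃⟩ := hread y hrow hcol hF
  exact pointConcl_of_concl3 y hrow hcol
    (concl3_of_rankOne _ _ _ (per3_bRow_eq_zero y hS) h₁ h₂ h₃)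

/-! ## 2g. The Hessian reading at a block direction: four squares ⇒ cofactor rank ≤ 1 -/

/-- The permanental cofactor matrix of the block of `y`: row `ρ` = `pv` of the two other block
rows (`cof y ρ κ` is the permanent of the block with row `ρ` and column `κ` deleted). -/
def cof (y : Fin 4 × Fin 4 → K) : Fin 3 → Fin 3 → K :=
  ![pv (bRow y 1) (bRow y 2), pv (bRow y 0) (bRow y 2), pv (bRow y 0) (bRow y 1)]

@[simp] theorem cof_zero (y : Fin 4 × Fin 4 → K) : cof y 0 = pv (bRow y 1) (bRow y 2) := rfl
@[simp] theorem cof_one (y : Fin 4 × Fin 4 → K) : cof y 1 = pv (bRow y 0) (bRow y 2) := rfl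
@[simp] theorem cof_two (y : Fin 4 × Fin 4 → K) : cof y 2 = pv (bRow y 0) (bRow y 1) := rfl

/-- The `s²`-coefficient of `per₄ (u + s y)` at a block direction `y`:
`Q_y(u) = u₃₃ · Σ C_{ρκ} u_{ρκ} + Σ C_{ρκ} u_{ρ3} u_{3κ}`. -/
def Qf (y u : Fin 4 × Fin 4 → K) : K :=
  u (3, 3) * (cof y 0 0 * u (0, 0) + cof y 0 1 * u (0, 1) + cof y 0 2 * u (0, 2) +
      cof y 1 0 * u (1, 0) + cof y 1 1 * u (1, 1) + cof y 1 2 * u (1, 2) +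
      cof y 2 0 * u (2, 0) + cof y 2 1 * u (2, 1) + cof y 2 2 * u (2, 2)) +
    (cof y 0 0 * u (0, 3) * u (3, 0) + cof y 0 1 * u (0, 3) * u (3, 1) + cof y 0 2 * u (0, 3) * u (3, 2) +
      cof y 1 0 * u (1, 3) * u (3, 0) + cof y 1 1 * u (1, 3) * u (3, 1) + cof y 1 2 * u (1, 3) * u (3, 2) +
      cof y 2 0 * u (2, 3) * u (3, 0) + cof y 2 1 * u (2, 3) * u (3, 1) + cof y 2 2 * u (2, 3) * u (3, 2))

/-- **Second finite difference of `per₄` along a block direction**: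
`per(u + y) + per(u − y) − 2 per(u) = 2 Q_y(u)`. [folklore] -/
theorem second_diff (y : Fin 4 × Fin 4 → K) (hrow : ∀ m, y (3, m) = 0) (hcol : ∀ m, y (m, 3) = 0)
    (u : Fin 4 × Fin 4 → K) :
    eval (u + y) (perPoly (Fin 4) K) + eval (u - y) (perPoly (Fin 4) K) -
      2 * eval u (perPoly (Fin 4) K) = 2 * Qf y u := by
  have h03 := hcol 0; have h13 := hcol 1; have h23 := hcol 2
  have h30 := hrow 0; have h31 := hrow 1; have h32 := hrow 2; have h33 := hrow 3
  simp only [eval_perPoly, Matrix.permanent_fin_four_row, Matrix.of_apply, Pi.add_apply,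
    Pi.sub_apply, h03, h13, h23, h30, h31, h32, h33, add_zero, sub_zero, Qf, cof_zero, cof_one,
    cof_two, pv_zero, pv_one, pv_two, bRow, cs0, cs1, cs2]
  ring

/-- **The Hessian reading, step 1**: a per-direction family of squares at a block direction `y`
represents exactly `Q_y`. [folklore] -/
theorem sum_sq_eq_Qf [CharZero K] (y : Fin 4 × Fin 4 → K) (hrow : ∀ m, y (3, m) = 0)
    (hcol : ∀ m, y (m, 3) = 0) {ι : Type*} [Fintype ι] (c : ι → K)
    (Λ : ι → ((Fin 4 × Fin 4 → K) →ₗ[K] K))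
    (h : ∀ u : Fin 4 × Fin 4 → K, ∃ e₀ e₁ : K, ∀ s : K,
      eval (u + s • y) (perPoly (Fin 4) K) = e₀ + s * e₁ + s ^ 2 * ∑ k, c k * (Λ k u) ^ 2)
    (u : Fin 4 × Fin 4 → K) : ∑ k, c k * (Λ k u) ^ 2 = Qf y u := by
  obtain ⟨e₀, e₁, he⟩ := h u
  have h0 := he 0
  have h1 := he 1
  have h1' := he (-1)
  rw [zero_smul, add_zero] at h0
  rw [one_smul] at h1
  rw [neg_one_smul, ← sub_eq_add_neg] at h1'
  have hd := second_diff y hrow hcol u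
  have h2 : (2 : K) * ∑ k, c k * (Λ k u) ^ 2 = 2 * Qf y u := by
    linear_combination hd - h1 - h1' + 2 * h0
  exact (mul_right_inj' two_ne_zero).1 h2

/-- **The Hessian reading, step 2 (abstract)**: a non-degenerate quadratic form
`γ x₀x₁ + (x₄, x₅)·N·(x₂, x₃)ᵀ` on `K⁶` (`γ ≠ 0`, `det N ≠ 0`) is not a combination of … (memo). [folklore] -/
theorem nondeg6 (γ n00 n01 n10 n11 : K) (hγ : γ ≠ 0) (hN : n00 * n11 - n01 * n10 ≠ 0)
    (c : Fin 4 → K) (ℓ : Fin 4 → ((Fin 6 → K) →ₗ[K] K))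
    (h : ∀ z : Fin 6 → K, γ * z 0 * z 1 + z 4 * (n00 * z 2 + n01 * z 3) +
      z 5 * (n10 * z 2 + n11 * z 3) = ∑ k, c k * (ℓ k z) ^ 2) : False := by
  classical
  let L : (Fin 6 → K) →ₗ[K] (Fin 4 → K) := LinearMap.pi fun k => ℓ k
  have hker : LinearMap.ker L ≠ ⊥ :=
    LinearMap.ker_ne_bot_of_finrank_lt (by
      rw [finrank_fintype_fun_eq_card, finrank_fintype_fun_eq_card, Fintype.card_fin,
        Fintype.card_fin]
      norm_num)
  obtain ⟨n, hn, hn0⟩ := Submodule.exists_mem_ne_zero_of_ne_bot hker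
  have hℓ : ∀ k, ℓ k n = 0 := fun k => by
    have := congr_fun (LinearMap.mem_ker.1 hn) k
    simpa [L] using this
  have hinv : ∀ z : Fin 6 → K,
      γ * (n 0 + z 0) * (n 1 + z 1) + (n 4 + z 4) * (n00 * (n 2 + z 2) + n01 * (n 3 + z 3)) +
        (n 5 + z 5) * (n10 * (n 2 + z 2) + n11 * (n 3 + z 3)) =
      γ * z 0 * z 1 + z 4 * (n00 * z 2 + n01 * z 3) + z 5 * (n10 * z 2 + n11 * z 3) := by
    intro z
    have h1 := h (n + z)
    simp only [Pi.add_apply, map_add, hℓ, zero_add] at h1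
    rw [h1, h z]
  have e00 := hinv 0
  simp only [Pi.zero_apply, add_zero, mul_zero] at e00
  have e0 := hinv (Pi.single 0 1)
  have e1 := hinv (Pi.single 1 1)
  have e2 := hinv (Pi.single 2 1)
  have e3 := hinv (Pi.single 3 1)
  have e4 := hinv (Pi.single 4 1)
  have e5 := hinv (Pi.single 5 1)
  simp at e0 e1 e2 e3 e4 e5
  have hn1 : n 1 = 0 := by
    have : γ * n 1 = 0 := by linear_combination e0 - e00
    exact (mul_eq_zero.1 this).resolve_left hγ
  have hn0' : n 0 = 0 := by
    have : γ * n 0 = 0 := by linear_combination e1 - e00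
    exact (mul_eq_zero.1 this).resolve_left hγ
  have c2 : n 4 * n00 + n 5 * n10 = 0 := by linear_combination e2 - e00
  have c3 : n 4 * n01 + n 5 * n11 = 0 := by linear_combination e3 - e00
  have c4 : n00 * n 2 + n01 * n 3 = 0 := by linear_combination e4 - e00
  have c5 : n10 * n 2 + n11 * n 3 = 0 := by linear_combination e5 - e00
  have hn4 : n 4 = 0 := by
    have : n 4 * (n00 * n11 - n01 * n10) = 0 := by linear_combination n11 * c2 - n10 * c3
    exact (mul_eq_zero.1 this).resolve_right hN
  have hn5 : n 5 = 0 := by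
    have : n 5 * (n00 * n11 - n01 * n10) = 0 := by linear_combination n00 * c3 - n01 * c2
    exact (mul_eq_zero.1 this).resolve_right hN
  have hn2 : n 2 = 0 := by
    have : n 2 * (n00 * n11 - n01 * n10) = 0 := by linear_combination n11 * c4 - n01 * c5
    exact (mul_eq_zero.1 this).resolve_right hN
  have hn3 : n 3 = 0 := by
    have : n 3 * (n00 * n11 - n01 * n10) = 0 := by linear_combination n00 * c5 - n10 * c4
    exact (mul_eq_zero.1 this).resolve_right hN
  apply hn0
  funext i
  fin_cases i
  · exact hn0'
  · exact hn1
  · exact hn2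
  · exact hn3
  · exact hn4
  · exact hn5

/-- The coordinate embedding of `K⁶` at six positions. -/
def emb6 (pos : Fin 6 → Fin 4 × Fin 4) : (Fin 6 → K) →ₗ[K] (Fin 4 × Fin 4 → K) :=
  ∑ i : Fin 6, (LinearMap.proj i : (Fin 6 → K) →ₗ[K] K).smulRight (Pi.single (pos i) (1 : K))

theorem emb6_apply (pos : Fin 6 → Fin 4 × Fin 4) (z : Fin 6 → K) (q : Fin 4 × Fin 4) :
    emb6 (K := K) pos z q = ∑ i : Fin 6, if q = pos i then z i else 0 := by
  simp only [emb6, LinearMap.coe_sum, Finset.sum_apply, LinearMap.smulRight_apply,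
    LinearMap.proj_apply, Pi.smul_apply, Pi.single_apply, smul_eq_mul, mul_ite, mul_one, mul_zero]

/-- **The Hessian reading, step 3**: every `2 × 2` minor of the cofactor matrix vanishes
(rows `ρ < ρ'`, columns `κ < κ'`; the `6`-dimensional coordinate block
`{u₃₃, u_{ρ₀κ₀}, u_{3κ}, u_{3κ'}, u_{ρ3}, u_{ρ'3}}` fed to `nondeg6`). -/
theorem minor_eq_zero_lt [CharZero K] (y : Fin 4 × Fin 4 → K) (c : Fin 4 → K)
    (Λ : Fin 4 → ((Fin 4 × Fin 4 → K) →ₗ[K] K))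
    (hQ : ∀ u : Fin 4 × Fin 4 → K, ∑ k, c k * (Λ k u) ^ 2 = Qf y u) :
    ∀ ρ ρ' κ κ' : Fin 3, ρ < ρ' → κ < κ' →
      cof y ρ κ * cof y ρ' κ' = cof y ρ κ' * cof y ρ' κ := by
  intro ρ ρ' κ κ' hρ hκ
  by_contra hne
  have hN : cof y ρ κ * cof y ρ' κ' - cof y ρ κ' * cof y ρ' κ ≠ 0 := sub_ne_zero.2 hne
  by_cases hγ : cof y ρ κ ≠ 0
  · refine nondeg6 (cof y ρ κ) (cof y ρ κ) (cof y ρ κ') (cof y ρ' κ) (cof y ρ' κ') hγ hN c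
      (fun k => (Λ k).comp (emb6 ![((3 : Fin 4), (3 : Fin 4)), (Fin.castSucc ρ, Fin.castSucc κ),
        (3, Fin.castSucc κ), (3, Fin.castSucc κ'), (Fin.castSucc ρ, 3), (Fin.castSucc ρ', 3)]))
      fun z => ?_
    simp only [LinearMap.comp_apply]
    rw [hQ]
    fin_cases ρ <;> fin_cases ρ' <;> fin_cases κ <;> fin_cases κ' <;>
      first
      | exact absurd hρ (by decide)
      | exact absurd hκ (by decide)
      | (simp [Qf, emb6_apply, Fin.sum_univ_six]; ring)
  · have hγ0 : cof y ρ κ = 0 := not_not.1 hγ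
    have hγ' : cof y ρ κ' ≠ 0 := by
      intro h0
      apply hN
      rw [hγ0, h0]
      ring
    refine nondeg6 (cof y ρ κ') (cof y ρ κ) (cof y ρ κ') (cof y ρ' κ) (cof y ρ' κ') hγ' hN c
      (fun k => (Λ k).comp (emb6 ![((3 : Fin 4), (3 : Fin 4)), (Fin.castSucc ρ, Fin.castSucc κ'),
        (3, Fin.castSucc κ), (3, Fin.castSucc κ'), (Fin.castSucc ρ, 3), (Fin.castSucc ρ', 3)]))
      fun z => ?_
    simp only [LinearMap.comp_apply]
    rw [hQ]
    fin_cases ρ <;> fin_cases ρ' <;> fin_cases κ <;> fin_cases κ' <;>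
      first
      | exact absurd hρ (by decide)
      | exact absurd hκ (by decide)
      | (simp [Qf, emb6_apply, Fin.sum_univ_six]; ring)

theorem minor_eq_zero [CharZero K] (y : Fin 4 × Fin 4 → K) (c : Fin 4 → K)
    (Λ : Fin 4 → ((Fin 4 × Fin 4 → K) →ₗ[K] K))
    (hQ : ∀ u : Fin 4 × Fin 4 → K, ∑ k, c k * (Λ k u) ^ 2 = Qf y u)
    (ρ ρ' κ κ' : Fin 3) (hρ : ρ ≠ ρ') :
    cof y ρ κ * cof y ρ' κ' = cof y ρ κ' * cof y ρ' κ := by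
  have key := minor_eq_zero_lt y c Λ hQ
  rcases eq_or_ne κ κ' with rfl | hκ
  · ring
  rcases lt_or_gt_of_ne hρ with h1 | h1 <;> rcases lt_or_gt_of_ne hκ with h2 | h2
  · exact key ρ ρ' κ κ' h1 h2
  · exact (key ρ ρ' κ' κ h1 h2).symm
  · have := key ρ' ρ κ κ' h1 h2
    linear_combination -this
  · have := key ρ' ρ κ' κ h1 h2
    linear_combination this

/-- **The Hessian reading** (closes `stub_cofactorRank33`): a per-direction family of four squares
at a block direction forces the cofactor matrix of the block to have rank `≤ 1`. [folklore] -/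
theorem cofRankLeOne_of_famAt [CharZero K] (y : Fin 4 × Fin 4 → K) (hrow : ∀ m, y (3, m) = 0)
    (hcol : ∀ m, y (m, 3) = 0) (hF : FamAt y) : CofRankLeOne y := by
  obtain ⟨c, Λ, h⟩ := hF
  have hQ := sum_sq_eq_Qf y hrow hcol c Λ h
  have M := minor_eq_zero y c Λ hQ
  refine ⟨fun m m' => ?_, fun m m' => ?_, fun m m' => ?_⟩
  · simpa using M 2 1 m m' (by decide)
  · simpa using M 2 0 m m' (by decide)
  · simpa using M 1 0 m m' (by decide)

/-- **Leaf R1C — THE HESSIAN READING** (PROVED in rev 8, §2g — `second_diff` (the identity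
`per(u+y) + per(u−y) − 2 per(u) = 2 Q_y(u)` by `permanent_fin_four_row` + `ring`) … (memo). [folklore] -/
theorem stub_cofactorRank33 [CharZero K] :
    ∀ y : Fin 4 × Fin 4 → K, (∀ m, y (3, m) = 0) → (∀ m, y (m, 3) = 0) → FamAt y →
      CofRankLeOne y :=
  fun y hrow hcol hF => cofRankLeOne_of_famAt y hrow hcol hF

/-- **Leaf R1C — POINT LEMMA** (PROVED in rev 7 from the Hessian reading `stub_cofactorRank33` and
the sorry-free `3 × 3` lemma `concl3_of_rankOne`, §2e–2f; PAPER: memo §6.1 … (memo). -/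
theorem stub_blockPoint33 [CharZero K] :
    ∀ y : Fin 4 × Fin 4 → K, (∀ m, y (3, m) = 0) → (∀ m, y (m, 3) = 0) →
      Sing3At y → FamAt y → PointConcl 3 3 y :=
  fun y hrow hcol hS hF => blockPoint33_of_reading stub_cofactorRank33 y hrow hcol hS hF

/-- **Leaf R1C** (REDUCED in rev 6 to its point lemma `stub_blockPoint33`: the union step over the
`3 + 3 + 16` subspaces — ✓ Mathlib … (memo). [folklore] -/
theorem stub_threeByThree [CharZero K] :
    ∀ W : Submodule K (Fin 4 × Fin 4 → K), Sing3 W → finrank K W = 5 →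
      (∃ i : Fin 4, ∀ x ∈ W, ∀ j : Fin 4, x (i, j) = 0) →
      (∃ j : Fin 4, ∀ x ∈ W, ∀ i : Fin 4, x (i, j) = 0) →
      ¬ TwoZeroRows W → ¬ TwoZeroCols W → ¬ InCross W → PerDirFour W → False := by
  intro W hS _h5 hi hj h2r h2c hX hP
  exact threeByThree_of_point (blockPoint_of_33 stub_blockPoint33) W hS hi hj h2r h2c hX
    (fun y hy => hP y hy)

/-! ## 2h. Leaf R1N — tools and the full-row-rank branch (rev 9; memo §6.2–6.3): (T1) manufactured
two-row families `trunc_familyPQ` (via `second_diff₁`, `sum_sq_eq_Q1`), (T1′) `common_colPQ` / `common_col_gen`,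
(T2) `polar₁`, the kernel plane `kerPlane`, (B3) `nr4_false` (no live row of full rank), `threeRowsFourCols_of_residual`. -/

/-- The `s²`-coefficient of `per₄ (u + s y)` at a direction `y` with row `3` zero (memo (I2)):
`Q_y(u) = u₃ᵀ · (P(y₁,y₂) u₀ + P(y₀,y₂) u₁ + P(y₀,y₁) u₂)`, written out. -/
def Q1 (y u : Fin 4 × Fin 4 → K) : K :=
    u (3, 0) * u (0, 1) * xf 1 2 2 3 y + u (3, 0) * u (0, 2) * xf 1 2 1 3 y + u (3, 0) * u (0, 3) * xf 1 2 1 2 y +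
    u (3, 1) * u (0, 0) * xf 1 2 2 3 y + u (3, 1) * u (0, 2) * xf 1 2 0 3 y + u (3, 1) * u (0, 3) * xf 1 2 0 2 y +
    u (3, 2) * u (0, 0) * xf 1 2 1 3 y + u (3, 2) * u (0, 1) * xf 1 2 0 3 y + u (3, 2) * u (0, 3) * xf 1 2 0 1 y +
    u (3, 3) * u (0, 0) * xf 1 2 1 2 y + u (3, 3) * u (0, 1) * xf 1 2 0 2 y + u (3, 3) * u (0, 2) * xf 1 2 0 1 y +
    u (3, 0) * u (1, 1) * xf 0 2 2 3 y + u (3, 0) * u (1, 2) * xf 0 2 1 3 y + u (3, 0) * u (1, 3) * xf 0 2 1 2 y +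
    u (3, 1) * u (1, 0) * xf 0 2 2 3 y + u (3, 1) * u (1, 2) * xf 0 2 0 3 y + u (3, 1) * u (1, 3) * xf 0 2 0 2 y +
    u (3, 2) * u (1, 0) * xf 0 2 1 3 y + u (3, 2) * u (1, 1) * xf 0 2 0 3 y + u (3, 2) * u (1, 3) * xf 0 2 0 1 y +
    u (3, 3) * u (1, 0) * xf 0 2 1 2 y + u (3, 3) * u (1, 1) * xf 0 2 0 2 y + u (3, 3) * u (1, 2) * xf 0 2 0 1 y +
    u (3, 0) * u (2, 1) * xf 0 1 2 3 y + u (3, 0) * u (2, 2) * xf 0 1 1 3 y + u (3, 0) * u (2, 3) * xf 0 1 1 2 y +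
    u (3, 1) * u (2, 0) * xf 0 1 2 3 y + u (3, 1) * u (2, 2) * xf 0 1 0 3 y + u (3, 1) * u (2, 3) * xf 0 1 0 2 y +
    u (3, 2) * u (2, 0) * xf 0 1 1 3 y + u (3, 2) * u (2, 1) * xf 0 1 0 3 y + u (3, 2) * u (2, 3) * xf 0 1 0 1 y +
    u (3, 3) * u (2, 0) * xf 0 1 1 2 y + u (3, 3) * u (2, 1) * xf 0 1 0 2 y + u (3, 3) * u (2, 2) * xf 0 1 0 1 y

/-- **Second finite difference of `per₄` along a one-zero-row direction**:
`per(u + y) + per(u − y) − 2 per(u) = 2 Q_y(u)` (the quartic term is `per y = 0`). [folklore] -/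
theorem second_diff₁ (y : Fin 4 × Fin 4 → K) (hrow : ∀ m, y (3, m) = 0) (u : Fin 4 × Fin 4 → K) :
    eval (u + y) (perPoly (Fin 4) K) + eval (u - y) (perPoly (Fin 4) K) -
      2 * eval u (perPoly (Fin 4) K) = 2 * Q1 y u := by
  have h30 := hrow 0; have h31 := hrow 1; have h32 := hrow 2; have h33 := hrow 3
  simp only [eval_perPoly, Matrix.permanent_fin_four_row, Matrix.of_apply, Pi.add_apply,
    Pi.sub_apply, h30, h31, h32, h33, add_zero, sub_zero, Q1, xf]
  ring

/-- **The one-zero-row Hessian reading**: a per-direction family of squares at `y` represents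
exactly `Q_y`. [folklore] -/
theorem sum_sq_eq_Q1 [CharZero K] (y : Fin 4 × Fin 4 → K) (hrow : ∀ m, y (3, m) = 0)
    {ι : Type*} [Fintype ι] (c : ι → K) (Λ : ι → ((Fin 4 × Fin 4 → K) →ₗ[K] K))
    (h : ∀ u : Fin 4 × Fin 4 → K, ∃ e₀ e₁ : K, ∀ s : K,
      eval (u + s • y) (perPoly (Fin 4) K) = e₀ + s * e₁ + s ^ 2 * ∑ k, c k * (Λ k u) ^ 2)
    (u : Fin 4 × Fin 4 → K) : ∑ k, c k * (Λ k u) ^ 2 = Q1 y u := by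
  obtain ⟨e₀, e₁, he⟩ := h u
  have h0 := he 0
  have h1 := he 1
  have h1' := he (-1)
  rw [zero_smul, add_zero] at h0
  rw [one_smul] at h1
  rw [neg_one_smul, ← sub_eq_add_neg] at h1'
  have hd := second_diff₁ y hrow u
  have h2 : (2 : K) * ∑ k, c k * (Λ k u) ^ 2 = 2 * Q1 y u := by
    linear_combination hd - h1 - h1' + 2 * h0
  exact (mul_right_inj' two_ne_zero).1 h2

/-- The two-row truncation of `y` to the rows `p, q`. -/
def trunc (p q : Fin 4) (y : Fin 4 × Fin 4 → K) : Fin 4 × Fin 4 → K :=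
  fun x => if x.1 = p then y (p, x.2) else if x.1 = q then y (q, x.2) else 0

theorem trunc_supp (p q : Fin 4) (y : Fin 4 × Fin 4 → K) :
    ∀ i j : Fin 4, i ≠ p → i ≠ q → trunc p q y (i, j) = 0 := by
  intro i j hip hiq
  simp [trunc, hip, hiq]

/-- Zeroing the rows `p, q` of `u` (a linear map). -/
def zeroRows (p q : Fin 4) : (Fin 4 × Fin 4 → K) →ₗ[K] (Fin 4 × Fin 4 → K) where
  toFun u x := if x.1 = p ∨ x.1 = q then 0 else u x
  map_add' u v := by
    ext x
    simp only [Pi.add_apply]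
    split_ifs <;> simp
  map_smul' c u := by
    ext x
    simp only [Pi.smul_apply, smul_eq_mul, RingHom.id_apply]
    split_ifs <;> simp

theorem zeroRows_apply (p q : Fin 4) (u : Fin 4 × Fin 4 → K) (x : Fin 4 × Fin 4) :
    zeroRows p q u x = if x.1 = p ∨ x.1 = q then 0 else u x := rfl

/-- The MANUFACTURED family at the two-row truncation to the rows `0, 1`: with
`Σ c_k Λ_k(u)² = Q_y(u)`, the truncation carries the family `Λ_k ∘ zeroRows 0 1`. [folklore] -/
theorem trunc_family01 [CharZero K] (y : Fin 4 × Fin 4 → K) (_hrow : ∀ m, y (3, m) = 0)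
    (c : Fin 4 → K) (Λ : Fin 4 → ((Fin 4 × Fin 4 → K) →ₗ[K] K))
    (hQ : ∀ u : Fin 4 × Fin 4 → K, ∑ k, c k * (Λ k u) ^ 2 = Q1 y u) :
    ∀ u : Fin 4 × Fin 4 → K, ∃ e₀ e₁ : K, ∀ s : K,
      eval (u + s • trunc 0 1 y) (perPoly (Fin 4) K) =
        e₀ + s * e₁ + s ^ 2 * ∑ k, c k * (((Λ k).comp (zeroRows 0 1)) u) ^ 2 := by
  intro u
  refine ⟨eval u (perPoly (Fin 4) K),
    (eval (u + trunc 0 1 y) (perPoly (Fin 4) K) - eval (u - trunc 0 1 y) (perPoly (Fin 4) K)) / 2,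
    fun s => ?_⟩
  simp only [LinearMap.comp_apply]
  rw [hQ (zeroRows 0 1 u)]
  have key : 2 * eval (u + s • trunc 0 1 y) (perPoly (Fin 4) K) =
      2 * eval u (perPoly (Fin 4) K) +
        s * (eval (u + trunc 0 1 y) (perPoly (Fin 4) K) - eval (u - trunc 0 1 y) (perPoly (Fin 4) K)) +
        2 * s ^ 2 * Q1 y (zeroRows 0 1 u) := by
    simp only [eval_perPoly, Matrix.permanent_fin_four_row, Matrix.of_apply, Pi.add_apply,
      Pi.sub_apply, Pi.smul_apply, smul_eq_mul, trunc, zeroRows_apply, Q1, xf]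
    simp
    ring
  have h2 : (2 : K) ≠ 0 := two_ne_zero
  field_simp
  linear_combination key

/-- The MANUFACTURED family at the two-row truncation to the rows `0, 2`: with
`Σ c_k Λ_k(u)² = Q_y(u)`, the truncation carries the family `Λ_k ∘ zeroRows 0 2`. [folklore] -/
theorem trunc_family02 [CharZero K] (y : Fin 4 × Fin 4 → K) (_hrow : ∀ m, y (3, m) = 0)
    (c : Fin 4 → K) (Λ : Fin 4 → ((Fin 4 × Fin 4 → K) →ₗ[K] K))
    (hQ : ∀ u : Fin 4 × Fin 4 → K, ∑ k, c k * (Λ k u) ^ 2 = Q1 y u) :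
    ∀ u : Fin 4 × Fin 4 → K, ∃ e₀ e₁ : K, ∀ s : K,
      eval (u + s • trunc 0 2 y) (perPoly (Fin 4) K) =
        e₀ + s * e₁ + s ^ 2 * ∑ k, c k * (((Λ k).comp (zeroRows 0 2)) u) ^ 2 := by
  intro u
  refine ⟨eval u (perPoly (Fin 4) K),
    (eval (u + trunc 0 2 y) (perPoly (Fin 4) K) - eval (u - trunc 0 2 y) (perPoly (Fin 4) K)) / 2,
    fun s => ?_⟩
  simp only [LinearMap.comp_apply]
  rw [hQ (zeroRows 0 2 u)]
  have key : 2 * eval (u + s • trunc 0 2 y) (perPoly (Fin 4) K) =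
      2 * eval u (perPoly (Fin 4) K) +
        s * (eval (u + trunc 0 2 y) (perPoly (Fin 4) K) - eval (u - trunc 0 2 y) (perPoly (Fin 4) K)) +
        2 * s ^ 2 * Q1 y (zeroRows 0 2 u) := by
    simp only [eval_perPoly, Matrix.permanent_fin_four_row, Matrix.of_apply, Pi.add_apply,
      Pi.sub_apply, Pi.smul_apply, smul_eq_mul, trunc, zeroRows_apply, Q1, xf]
    simp
    ring
  have h2 : (2 : K) ≠ 0 := two_ne_zero
  field_simp
  linear_combination key

/-- The MANUFACTURED family at the two-row truncation to the rows `1, 2`: with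
`Σ c_k Λ_k(u)² = Q_y(u)`, the truncation carries the family `Λ_k ∘ zeroRows 1 2`. [folklore] -/
theorem trunc_family12 [CharZero K] (y : Fin 4 × Fin 4 → K) (_hrow : ∀ m, y (3, m) = 0)
    (c : Fin 4 → K) (Λ : Fin 4 → ((Fin 4 × Fin 4 → K) →ₗ[K] K))
    (hQ : ∀ u : Fin 4 × Fin 4 → K, ∑ k, c k * (Λ k u) ^ 2 = Q1 y u) :
    ∀ u : Fin 4 × Fin 4 → K, ∃ e₀ e₁ : K, ∀ s : K,
      eval (u + s • trunc 1 2 y) (perPoly (Fin 4) K) =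
        e₀ + s * e₁ + s ^ 2 * ∑ k, c k * (((Λ k).comp (zeroRows 1 2)) u) ^ 2 := by
  intro u
  refine ⟨eval u (perPoly (Fin 4) K),
    (eval (u + trunc 1 2 y) (perPoly (Fin 4) K) - eval (u - trunc 1 2 y) (perPoly (Fin 4) K)) / 2,
    fun s => ?_⟩
  simp only [LinearMap.comp_apply]
  rw [hQ (zeroRows 1 2 u)]
  have key : 2 * eval (u + s • trunc 1 2 y) (perPoly (Fin 4) K) =
      2 * eval u (perPoly (Fin 4) K) +
        s * (eval (u + trunc 1 2 y) (perPoly (Fin 4) K) - eval (u - trunc 1 2 y) (perPoly (Fin 4) K)) +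
        2 * s ^ 2 * Q1 y (zeroRows 1 2 u) := by
    simp only [eval_perPoly, Matrix.permanent_fin_four_row, Matrix.of_apply, Pi.add_apply,
      Pi.sub_apply, Pi.smul_apply, smul_eq_mul, trunc, zeroRows_apply, Q1, xf]
    simp
    ring
  have h2 : (2 : K) ≠ 0 := two_ne_zero
  field_simp
  linear_combination key

/-- Truncation to the rows `p, q` as a linear map. -/
def truncL (p q : Fin 4) : (Fin 4 × Fin 4 → K) →ₗ[K] (Fin 4 × Fin 4 → K) where
  toFun := trunc p q
  map_add' x y := by
    ext z
    simp only [trunc, Pi.add_apply]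
    split_ifs <;> simp
  map_smul' c x := by
    ext z
    simp only [trunc, Pi.smul_apply, smul_eq_mul, RingHom.id_apply]
    split_ifs <;> simp

theorem truncL_apply (p q : Fin 4) (y : Fin 4 × Fin 4 → K) : truncL p q y = trunc p q y := rfl

/-- **(T1′) for the rows `0, 1`**: if `W` (row `3` zero, per-direction families) has no
non-zero element supported outside the rows `0, 1`, then the rows `0, 1` of `W` have … (memo). [folklore] -/
theorem common_col01 [CharZero K] (W : Submodule K (Fin 4 × Fin 4 → K)) (h5 : finrank K W = 5)
    (hrow : ∀ x ∈ W, ∀ j : Fin 4, x (3, j) = 0) (hP : PerDirFour W)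
    (hinj : ∀ x ∈ W, (∀ j : Fin 4, x (0, j) = 0) → (∀ j : Fin 4, x (1, j) = 0) → x = 0) :
    ∃ m : Fin 4, ∀ y ∈ W, y (0, m) = 0 ∧ y (1, m) = 0 := by
  set W' : Submodule K (Fin 4 × Fin 4 → K) := W.map (truncL 0 1) with hW'
  have hker : ∀ x ∈ W, truncL (K := K) 0 1 x = 0 → x = 0 := by
    intro x hx h0
    have h := fun i j => congr_fun h0 ((i : Fin 4), (j : Fin 4))
    refine hinj x hx (fun j => ?_) (fun j => ?_)
    · simpa [truncL_apply, trunc] using h 0 j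
    · simpa [truncL_apply, trunc] using h 1 j
  have h5' : finrank K W' = 5 := by
    have hinj' : Function.Injective ((truncL (K := K) 0 1).comp W.subtype) := by
      rw [← LinearMap.ker_eq_bot, LinearMap.ker_eq_bot']
      rintro ⟨x, hx⟩ h0
      exact Subtype.ext (hker x hx h0)
    have h := LinearMap.finrank_range_of_inj hinj'
    rw [LinearMap.range_comp, Submodule.range_subtype] at h
    rw [hW', h]
    exact h5
  have hsupp : ∀ y ∈ W', ∀ i j : Fin 4, i ≠ 0 → i ≠ 1 → y (i, j) = 0 := by
    rintro _ ⟨x, -, rfl⟩ i j hi0 hi1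
    exact trunc_supp 0 1 x i j hi0 hi1
  have hP' : ∀ y ∈ W', ∃ (c : Fin 4 → K) (Λ : Fin 4 → ((Fin 4 × Fin 4 → K) →ₗ[K] K)),
      ∀ u : Fin 4 × Fin 4 → K, ∃ e₀ e₁ : K, ∀ s : K,
        eval (u + s • y) (perPoly (Fin 4) K) = e₀ + s * e₁ + s ^ 2 * ∑ k, c k * (Λ k u) ^ 2 := by
    rintro _ ⟨x, hx, rfl⟩
    obtain ⟨c, Λ, h⟩ := hP x hx
    exact ⟨c, fun k => (Λ k).comp (zeroRows 0 1),
      trunc_family01 x (hrow x hx) c Λ (sum_sq_eq_Q1 x (hrow x hx) c Λ h)⟩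
  obtain ⟨m, hm⟩ := twoRows_common_col W' h5' (p := 0) (q := 1) (by decide) hsupp hP'
  refine ⟨m, fun y hy => ?_⟩
  have h := hm (truncL 0 1 y) (Submodule.mem_map_of_mem hy)
  simpa [truncL_apply, trunc] using h

/-- **(T1′) for the rows `0, 2`**: if `W` (row `3` zero, per-direction families) has no
non-zero element supported outside the rows `0, 2`, then the rows `0, 2` of `W` have … (memo). [folklore] -/
theorem common_col02 [CharZero K] (W : Submodule K (Fin 4 × Fin 4 → K)) (h5 : finrank K W = 5)
    (hrow : ∀ x ∈ W, ∀ j : Fin 4, x (3, j) = 0) (hP : PerDirFour W)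
    (hinj : ∀ x ∈ W, (∀ j : Fin 4, x (0, j) = 0) → (∀ j : Fin 4, x (2, j) = 0) → x = 0) :
    ∃ m : Fin 4, ∀ y ∈ W, y (0, m) = 0 ∧ y (2, m) = 0 := by
  set W' : Submodule K (Fin 4 × Fin 4 → K) := W.map (truncL 0 2) with hW'
  have hker : ∀ x ∈ W, truncL (K := K) 0 2 x = 0 → x = 0 := by
    intro x hx h0
    have h := fun i j => congr_fun h0 ((i : Fin 4), (j : Fin 4))
    refine hinj x hx (fun j => ?_) (fun j => ?_)
    · simpa [truncL_apply, trunc] using h 0 j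
    · simpa [truncL_apply, trunc] using h 2 j
  have h5' : finrank K W' = 5 := by
    have hinj' : Function.Injective ((truncL (K := K) 0 2).comp W.subtype) := by
      rw [← LinearMap.ker_eq_bot, LinearMap.ker_eq_bot']
      rintro ⟨x, hx⟩ h0
      exact Subtype.ext (hker x hx h0)
    have h := LinearMap.finrank_range_of_inj hinj'
    rw [LinearMap.range_comp, Submodule.range_subtype] at h
    rw [hW', h]
    exact h5
  have hsupp : ∀ y ∈ W', ∀ i j : Fin 4, i ≠ 0 → i ≠ 2 → y (i, j) = 0 := by
    rintro _ ⟨x, -, rfl⟩ i j hi0 hi1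
    exact trunc_supp 0 2 x i j hi0 hi1
  have hP' : ∀ y ∈ W', ∃ (c : Fin 4 → K) (Λ : Fin 4 → ((Fin 4 × Fin 4 → K) →ₗ[K] K)),
      ∀ u : Fin 4 × Fin 4 → K, ∃ e₀ e₁ : K, ∀ s : K,
        eval (u + s • y) (perPoly (Fin 4) K) = e₀ + s * e₁ + s ^ 2 * ∑ k, c k * (Λ k u) ^ 2 := by
    rintro _ ⟨x, hx, rfl⟩
    obtain ⟨c, Λ, h⟩ := hP x hx
    exact ⟨c, fun k => (Λ k).comp (zeroRows 0 2),
      trunc_family02 x (hrow x hx) c Λ (sum_sq_eq_Q1 x (hrow x hx) c Λ h)⟩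
  obtain ⟨m, hm⟩ := twoRows_common_col W' h5' (p := 0) (q := 2) (by decide) hsupp hP'
  refine ⟨m, fun y hy => ?_⟩
  have h := hm (truncL 0 2 y) (Submodule.mem_map_of_mem hy)
  simpa [truncL_apply, trunc] using h

/-- **(T1′) for the rows `1, 2`**: if `W` (row `3` zero, per-direction families) has no
non-zero element supported outside the rows `1, 2`, then the rows `1, 2` of `W` have … (memo). [folklore] -/
theorem common_col12 [CharZero K] (W : Submodule K (Fin 4 × Fin 4 → K)) (h5 : finrank K W = 5)
    (hrow : ∀ x ∈ W, ∀ j : Fin 4, x (3, j) = 0) (hP : PerDirFour W)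
    (hinj : ∀ x ∈ W, (∀ j : Fin 4, x (1, j) = 0) → (∀ j : Fin 4, x (2, j) = 0) → x = 0) :
    ∃ m : Fin 4, ∀ y ∈ W, y (1, m) = 0 ∧ y (2, m) = 0 := by
  set W' : Submodule K (Fin 4 × Fin 4 → K) := W.map (truncL 1 2) with hW'
  have hker : ∀ x ∈ W, truncL (K := K) 1 2 x = 0 → x = 0 := by
    intro x hx h0
    have h := fun i j => congr_fun h0 ((i : Fin 4), (j : Fin 4))
    refine hinj x hx (fun j => ?_) (fun j => ?_)
    · simpa [truncL_apply, trunc] using h 1 j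
    · simpa [truncL_apply, trunc] using h 2 j
  have h5' : finrank K W' = 5 := by
    have hinj' : Function.Injective ((truncL (K := K) 1 2).comp W.subtype) := by
      rw [← LinearMap.ker_eq_bot, LinearMap.ker_eq_bot']
      rintro ⟨x, hx⟩ h0
      exact Subtype.ext (hker x hx h0)
    have h := LinearMap.finrank_range_of_inj hinj'
    rw [LinearMap.range_comp, Submodule.range_subtype] at h
    rw [hW', h]
    exact h5
  have hsupp : ∀ y ∈ W', ∀ i j : Fin 4, i ≠ 1 → i ≠ 2 → y (i, j) = 0 := by
    rintro _ ⟨x, -, rfl⟩ i j hi0 hi1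
    exact trunc_supp 1 2 x i j hi0 hi1
  have hP' : ∀ y ∈ W', ∃ (c : Fin 4 → K) (Λ : Fin 4 → ((Fin 4 × Fin 4 → K) →ₗ[K] K)),
      ∀ u : Fin 4 × Fin 4 → K, ∃ e₀ e₁ : K, ∀ s : K,
        eval (u + s • y) (perPoly (Fin 4) K) = e₀ + s * e₁ + s ^ 2 * ∑ k, c k * (Λ k u) ^ 2 := by
    rintro _ ⟨x, hx, rfl⟩
    obtain ⟨c, Λ, h⟩ := hP x hx
    exact ⟨c, fun k => (Λ k).comp (zeroRows 1 2),
      trunc_family12 x (hrow x hx) c Λ (sum_sq_eq_Q1 x (hrow x hx) c Λ h)⟩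
  obtain ⟨m, hm⟩ := twoRows_common_col W' h5' (p := 1) (q := 2) (by decide) hsupp hP'
  refine ⟨m, fun y hy => ?_⟩
  have h := hm (truncL 1 2 y) (Submodule.mem_map_of_mem hy)
  simpa [truncL_apply, trunc] using h

/-! ### (T1″) general pairs, the kernel plane, (B3) the full-row-rank branch `n_r = 4` (memo §6.3) -/

/-- (T1′) for a general pair of live rows. [folklore] -/
theorem common_col_gen [CharZero K] (W : Submodule K (Fin 4 × Fin 4 → K))
    (h5 : finrank K W = 5) (hrow : ∀ x ∈ W, ∀ j : Fin 4, x (3, j) = 0) (hP : PerDirFour W)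
    (p q : Fin 4) (hpq : p ≠ q) (hp : p ≠ 3) (hq : q ≠ 3)
    (hinj : ∀ x ∈ W, (∀ j : Fin 4, x (p, j) = 0) → (∀ j : Fin 4, x (q, j) = 0) → x = 0) :
    ∃ m : Fin 4, ∀ y ∈ W, y (p, m) = 0 ∧ y (q, m) = 0 := by
  have hi4 : ∀ i : Fin 4, i = 0 ∨ i = 1 ∨ i = 2 ∨ i = 3 := by decide
  have swap : ∀ p' q' : Fin 4, (∃ m : Fin 4, ∀ y ∈ W, y (q', m) = 0 ∧ y (p', m) = 0) →
      ∃ m : Fin 4, ∀ y ∈ W, y (p', m) = 0 ∧ y (q', m) = 0 :=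
    fun p' q' ⟨m, hm⟩ => ⟨m, fun y hy => (hm y hy).symm⟩
  rcases hi4 p with rfl | rfl | rfl | rfl <;> rcases hi4 q with rfl | rfl | rfl | rfl <;> first
    | exact absurd rfl hpq
    | exact absurd rfl hp
    | exact absurd rfl hq
    | exact common_col01 W h5 hrow hP hinj
    | exact common_col02 W h5 hrow hP hinj
    | exact common_col12 W h5 hrow hP hinj
    | exact swap _ _ (common_col01 W h5 hrow hP (fun x hx h0 h1 => hinj x hx h1 h0))
    | exact swap _ _ (common_col02 W h5 hrow hP (fun x hx h0 h1 => hinj x hx h1 h0))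
    | exact swap _ _ (common_col12 W h5 hrow hP (fun x hx h0 h1 => hinj x hx h1 h0))

/-- The kernel plane `K_r = {k ∈ W : row r of k = 0}` (as an ambient submodule). -/
def kerPlane (W : Submodule K (Fin 4 × Fin 4 → K)) (r : Fin 4) :
    Submodule K (Fin 4 × Fin 4 → K) :=
  W ⊓ LinearMap.ker (rowL (K := K) r)

theorem mem_kerPlane (W : Submodule K (Fin 4 × Fin 4 → K)) (r : Fin 4)
    (d : Fin 4 × Fin 4 → K) : d ∈ kerPlane W r ↔ d ∈ W ∧ row d r = 0 := by
  simp only [kerPlane, Submodule.mem_inf, LinearMap.mem_ker, rowL_apply]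

/-- rank–nullity for the row-`r` map on `W`. [folklore] -/
theorem finrank_kerPlane (W : Submodule K (Fin 4 × Fin 4 → K)) (r : Fin 4) :
    finrank K (kerPlane W r) + finrank K (W.map (rowL (K := K) r)) = finrank K W := by
  set f : W →ₗ[K] (Fin 4 → K) := (rowL (K := K) r).comp W.subtype with hf
  have hk : (LinearMap.ker f).map W.subtype = kerPlane W r := by
    ext d
    rw [mem_kerPlane, Submodule.mem_map]
    constructor
    · rintro ⟨w, hw, rfl⟩
      rw [LinearMap.mem_ker] at hw
      exact ⟨w.2, hw⟩
    · rintro ⟨hd, hdr⟩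
      exact ⟨⟨d, hd⟩, by rw [LinearMap.mem_ker]; exact hdr, rfl⟩
  have hrange : LinearMap.range f = W.map (rowL (K := K) r) := by
    rw [hf, LinearMap.range_comp, Submodule.range_subtype]
  have h1 := LinearMap.finrank_range_add_finrank_ker f
  rw [hrange] at h1
  rw [← hk, Submodule.finrank_map_subtype_eq]
  omega

/-- **§6.3 (B3)**: no live row `r` of `W` projects onto `K⁴` (the kernel plane `K_r` would be a
line, so one of the two other live rows has no pure element; then (T1′) kills a column of row `r`,
contradicting surjectivity). [folklore] -/
theorem nr4_false [CharZero K] (W : Submodule K (Fin 4 × Fin 4 → K)) (h5 : finrank K W = 5)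
    (hrow : ∀ x ∈ W, ∀ j : Fin 4, x (3, j) = 0) (hP : PerDirFour W)
    (r s t : Fin 4) (hrs : r ≠ s) (hrt : r ≠ t) (hr3 : r ≠ 3) (hs3 : s ≠ 3) (ht3 : t ≠ 3)
    (hcov : ∀ i : Fin 4, i = r ∨ i = s ∨ i = t ∨ i = 3)
    (hsurj : W.map (rowL (K := K) r) = ⊤) : False := by
  have hk : finrank K (kerPlane W r) = 1 := by
    have h := finrank_kerPlane W r
    rw [hsurj, finrank_top, Module.finrank_fintype_fun_eq_card, Fintype.card_fin] at h
    have h5W : finrank K W = 5 := h5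
    omega
  have zero_of : ∀ x ∈ W, (∀ m, x (r, m) = 0) → (∀ m, x (s, m) = 0) → (∀ m, x (t, m) = 0) →
      x = 0 := by
    intro x hx h1 h2 h3
    ext ⟨i, m⟩
    rw [Pi.zero_apply]
    rcases hcov i with rfl | rfl | rfl | rfl
    · exact h1 m
    · exact h2 m
    · exact h3 m
    · exact hrow x hx m
  have unit_absurd : ∀ p q : Fin 4, (∃ m : Fin 4, ∀ y ∈ W, y (p, m) = 0 ∧ y (q, m) = 0) →
      p = r → False := by
    rintro p q ⟨m, hm⟩ rfl
    have hmem : (Pi.single m (1 : K) : Fin 4 → K) ∈ W.map (rowL (K := K) p) := by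
      rw [hsurj]
      exact Submodule.mem_top
    obtain ⟨y, hy, hyr⟩ := hmem
    have h : y (p, m) = (Pi.single m (1 : K) : Fin 4 → K) m := congr_fun hyr m
    rw [(hm y hy).1, Pi.single_eq_same] at h
    exact zero_ne_one h
  by_cases ha : ∀ a ∈ W, (∀ m, a (r, m) = 0) → (∀ m, a (s, m) = 0) → a = 0
  · exact unit_absurd r s (common_col_gen W h5 hrow hP r s hrs hr3 hs3 ha) rfl
  by_cases hb : ∀ b ∈ W, (∀ m, b (r, m) = 0) → (∀ m, b (t, m) = 0) → b = 0
  · exact unit_absurd r t (common_col_gen W h5 hrow hP r t hrt hr3 ht3 hb) rfl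
  push Not at ha hb
  obtain ⟨a, haW, har, has, hane⟩ := ha
  obtain ⟨b, hbW, hbr, hbt, hbne⟩ := hb
  have haK : a ∈ kerPlane W r := (mem_kerPlane W r a).2 ⟨haW, funext har⟩
  have hbK : b ∈ kerPlane W r := (mem_kerPlane W r b).2 ⟨hbW, funext hbr⟩
  have hane' : (⟨a, haK⟩ : kerPlane W r) ≠ 0 := by
    intro h
    apply hane
    have := congr_arg (fun z : kerPlane W r => (z : Fin 4 × Fin 4 → K)) h
    simpa using this
  obtain ⟨μ, hμ⟩ :=
    (finrank_eq_one_iff_of_nonzero' (K := K) (V := kerPlane W r) _ hane').1 hk ⟨b, hbK⟩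
  have hμ' : μ • a = b := by
    have := congr_arg (fun z : kerPlane W r => (z : Fin 4 × Fin 4 → K)) hμ
    simpa using this
  apply hbne
  refine zero_of b hbW hbr ?_ hbt
  intro m
  rw [← hμ', Pi.smul_apply, has m, smul_zero]

/-- **Mixed polarisation**: if `x, k ∈ W ⊆ Sing` and row `r` of `k` vanishes, then
`T3 (row x r) (row x s) (row k t) + T3 (row x r) (row k s) (row x t) = 0` (the `λ¹`-coefficient … (memo). [folklore] -/
theorem polar₁ [CharZero K] {W : Submodule K (Fin 4 × Fin 4 → K)} (hS : Sing3 W)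
    {r s t : Fin 4} (hrs : r ≠ s) (hrt : r ≠ t) (hst : s ≠ t)
    {x : Fin 4 × Fin 4 → K} (hx : x ∈ W) {k : Fin 4 × Fin 4 → K} (hk : k ∈ W)
    (hkr : row k r = 0) (l : Fin 4) :
    T3 (row x r) (row x s) (row k t) l + T3 (row x r) (row k s) (row x t) l = 0 := by
  have h1 := T3_eq_zero_of_sing3 hS (W.add_mem hx hk) r s t hrs hrt hst l
  have h2 := T3_eq_zero_of_sing3 hS (W.sub_mem hx hk) r s t hrs hrt hst l
  rw [row_add, row_add, row_add, hkr, add_zero] at h1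
  rw [row_sub, row_sub, row_sub, hkr, sub_zero] at h2
  have e1 : T3 (row x r) (row x s + row k s) (row x t + row k t) l =
      T3 (row x r) (row x s) (row x t) l + T3 (row x r) (row x s) (row k t) l +
        T3 (row x r) (row k s) (row x t) l + T3 (row x r) (row k s) (row k t) l := by
    simp only [T3, Pi.add_apply]; ring
  have e2 : T3 (row x r) (row x s - row k s) (row x t - row k t) l =
      T3 (row x r) (row x s) (row x t) l - T3 (row x r) (row x s) (row k t) l -
        T3 (row x r) (row k s) (row x t) l + T3 (row x r) (row k s) (row k t) l := by
    simp only [T3, Pi.sub_apply]; ring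
  have h3 : (2 : K) * (T3 (row x r) (row x s) (row k t) l + T3 (row x r) (row k s) (row x t) l) = 0 := by
    linear_combination h1 - h2 - e1 + e2
  rcases mul_eq_zero.mp h3 with h | h
  · exact absurd h two_ne_zero
  · exact h

/-! ### Leaf R1N from the NARROWED residual (normal form: zero row `3`, no live row of full rank) -/

/-- **Leaf R1N ⇐ its narrowed residual.** Transport the zero row to row `3` (`rowPermL`, `per₄`
invariant ✓ `eval_perPoly_comp_prodCongr`, families by ✓ `sum_sq_swap_map`); a … (memo). [folklore] -/
theorem threeRowsFourCols_of_residual [CharZero K]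
    (hres : ∀ W : Submodule K (Fin 4 × Fin 4 → K), Sing3 W → finrank K W = 5 →
      (∀ x ∈ W, ∀ j : Fin 4, x (3, j) = 0) →
      ¬ (∃ j : Fin 4, ∀ x ∈ W, ∀ i : Fin 4, x (i, j) = 0) →
      ¬ TwoZeroRows W → ¬ InCross W → PerDirFour W →
      (∀ r : Fin 4, W.map (rowL (K := K) r) ≠ ⊤) → False) :
    ∀ W : Submodule K (Fin 4 × Fin 4 → K), Sing3 W → finrank K W = 5 →
      (∃ i : Fin 4, ∀ x ∈ W, ∀ j : Fin 4, x (i, j) = 0) →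
      ¬ (∃ j : Fin 4, ∀ x ∈ W, ∀ i : Fin 4, x (i, j) = 0) →
      ¬ TwoZeroRows W → ¬ InCross W → PerDirFour W → False := by
  intro W hS h5 hrow hncol hn2 hnX hP
  obtain ⟨i, hi⟩ := hrow
  set σ : Equiv.Perm (Fin 4) := Equiv.swap 3 i with hσ
  have hσ3 : σ 3 = i := by rw [hσ, Equiv.swap_apply_left]
  set Φ : (Fin 4 × Fin 4 → K) ≃ₗ[K] (Fin 4 × Fin 4 → K) := rowPermL (K := K) σ with hΦ
  have hΦa : ∀ (x : Fin 4 × Fin 4 → K) (a b : Fin 4), Φ x (a, b) = x (σ a, b) := fun x a b => rfl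
  set W' : Submodule K (Fin 4 × Fin 4 → K) :=
    W.map (Φ : (Fin 4 × Fin 4 → K) →ₗ[K] (Fin 4 × Fin 4 → K)) with hW'
  have hmemΦ : ∀ x ∈ W, (Φ x : Fin 4 × Fin 4 → K) ∈ W' := fun x hx =>
    Submodule.mem_map_of_mem (f := (Φ : (Fin 4 × Fin 4 → K) →ₗ[K] (Fin 4 × Fin 4 → K))) hx
  have hS' : Sing3 W' := sing3_map_rowPermL hS σ
  have h5' : finrank K W' = 5 := by rw [hW', LinearEquiv.finrank_map_eq]; exact h5
  have hrow' : ∀ y ∈ W', ∀ j : Fin 4, y (3, j) = 0 := by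
    rintro _ ⟨x, hx, rfl⟩ j
    show Φ x (3, j) = 0
    rw [hΦa, hσ3]
    exact hi x hx j
  have hncol' : ¬ ∃ j : Fin 4, ∀ y ∈ W', ∀ a : Fin 4, y (a, j) = 0 := by
    rintro ⟨j, hj⟩
    apply hncol
    refine ⟨j, fun x hx a => ?_⟩
    have h := hj (Φ x) (hmemΦ x hx) (σ.symm a)
    rw [hΦa, Equiv.apply_symm_apply] at h
    exact h
  have hn2' : ¬ TwoZeroRows W' := by
    rintro ⟨p, q, hpq, h⟩
    apply hn2
    refine ⟨σ p, σ q, fun e => hpq (σ.injective e), fun x hx j => ?_⟩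
    have h' := h (Φ x) (hmemΦ x hx) j
    rw [hΦa, hΦa] at h'
    exact h'
  have hnX' : ¬ InCross W' := by
    rintro ⟨l, c, h⟩
    apply hnX
    refine ⟨σ l, c, fun x hx a b ha hb => ?_⟩
    have h' := h (Φ x) (hmemΦ x hx) (σ.symm a) b
      (fun e => ha (by rw [← e, Equiv.apply_symm_apply])) hb
    rw [hΦa, Equiv.apply_symm_apply] at h'
    exact h'
  have hP' : PerDirFour W' := by
    rintro _ ⟨x, hx, rfl⟩
    obtain ⟨c, Λ, h⟩ := hP x hx
    exact ⟨c, fun k => (Λ k).comp Φ.symm.toLinearMap,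
      SymPencilPerFourTwoRowCorankTwo.sum_sq_swap_map Φ
        (fun z => SymPencilPerFourBlocks.eval_perPoly_comp_prodCongr σ (Equiv.refl (Fin 4)) z)
        x c Λ h⟩
  by_cases h4 : ∃ r : Fin 4, W'.map (rowL (K := K) r) = ⊤
  · obtain ⟨r, hr⟩ := h4
    have hi4 : ∀ r : Fin 4, r = 0 ∨ r = 1 ∨ r = 2 ∨ r = 3 := by decide
    rcases hi4 r with rfl | rfl | rfl | rfl
    · exact nr4_false W' h5' hrow' hP' 0 1 2 (by decide) (by decide) (by decide) (by decide)
        (by decide) (by decide) hr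
    · exact nr4_false W' h5' hrow' hP' 1 0 2 (by decide) (by decide) (by decide) (by decide)
        (by decide) (by decide) hr
    · exact nr4_false W' h5' hrow' hP' 2 0 1 (by decide) (by decide) (by decide) (by decide)
        (by decide) (by decide) hr
    · have hmem : (Pi.single 0 (1 : K) : Fin 4 → K) ∈ W'.map (rowL (K := K) 3) := by
        rw [hr]; trivial
      obtain ⟨y, hy, hyv⟩ := Submodule.mem_map.mp hmem
      have h1 := congr_fun hyv 0
      simp only [rowL_apply, Pi.single_eq_same] at h1
      have h0 : row y 3 0 = 0 := hrow' y hy 0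
      rw [h0] at h1
      exact zero_ne_one h1
  · push Not at h4
    exact hres W' hS' h5' hrow' hncol' hn2' hnX' hP' h4

/-! ## 2i. Leaf R1N — the kernel plane (memo §6.4): tools -/

/-- The map `u ↦ P(a,b) u = (T3 u a b l)_l` (linear in `u`). -/
def Pmap (a b : Fin 4 → K) : (Fin 4 → K) →ₗ[K] (Fin 4 → K) where
  toFun u l := T3 u a b l
  map_add' u u' := by
    ext l
    exact T3_add₁ u u' a b l
  map_smul' c u := by
    ext l
    rw [Pi.smul_apply, T3_smul₁, smul_eq_mul, RingHom.id_apply]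

theorem Pmap_apply (a b u : Fin 4 → K) (l : Fin 4) : Pmap a b u l = T3 u a b l := rfl

/-- Two vectors of a line cannot have crossed zero patterns. [folklore] -/
theorem dep_absurd (R : Submodule K (Fin 4 → K)) (hR : finrank K R ≤ 1) {v₁ v₂ : Fin 4 → K}
    (h1 : v₁ ∈ R) (h2 : v₂ ∈ R) (k l : Fin 4) (h1l : v₁ l ≠ 0) (h1k : v₁ k = 0) (h2k : v₂ k ≠ 0) :
    False := by
  have hne : (⟨v₂, h2⟩ : R) ≠ 0 := by
    intro h
    apply h2k
    have := congr_arg (fun z : R => (z : Fin 4 → K) k) h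
    simpa using this
  have h1R : finrank K R = 1 := by
    have hpos : 0 < finrank K R := Module.finrank_pos_iff_exists_ne_zero.2 ⟨_, hne⟩
    omega
  obtain ⟨c, hc⟩ := (finrank_eq_one_iff_of_nonzero' (K := K) (V := R) ⟨v₂, h2⟩ hne).1 h1R ⟨v₁, h1⟩
  have hk := congr_arg (fun z : R => (z : Fin 4 → K) k) hc
  have hl := congr_arg (fun z : R => (z : Fin 4 → K) l) hc
  simp only [SetLike.mk_smul_mk, Pi.smul_apply, smul_eq_mul] at hk hl
  rw [h1k] at hk
  rcases mul_eq_zero.1 hk with h0 | h0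
  · rw [h0, zero_mul] at hl
    exact h1l hl.symm
  · exact h2k h0

/-- `T3 e_l a b k = T3 e_k a b l` (both are the `2 × 2` permanent of `(a;b)` on the complement of
`{k,l}`, for `k ≠ l`). [folklore] -/
theorem T3_single_symm (a b : Fin 4 → K) (k l : Fin 4) :
    T3 (Pi.single l 1) a b k = T3 (Pi.single k 1) a b l := by
  fin_cases k <;> fin_cases l <;> simp [T3, Fin.succAbove]

/-- complementary pair tables: for `p ≠ q`, `(ck p q, cl p q)` is the complement of `{p,q}`. -/
def ck (p q : Fin 4) : Fin 4 := ![![0, 2, 1, 1], ![2, 0, 0, 0], ![1, 0, 0, 0], ![1, 0, 0, 0]] p q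
/-- see `ck` -/
def cl (p q : Fin 4) : Fin 4 := ![![1, 3, 3, 2], ![3, 1, 3, 2], ![3, 3, 1, 1], ![2, 2, 1, 1]] p q

theorem ck_ne_cl : ∀ p q : Fin 4, p ≠ q → ck p q ≠ cl p q := by decide

theorem T3_single_compl (a b : Fin 4 → K) : ∀ p q : Fin 4, p ≠ q →
    T3 (Pi.single (ck p q) 1) a b (cl p q) = pairPerm a b p q := by
  intro p q hpq
  fin_cases p <;> fin_cases q <;> first
    | exact absurd rfl hpq
    | (simp [ck, cl, T3, Fin.succAbove, pairPerm]; try ring)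

/-- **(K1) Kernel perm-orthogonality**: if `T3 u a b ≡ 0` for all `u` in a subspace of dimension
`≥ 3`, then `a ⊥ b` (a zero-diagonal symmetric `4 × 4` matrix with a `3`-dimensional kernel
vanishes). [folklore] -/
theorem permOrth_of_ker3 (A : Submodule K (Fin 4 → K)) (hA : 3 ≤ finrank K A) (a b : Fin 4 → K)
    (h : ∀ u ∈ A, ∀ l, T3 u a b l = 0) : PermOrth a b := by
  set Pm := Pmap a b with hPm
  have hker : A ≤ LinearMap.ker Pm := by
    intro u hu
    rw [LinearMap.mem_ker]
    ext l
    rw [hPm, Pmap_apply, Pi.zero_apply]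
    exact h u hu l
  have hR : finrank K (LinearMap.range Pm) ≤ 1 := by
    have h1 := LinearMap.finrank_range_add_finrank_ker Pm
    rw [Module.finrank_fintype_fun_eq_card, Fintype.card_fin] at h1
    have h2 := Submodule.finrank_mono hker
    omega
  have key : ∀ k l : Fin 4, k ≠ l → Pm (Pi.single k 1) l ≠ 0 → False := by
    intro k l _ hv
    refine dep_absurd _ hR (LinearMap.mem_range_self Pm (Pi.single k 1))
      (LinearMap.mem_range_self Pm (Pi.single l 1)) k l hv ?_ ?_
    · rw [hPm, Pmap_apply]
      exact T3_single_self a b k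
    · rw [hPm, Pmap_apply, T3_single_symm]
      exact hv
  intro p q hpq
  by_contra hne
  refine key (ck p q) (cl p q) (ck_ne_cl p q hpq) ?_
  rw [hPm, Pmap_apply, T3_single_compl a b p q hpq]
  exact hne

/-! ## 2j. Leaf R1N — the kernel plane of a rank-`3` live row (memo §6.4) -/

/-- **(K2) Kernel-plane perm-orthogonality**: if the live row `r` has rank `≥ 3`, the two other
live rows of any `k ∈ K_r` are perm-orthogonal (`polar` + (K1)). [folklore] -/
theorem ker_permOrth [CharZero K] {W : Submodule K (Fin 4 × Fin 4 → K)} (hS : Sing3 W)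
    {r s t : Fin 4} (hrs : r ≠ s) (hrt : r ≠ t) (hst : s ≠ t)
    (h3 : 3 ≤ finrank K (W.map (rowL (K := K) r))) {k : Fin 4 × Fin 4 → K} (hk : k ∈ W)
    (hkr : row k r = 0) : PermOrth (row k s) (row k t) := by
  refine permOrth_of_ker3 (W.map (rowL (K := K) r)) h3 (row k s) (row k t) ?_
  rintro _ ⟨x, hx, rfl⟩ l
  exact polar hS hrs hrt hst hx hk hkr l

theorem finrank_sup_single (A : Submodule K (Fin 4 → K)) (m : Fin 4) (h : ∀ u ∈ A, u m = 0) :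
    finrank K ↥(A ⊔ K ∙ (Pi.single m (1 : K) : Fin 4 → K)) = finrank K A + 1 := by
  have hne : (Pi.single m (1 : K) : Fin 4 → K) ≠ 0 := by
    intro h0
    have := congr_fun h0 m
    simp at this
  have hinf : A ⊓ (K ∙ (Pi.single m (1 : K) : Fin 4 → K)) = ⊥ := by
    rw [Submodule.eq_bot_iff]
    intro u hu
    obtain ⟨huA, huS⟩ := Submodule.mem_inf.1 hu
    obtain ⟨a, rfl⟩ := Submodule.mem_span_singleton.1 huS
    have := h _ huA
    simp only [Pi.smul_apply, Pi.single_eq_same, smul_eq_mul, mul_one] at this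
    simp [this]
  have h1 := Submodule.finrank_sup_add_finrank_inf_eq A (K ∙ (Pi.single m (1 : K) : Fin 4 → K))
  rw [hinf, finrank_bot, finrank_span_singleton hne] at h1
  omega

/-- A subspace of `K⁴` killed by two distinct coordinates has dimension `≤ 2`. [folklore] -/
theorem finrank_le_two_of_vanish2 (A : Submodule K (Fin 4 → K)) (m₁ m₂ : Fin 4)
    (hne : m₁ ≠ m₂) (h₁ : ∀ u ∈ A, u m₁ = 0) (h₂ : ∀ u ∈ A, u m₂ = 0) :
    finrank K A ≤ 2 := by
  set B := A ⊔ K ∙ (Pi.single m₁ (1 : K) : Fin 4 → K) with hB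
  have hB1 : finrank K B = finrank K A + 1 := finrank_sup_single A m₁ h₁
  have hB2 : ∀ u ∈ B, u m₂ = 0 := by
    intro u hu
    obtain ⟨a, ha, z, hz, rfl⟩ := Submodule.mem_sup.1 hu
    obtain ⟨c, rfl⟩ := Submodule.mem_span_singleton.1 hz
    simp [h₂ a ha, hne.symm]
  have hC := finrank_sup_single B m₂ hB2
  have hle := Submodule.finrank_le (B ⊔ K ∙ (Pi.single m₂ (1 : K) : Fin 4 → K))
  rw [Module.finrank_fintype_fun_eq_card, Fintype.card_fin] at hle
  omega

/-- **GRAPH kernel plane is impossible** (memo §6.4): a graph plane has no pure elements, so (T1′)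
applies to both pairs `(r,s)`, `(r,t)`; equal common columns give a zero column, distinct ones force
`n_r ≤ 2`. [folklore] -/
theorem graph_false [CharZero K] (W : Submodule K (Fin 4 × Fin 4 → K)) (h5 : finrank K W = 5)
    (hrow : ∀ x ∈ W, ∀ j : Fin 4, x (3, j) = 0)
    (hncol : ¬ ∃ j : Fin 4, ∀ x ∈ W, ∀ i : Fin 4, x (i, j) = 0) (hP : PerDirFour W)
    (r s t : Fin 4) (hrs : r ≠ s) (hrt : r ≠ t) (hr3 : r ≠ 3) (hs3 : s ≠ 3)
    (ht3 : t ≠ 3) (hcov : ∀ i : Fin 4, i = r ∨ i = s ∨ i = t ∨ i = 3)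
    (hn3 : finrank K (W.map (rowL (K := K) r)) = 3)
    (j c : Fin 4) (e : K) (he : e ≠ 0)
    (hG : ∀ d, d ∈ kerPlane W r ↔ ((∀ i, i ≠ s → i ≠ t → row d i = 0) ∧
      (∀ i, i ≠ j → i ≠ c → d (s, i) = 0 ∧ d (t, i) = 0) ∧
      d (t, j) = e * d (s, j) ∧ d (t, c) = -(e * d (s, c)))) :
    False := by
  have zero_of : ∀ x ∈ W, (∀ m, x (r, m) = 0) → (∀ m, x (s, m) = 0) → (∀ m, x (t, m) = 0) →
      x = 0 := by
    intro x hx h1 h2 h3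
    ext ⟨i, m⟩
    rw [Pi.zero_apply]
    rcases hcov i with rfl | rfl | rfl | rfl
    · exact h1 m
    · exact h2 m
    · exact h3 m
    · exact hrow x hx m
  have nps : ∀ x ∈ W, (∀ m, x (r, m) = 0) → (∀ m, x (t, m) = 0) → x = 0 := by
    intro x hx h1 h3
    have hxD : x ∈ kerPlane W r := (mem_kerPlane W r x).2 ⟨hx, funext fun m => h1 m⟩
    obtain ⟨-, hoff, hj', hc'⟩ := (hG x).1 hxD
    refine zero_of x hx h1 ?_ h3
    intro m
    by_cases hmj : m = j
    · subst hmj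
      rw [h3] at hj'
      exact (mul_eq_zero.1 hj'.symm).resolve_left he
    by_cases hmc : m = c
    · subst hmc
      rw [h3] at hc'
      exact (mul_eq_zero.1 (neg_eq_zero.1 hc'.symm)).resolve_left he
    · exact (hoff m hmj hmc).1
  have npt : ∀ x ∈ W, (∀ m, x (r, m) = 0) → (∀ m, x (s, m) = 0) → x = 0 := by
    intro x hx h1 h2
    have hxD : x ∈ kerPlane W r := (mem_kerPlane W r x).2 ⟨hx, funext fun m => h1 m⟩
    obtain ⟨-, hoff, hj', hc'⟩ := (hG x).1 hxD
    refine zero_of x hx h1 h2 ?_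
    intro m
    by_cases hmj : m = j
    · subst hmj
      rw [h2, mul_zero] at hj'
      exact hj'
    by_cases hmc : m = c
    · subst hmc
      rw [h2, mul_zero, neg_zero] at hc'
      exact hc'
    · exact (hoff m hmj hmc).2
  obtain ⟨m₁, hm₁⟩ := common_col_gen W h5 hrow hP r s hrs hr3 hs3
    (fun x hx h1 h2 => npt x hx h1 h2)
  obtain ⟨m₂, hm₂⟩ := common_col_gen W h5 hrow hP r t hrt hr3 ht3
    (fun x hx h1 h3 => nps x hx h1 h3)
  by_cases hm : m₁ = m₂
  · subst hm
    refine hncol ⟨m₁, fun x hx i => ?_⟩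
    rcases hcov i with rfl | rfl | rfl | rfl
    · exact (hm₁ x hx).1
    · exact (hm₁ x hx).2
    · exact (hm₂ x hx).2
    · exact hrow x hx m₁
  · have hle := finrank_le_two_of_vanish2 (W.map (rowL (K := K) r)) m₁ m₂ hm
      (by
        rintro _ ⟨y, hy, rfl⟩
        exact (hm₁ y hy).1)
      (by
        rintro _ ⟨y, hy, rfl⟩
        exact (hm₂ y hy).1)
    omega

/-- Residual branch **TORIC** (memo §6.6): in the R1N normal form, every live row has rank `≤ 2`. -/
def R1NToric (K : Type*) [Field K] : Prop :=
  ∀ W : Submodule K (Fin 4 × Fin 4 → K), Sing3 W → finrank K W = 5 →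
    (∀ x ∈ W, ∀ j : Fin 4, x (3, j) = 0) →
    ¬ (∃ j : Fin 4, ∀ x ∈ W, ∀ i : Fin 4, x (i, j) = 0) →
    ¬ TwoZeroRows W → ¬ InCross W → PerDirFour W →
    (∀ r : Fin 4, finrank K (W.map (rowL (K := K) r)) ≤ 2) → False

/-- Residual branch **PRODUCT** (memo §6.5): some live row `r` has rank `3` and its kernel plane
`K_r = {d ∈ W : row r = 0}` is a PRODUCT plane `K(0;ℓ;0) ⊕ K(0;0;ℓ^σ)` … (memo). -/
def R1NProduct (K : Type*) [Field K] : Prop :=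
  ∀ W : Submodule K (Fin 4 × Fin 4 → K), Sing3 W → finrank K W = 5 →
    (∀ x ∈ W, ∀ j : Fin 4, x (3, j) = 0) →
    ¬ (∃ j : Fin 4, ∀ x ∈ W, ∀ i : Fin 4, x (i, j) = 0) →
    ¬ TwoZeroRows W → ¬ InCross W → PerDirFour W →
    ∀ r s t : Fin 4, r ≠ s → r ≠ t → s ≠ t → r ≠ 3 → s ≠ 3 → t ≠ 3 →
    finrank K (W.map (rowL (K := K) r)) = 3 →
    (∃ (j c : Fin 4) (α β : K), j ≠ c ∧ (α ≠ 0 ∨ β ≠ 0) ∧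
      ∀ d, (d ∈ W ∧ row d r = 0) ↔ ((∀ i, i ≠ s → i ≠ t → row d i = 0) ∧
        (∃ μ : K, row d s = μ • lvec j c α β) ∧ (∃ ν : K, row d t = ν • lvec j c α (-β)))) →
    False

/-- Residual branch **PURE** (memo §6.4, to be discharged below): some live row `r` has rank `3`
and its kernel plane is pure (row `s ≡ 0` on it). -/
def R1NPure (K : Type*) [Field K] : Prop :=
  ∀ W : Submodule K (Fin 4 × Fin 4 → K), Sing3 W → finrank K W = 5 →
    (∀ x ∈ W, ∀ j : Fin 4, x (3, j) = 0) →
    ¬ (∃ j : Fin 4, ∀ x ∈ W, ∀ i : Fin 4, x (i, j) = 0) →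
    ¬ TwoZeroRows W → ¬ InCross W → PerDirFour W →
    ∀ r s t : Fin 4, r ≠ s → r ≠ t → s ≠ t → r ≠ 3 → s ≠ 3 → t ≠ 3 →
    finrank K (W.map (rowL (K := K) r)) = 3 →
    (∀ d ∈ W, row d r = 0 → row d s = 0) → False

/-- **Kernel-plane dispatch** (memo §6.4): the rev-9 residual follows from the three branches
TORIC, PRODUCT, PURE — the GRAPH branch is ✗ `graph_false`, the perm-orthogonality … (memo). [folklore] -/
theorem residual_of_branches [CharZero K] (hT : R1NToric K) (hPr : R1NProduct K)
    (hPu : R1NPure K) :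
    ∀ W : Submodule K (Fin 4 × Fin 4 → K), Sing3 W → finrank K W = 5 →
      (∀ x ∈ W, ∀ j : Fin 4, x (3, j) = 0) →
      ¬ (∃ j : Fin 4, ∀ x ∈ W, ∀ i : Fin 4, x (i, j) = 0) →
      ¬ TwoZeroRows W → ¬ InCross W → PerDirFour W →
      (∀ r : Fin 4, W.map (rowL (K := K) r) ≠ ⊤) → False := by
  intro W hS h5 hrow hncol hn2 hnX hP hnt
  have hle3 : ∀ r, finrank K (W.map (rowL (K := K) r)) ≤ 3 := by
    intro r
    have hlt := Submodule.finrank_lt_finrank_of_lt (lt_top_iff_ne_top.2 (hnt r))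
    rw [finrank_top, Module.finrank_fintype_fun_eq_card, Fintype.card_fin] at hlt
    omega
  by_cases h2 : ∀ r, finrank K (W.map (rowL (K := K) r)) ≤ 2
  · exact hT W hS h5 hrow hncol hn2 hnX hP h2
  push Not at h2
  obtain ⟨r, hr⟩ := h2
  have hn3 : finrank K (W.map (rowL (K := K) r)) = 3 := by
    have := hle3 r
    omega
  have hr3 : r ≠ 3 := by
    rintro rfl
    have hbot : W.map (rowL (K := K) 3) = ⊥ := by
      rw [Submodule.eq_bot_iff]
      rintro _ ⟨x, hx, rfl⟩
      ext m
      exact hrow x hx m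
    rw [hbot, finrank_bot] at hn3
    omega
  have aux : ∀ r' : Fin 4, r' ≠ 3 → ∃ s t : Fin 4, r' ≠ s ∧ r' ≠ t ∧ s ≠ t ∧ s ≠ 3 ∧ t ≠ 3 ∧
      ∀ i : Fin 4, i = r' ∨ i = s ∨ i = t ∨ i = 3 := by decide
  obtain ⟨s, t, hrs, hrt, hst, hs3, ht3, hcov⟩ := aux r hr3
  have hDfin : finrank K (kerPlane W r) = 2 := by
    have h := finrank_kerPlane W r
    rw [hn3] at h
    have h5W : finrank K W = 5 := h5
    omega
  have hsupp : ∀ d ∈ kerPlane W r, ∀ i, i ≠ s → i ≠ t → row d i = 0 := by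
    intro d hd i his hit
    obtain ⟨hdW, hdr⟩ := (mem_kerPlane W r d).1 hd
    rcases hcov i with rfl | rfl | rfl | rfl
    · exact hdr
    · exact absurd rfl his
    · exact absurd rfl hit
    · ext m
      exact hrow d hdW m
  have hperp : ∀ d ∈ kerPlane W r, PermOrth (row d s) (row d t) := by
    intro d hd
    obtain ⟨hdW, hdr⟩ := (mem_kerPlane W r d).1 hd
    exact ker_permOrth hS hrs hrt hst (by omega) hdW hdr
  rcases perpPlanes permOrthPairs (kerPlane W r) s t hst hsupp (by omega) hperp with
    hps | hpt | ⟨-, hprod | hgraph⟩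
  · exact hPu W hS h5 hrow hncol hn2 hnX hP r s t hrs hrt hst hr3 hs3 ht3 hn3
      (fun d hdW hdr => hps d ((mem_kerPlane W r d).2 ⟨hdW, hdr⟩))
  · exact hPu W hS h5 hrow hncol hn2 hnX hP r t s hrt hrs (Ne.symm hst) hr3 ht3 hs3 hn3
      (fun d hdW hdr => hpt d ((mem_kerPlane W r d).2 ⟨hdW, hdr⟩))
  · obtain ⟨j, c, α, β, hjc, hαβ, hiff⟩ := hprod
    refine hPr W hS h5 hrow hncol hn2 hnX hP r s t hrs hrt hst hr3 hs3 ht3 hn3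
      ⟨j, c, α, β, hjc, hαβ, fun d => ?_⟩
    rw [← mem_kerPlane W r d]
    exact hiff d
  · obtain ⟨j, c, e, hjc, he, hiff⟩ := hgraph
    exact graph_false W h5 hrow hncol hP r s t hrs hrt hr3 hs3 ht3 hcov hn3 j c e he hiff

/-! ## 2k. Leaf R1N — the PURE kernel plane is impossible (memo §6.4) -/

theorem T3_zero₂ (u w : Fin 4 → K) (l : Fin 4) : T3 u 0 w l = 0 := by
  simp [T3]

theorem T3_add₂ (u v v' w : Fin 4 → K) (l : Fin 4) :
    T3 u (v + v') w l = T3 u v w l + T3 u v' w l := by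
  simp only [T3, Pi.add_apply]; ring

/-- `T3 u v b l = v_m · (P(u,b))_{l m}` when `u_m = b_m = 0` and `l ≠ m`. [folklore] -/
theorem T3_factor (u v b : Fin 4 → K) (m l : Fin 4) (hum : u m = 0) (hbm : b m = 0)
    (hl : l ≠ m) : T3 u v b l = v m * T3 (Pi.single m 1) u b l := by
  have hi4 : ∀ i : Fin 4, i = 0 ∨ i = 1 ∨ i = 2 ∨ i = 3 := by decide
  rcases hi4 m with rfl | rfl | rfl | rfl <;> rcases hi4 l with rfl | rfl | rfl | rfl <;>
    first
    | exact absurd rfl hl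
    | (simp [T3, Fin.succAbove, hum, hbm]; ring)

theorem ck_ne_self : ∀ m c : Fin 4, m ≠ c → ck m c ≠ m := by decide
theorem cl_ne_self : ∀ m c : Fin 4, m ≠ c → cl m c ≠ m := by decide

/-- `T3 e_m e_κ b l = b_c` for `{m, κ, l, c}` a permutation (`κ = ck m c`, `l = cl m c`). -/
theorem T3_single_single (b : Fin 4 → K) : ∀ m c : Fin 4, m ≠ c →
    T3 (Pi.single m 1) (Pi.single (ck m c) 1) b (cl m c) = b c := by
  intro m c hmc
  fin_cases m <;> fin_cases c <;> first
    | exact absurd rfl hmc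
    | simp [ck, cl, T3, Fin.succAbove]

/-- **PURE kernel plane is impossible** (memo §6.4): if the live row `r` has rank `3` and its
kernel plane `K_r` is pure-`t` (row `s ≡ 0` on it), then (T1′) on `(r,t)` gives a … (memo). [folklore] -/
theorem pure_false [CharZero K] : R1NPure K := by
  intro W hS h5 hrow hncol _hn2 _hnX hP r s t hrs hrt hst hr3 hs3 ht3 hn3 hpure
  have aux : ∀ r s t : Fin 4, r ≠ s → r ≠ t → s ≠ t → r ≠ 3 → s ≠ 3 → t ≠ 3 →
      ∀ i : Fin 4, i = r ∨ i = s ∨ i = t ∨ i = 3 := by decide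
  have hcov := aux r s t hrs hrt hst hr3 hs3 ht3
  have zero_of : ∀ x ∈ W, (∀ m, x (r, m) = 0) → (∀ m, x (s, m) = 0) → (∀ m, x (t, m) = 0) →
      x = 0 := by
    intro x hx h1 h2 h3
    ext ⟨i, m⟩
    rw [Pi.zero_apply]
    rcases hcov i with rfl | rfl | rfl | rfl
    · exact h1 m
    · exact h2 m
    · exact h3 m
    · exact hrow x hx m
  have nps : ∀ x ∈ W, (∀ m, x (r, m) = 0) → (∀ m, x (t, m) = 0) → x = 0 := by
    intro x hx h1 h3
    have h2 := hpure x hx (funext fun m => h1 m)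
    exact zero_of x hx h1 (fun m => congr_fun h2 m) h3
  obtain ⟨m, hm⟩ := common_col_gen W h5 hrow hP r t hrt hr3 ht3 nps
  obtain ⟨y₀, hy₀, hy₀m⟩ : ∃ y₀ ∈ W, y₀ (s, m) ≠ 0 := by
    by_contra hcon
    push Not at hcon
    refine hncol ⟨m, fun x hx i => ?_⟩
    rcases hcov i with rfl | rfl | rfl | rfl
    · exact (hm x hx).1
    · exact hcon x hx
    · exact (hm x hx).2
    · exact hrow x hx m
  have step : ∀ y ∈ W, ∀ k ∈ W, row k r = 0 → ∀ l, l ≠ m →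
      y (s, m) * T3 (Pi.single m 1) (row y r) (row k t) l = 0 := by
    intro y hy k hk hkr l hl
    have hp := polar₁ hS hrs hrt hst hy hk hkr l
    rw [hpure k hk hkr, T3_zero₂, add_zero,
      T3_factor (row y r) (row y s) (row k t) m l (hm y hy).1 (hm k hk).2 hl] at hp
    exact hp
  have all : ∀ y ∈ W, ∀ k ∈ W, row k r = 0 → ∀ l, l ≠ m →
      T3 (Pi.single m 1) (row y r) (row k t) l = 0 := by
    intro y hy k hk hkr l hl
    by_cases hym : y (s, m) = 0
    · have h0 : T3 (Pi.single m 1) (row y₀ r) (row k t) l = 0 :=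
        (mul_eq_zero.1 (step y₀ hy₀ k hk hkr l hl)).resolve_left hy₀m
      have h01 := step (y₀ + y) (W.add_mem hy₀ hy) k hk hkr l hl
      have hne : (y₀ + y) (s, m) ≠ 0 := by
        rw [Pi.add_apply, hym, add_zero]
        exact hy₀m
      have h01' := (mul_eq_zero.1 h01).resolve_left hne
      rw [row_add, T3_add₂, h0, zero_add] at h01'
      exact h01'
    · exact (mul_eq_zero.1 (step y hy k hk hkr l hl)).resolve_left hym
  have hAm : ∀ u ∈ W.map (rowL (K := K) r), u m = 0 := by
    rintro _ ⟨y, hy, rfl⟩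
    exact (hm y hy).1
  have hsup : W.map (rowL (K := K) r) ⊔ K ∙ (Pi.single m (1 : K) : Fin 4 → K) = ⊤ := by
    apply Submodule.eq_top_of_finrank_eq
    have h1 := finrank_sup_single (W.map (rowL (K := K) r)) m hAm
    have h2 : finrank K (Fin 4 → K) = 4 := by
      rw [Module.finrank_fintype_fun_eq_card, Fintype.card_fin]
    omega
  have unit_mem : ∀ κ : Fin 4, κ ≠ m → ∃ y ∈ W, row y r = Pi.single κ 1 := by
    intro κ hκ
    have hmem : (Pi.single κ (1 : K) : Fin 4 → K) ∈
        W.map (rowL (K := K) r) ⊔ K ∙ (Pi.single m (1 : K) : Fin 4 → K) := by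
      rw [hsup]
      exact Submodule.mem_top
    obtain ⟨a, ha, z, hz, haz⟩ := Submodule.mem_sup.1 hmem
    obtain ⟨c, rfl⟩ := Submodule.mem_span_singleton.1 hz
    have hc : c = 0 := by
      have := congr_fun haz m
      simpa [hAm a ha, Pi.single_apply, Ne.symm hκ] using this
    rw [hc, zero_smul, add_zero] at haz
    obtain ⟨y, hy, rfl⟩ := ha
    exact ⟨y, hy, haz⟩
  have kzero : ∀ k ∈ W, row k r = 0 → k = 0 := by
    intro k hk hkr
    have hks := hpure k hk hkr
    refine zero_of k hk (fun m' => congr_fun hkr m') (fun m' => congr_fun hks m') ?_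
    intro c
    by_cases hcm : c = m
    · rw [hcm]
      exact (hm k hk).2
    · obtain ⟨y, hy, hyr⟩ := unit_mem (ck m c) (ck_ne_self m c (Ne.symm hcm))
      have h := all y hy k hk hkr (cl m c) (cl_ne_self m c (Ne.symm hcm))
      rw [hyr, T3_single_single (row k t) m c (Ne.symm hcm)] at h
      exact h
  have hD : kerPlane W r = ⊥ := by
    rw [Submodule.eq_bot_iff]
    intro k hk
    obtain ⟨hkW, hkr⟩ := (mem_kerPlane W r k).1 hk
    exact kzero k hkW hkr
  have h := finrank_kerPlane W r
  rw [hD, finrank_bot, hn3] at h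
  have h5W : finrank K W = 5 := h5
  omega

/-- **Kernel-plane dispatch, PURE discharged**: the rev-9 residual follows from TORIC and PRODUCT. -/
theorem residual_of_toric_product [CharZero K] (hT : R1NToric K) (hPr : R1NProduct K) :
    ∀ W : Submodule K (Fin 4 × Fin 4 → K), Sing3 W → finrank K W = 5 →
      (∀ x ∈ W, ∀ j : Fin 4, x (3, j) = 0) →
      ¬ (∃ j : Fin 4, ∀ x ∈ W, ∀ i : Fin 4, x (i, j) = 0) →
      ¬ TwoZeroRows W → ¬ InCross W → PerDirFour W →
      (∀ r : Fin 4, W.map (rowL (K := K) r) ≠ ⊤) → False :=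
  residual_of_branches hT hPr pure_false

/-- **Leaf R1N — THE NARROWED RESIDUAL, rev 10** (the only `sorry` of this file): the conjunction of
the two remaining kernel-plane branches `R1NToric K` (memo §6.6: every live row of rank `≤ 2`; paper
proof: trilinear extension + ✓ `toricTriple`, the `(2,2,1)`-products by `|supp c₀|`, witness `W₀` with
`rank M_y = 3`) and `R1NProduct K` (memo §6.5: a rank-`3` live row whose kernel plane is a PRODUCT
plane; paper proof: `PermOrthPairs` in `K³`, the family `W(λ)` with `rank M_y = 3`, or a zero column).
The branches `n_r = 4`, GRAPH and PURE and the whole dispatch (`residual_of_toric_product`, §2h–2k)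
are PROVED; the rev-9 residual is the DERIVED theorem `stub_threeRowsFourCols_residual` below.  PAPER-PROVED
(memo §6.5–6.6; cross-checks `compute/toric221_census.py`, `compute/sanity_r1n.py`); porting debt owned
by val-lit-p8 after this seat's HANDOFF (R253). -/
theorem stub_R1N_residual [CharZero K] : R1NToric K ∧ R1NProduct K := by
  sorry

/-- The rev-9 residual «normal form, every live row of rank ≤ 3 ⇒ False» — DERIVED (rev 10) from
`stub_R1N_residual` by the kernel-plane dispatch `residual_of_toric_product` … (memo). [folklore] -/
theorem stub_threeRowsFourCols_residual [CharZero K] :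
    ∀ W : Submodule K (Fin 4 × Fin 4 → K), Sing3 W → finrank K W = 5 →
      (∀ x ∈ W, ∀ j : Fin 4, x (3, j) = 0) →
      ¬ (∃ j : Fin 4, ∀ x ∈ W, ∀ i : Fin 4, x (i, j) = 0) →
      ¬ TwoZeroRows W → ¬ InCross W → PerDirFour W →
      (∀ r : Fin 4, W.map (rowL (K := K) r) ≠ ⊤) → False :=
  residual_of_toric_product stub_R1N_residual.1 stub_R1N_residual.2

/-- **Leaf R1N** `stub_threeRowsFourCols` — now DERIVED from the narrowed residual
`stub_threeRowsFourCols_residual` by `threeRowsFourCols_of_residual` (§2h: normalisation to zero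
row `3` and the full-row-rank branch (B3) are PROVED). [folklore] -/
theorem stub_threeRowsFourCols [CharZero K] :
    ∀ W : Submodule K (Fin 4 × Fin 4 → K), Sing3 W → finrank K W = 5 →
      (∃ i : Fin 4, ∀ x ∈ W, ∀ j : Fin 4, x (i, j) = 0) →
      ¬ (∃ j : Fin 4, ∀ x ∈ W, ∀ i : Fin 4, x (i, j) = 0) →
      ¬ TwoZeroRows W → ¬ InCross W → PerDirFour W → False :=
  threeRowsFourCols_of_residual stub_threeRowsFourCols_residual

/-! ## 3. Brick dispatch -/

/-- Two-point transitivity of `S₄` used to normalise a cross. [folklore] -/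
theorem exists_perm_zero_three : ∀ l b : Fin 4, b ≠ l →
    ∃ σ : Equiv.Perm (Fin 4), σ 0 = l ∧ σ 3 = b := by
  decide

/-- The coordinate description of the inverse of a `prodCongr` relabelling. [folklore] -/
theorem funCongrLeft_prodCongr_symm_apply (σ τ : Equiv.Perm (Fin 4)) (y : Fin 4 × Fin 4 → K)
    (i j : Fin 4) :
    (LinearEquiv.funCongrLeft K K (Equiv.prodCongr σ τ)).symm y (i, j) = y (σ.symm i, τ.symm j) := by
  rfl

/-- **`V₅×`-type carries no joint family of four squares**: transport to `l = c = 0`, removed cells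
`(0,3)`, `(3,0)`, where `E₁₀ + E₀₂` and `E₂₀ + E₀₁` lie in the space, and ✓ … (memo). [folklore] -/
theorem noJoint_of_vFiveCrossType [CharZero K] {W : Submodule K (Fin 4 × Fin 4 → K)}
    (h : VFiveCrossType W) : ¬ HasJointFour W := by
  classical
  rintro ⟨cc, β, hJ⟩
  obtain ⟨l, c, a, b, hac, hbl, hiff⟩ := h
  obtain ⟨σ, hσ0, hσ3⟩ := exists_perm_zero_three l b hbl
  obtain ⟨τ, hτ0, hτ3⟩ := exists_perm_zero_three c a hac
  let Φ : (Fin 4 × Fin 4 → K) ≃ₗ[K] (Fin 4 × Fin 4 → K) :=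
    LinearEquiv.funCongrLeft K K (Equiv.prodCongr σ τ)
  have hΦ : ∀ z, eval (Φ z) (perPoly (Fin 4) K) = 1 * eval z (perPoly (Fin 4) K) := fun z => by
    rw [one_mul]; exact SymPencilPerFourBlocks.eval_perPoly_comp_prodCongr σ τ z
  have hσl : σ.symm l = 0 := by rw [← hσ0, Equiv.symm_apply_apply]
  have hσb : σ.symm b = 3 := by rw [← hσ3, Equiv.symm_apply_apply]
  have hτc : τ.symm c = 0 := by rw [← hτ0, Equiv.symm_apply_apply]
  have hτa : τ.symm a = 3 := by rw [← hτ3, Equiv.symm_apply_apply]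
  have hmem : ∀ (y : Fin 4 × Fin 4 → K),
      (∀ i j : Fin 4, i ≠ 0 → j ≠ 0 → y (i, j) = 0) → y (0, 3) = 0 → y (3, 0) = 0 →
      y ∈ W.map Φ.toLinearMap := by
    intro y hy h03 h30
    rw [show Φ.toLinearMap = (Φ : (Fin 4 × Fin 4 → K) →ₗ[K] (Fin 4 × Fin 4 → K)) from rfl,
      Submodule.mem_map_equiv, hiff]
    refine ⟨fun i j hi hj => ?_, ?_, ?_⟩
    · rw [funCongrLeft_prodCongr_symm_apply]
      apply hy
      · intro h0; apply hi
        have := congrArg σ h0; rwa [Equiv.apply_symm_apply, hσ0] at this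
      · intro h0; apply hj
        have := congrArg τ h0; rwa [Equiv.apply_symm_apply, hτ0] at this
    · rw [funCongrLeft_prodCongr_symm_apply, hσl, hτa]; exact h03
    · rw [funCongrLeft_prodCongr_symm_apply, hσb, hτc]; exact h30
  have h₀ : (fun p : Fin 4 × Fin 4 => if p = (1, 0) then (1 : K) else if p = (0, 2) then 1 else 0) ∈
      W.map Φ.toLinearMap := by
    apply hmem
    · intro i j hi hj
      have h1 : ((i, j) : Fin 4 × Fin 4) ≠ (1, 0) := fun h => hj (Prod.mk.inj h).2
      have h2 : ((i, j) : Fin 4 × Fin 4) ≠ (0, 2) := fun h => hi (Prod.mk.inj h).1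
      simp [h1, h2]
    · simp
    · simp
  have h₁ : (fun p : Fin 4 × Fin 4 => if p = (2, 0) then (1 : K) else if p = (0, 1) then 1 else 0) ∈
      W.map Φ.toLinearMap := by
    apply hmem
    · intro i j hi hj
      have h1 : ((i, j) : Fin 4 × Fin 4) ≠ (2, 0) := fun h => hj (Prod.mk.inj h).2
      have h2 : ((i, j) : Fin 4 × Fin 4) ≠ (0, 1) := fun h => hi (Prod.mk.inj h).1
      simp [h1, h2]
    · simp
    · simp
  exact not_jointFamily_of_map W Φ 1 hΦ
    (fun c' β' => SymPencilPerFourCrossPairNoJoint.not_jointFamily_four_of_cross_pair _ h₀ h₁ c' β')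
    cc β hJ

set_option linter.unusedSimpArgs false in
/-- **Torus + brick step.**  A space that contains every matrix supported on rows `0,1` and
columns `0,1,2` whose row `1` is annihilated by the weight vector `θ`, with support … (memo). [folklore] -/
theorem noJoint_of_rowNormal [CharZero K] (V : Submodule K (Fin 4 × Fin 4 → K)) (θ : Fin 4 → K)
    (hV : ∀ y : Fin 4 × Fin 4 → K, (∀ j, y (2, j) = 0) → (∀ j, y (3, j) = 0) → y (0, 3) = 0 →
      y (1, 3) = 0 → ∑ j, θ j * y (1, j) = 0 → y ∈ V)
    (hS : (θ 0 = 0 ∧ θ 1 = 0 ∧ θ 2 ≠ 0) ∨ (θ 0 ≠ 0 ∧ θ 1 ≠ 0 ∧ θ 2 = 0) ∨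
      (θ 0 ≠ 0 ∧ θ 1 ≠ 0 ∧ θ 2 ≠ 0))
    (c : Fin 4 → K) (β : Fin 4 → ((Fin 4 × Fin 4 → K) →ₗ[K] (Fin 4 × Fin 4 → K) →ₗ[K] K)) :
    ¬ (∀ u : Fin 4 × Fin 4 → K, ∀ y ∈ V, ∃ e₀ e₁ : K, ∀ s : K,
        eval (u + s • y) (perPoly (Fin 4) K) = e₀ + s * e₁ + s ^ 2 * ∑ k, c k * (β k u y) ^ 2) := by
  classical
  intro hJ
  set c' : Fin 4 → K := fun j => if θ j = 0 then 1 else θ j with hc'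
  have hc'ne : ∀ j, c' j ≠ 0 := fun j => by
    by_cases h : θ j = 0 <;> simp [hc', h]
  have hquot : ∀ j, θ j * (c' j)⁻¹ = if θ j = 0 then 0 else 1 := fun j => by
    by_cases h : θ j = 0 <;> simp [hc', h]
  obtain ⟨c'', β'', h''⟩ := jointFamily_map_torus V (fun _ => (1 : K)) c'
    (fun _ => one_ne_zero) hc'ne c β hJ
  let D : (Fin 4 × Fin 4 → K) →ₗ[K] (Fin 4 × Fin 4 → K) :=
    { toFun := fun y p => ((fun _ : Fin 4 => (1 : K)) p.1)⁻¹ * (c' p.2)⁻¹ * y p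
      map_add' := fun y z => by
        ext p; simp only [Pi.add_apply]; ring
      map_smul' := fun a y => by
        ext p; simp only [Pi.smul_apply, smul_eq_mul, RingHom.id_apply]; ring }
  have hDp : ∀ y p, D y p = (c' p.2)⁻¹ * y p := fun y p => by
    show ((fun _ : Fin 4 => (1 : K)) p.1)⁻¹ * (c' p.2)⁻¹ * y p = _
    simp
  let V' : Submodule K (Fin 4 × Fin 4 → K) := V.comap D
  have hfam : ∀ u : Fin 4 × Fin 4 → K, ∀ y ∈ V', ∃ e₀ e₁ : K, ∀ s : K,
      eval (u + s • y) (perPoly (Fin 4) K) = e₀ + s * e₁ + s ^ 2 * ∑ k, c'' k * (β'' k u y) ^ 2 :=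
    fun u y hy => h'' u y (Submodule.mem_comap.mp hy)
  have hmem : ∀ y : Fin 4 × Fin 4 → K, (∀ j, y (2, j) = 0) → (∀ j, y (3, j) = 0) → y (0, 3) = 0 →
      y (1, 3) = 0 → ∑ j, (if θ j = 0 then (0 : K) else 1) * y (1, j) = 0 → y ∈ V' := by
    intro y h2 h3 h03 h13 hs
    refine Submodule.mem_comap.mpr (hV _ (fun j => ?_) (fun j => ?_) ?_ ?_ ?_)
    · rw [hDp, h2, mul_zero]
    · rw [hDp, h3, mul_zero]
    · rw [hDp, h03, mul_zero]
    · rw [hDp, h13, mul_zero]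
    · have : ∑ j, θ j * D y (1, j) = ∑ j, (if θ j = 0 then (0 : K) else 1) * y (1, j) :=
        Finset.sum_congr rfl fun j _ => by rw [hDp, ← mul_assoc, hquot]
      rw [this]; exact hs
  rcases hS with ⟨h0, h1, h2⟩ | ⟨h0, h1, h2⟩ | ⟨h0, h1, h2⟩
  · -- `L = {v₂ = 0} ⊇ K^{01}`: ✓ p605861
    refine SymPencilPerFourRowPairNoJoint.not_jointFamily_four_of_row_pair V' ?_ ?_ c'' β'' hfam
    · apply hmem <;> simp [h0, h1, Fin.sum_univ_four]
    · apply hmem <;> simp [h0, h1, Fin.sum_univ_four]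
  · -- `L = {v₀ + v₁ = 0} = span{e₀−e₁, e₂}`: ✓ p606014
    refine SymPencilPerFourRowPairSkewNoJoint.not_jointFamily_four_of_row_pair_skew V' ?_ ?_
      c'' β'' hfam
    · apply hmem <;> simp [h0, h1, h2, Fin.sum_univ_four]
    · apply hmem <;> simp [h0, h1, h2, Fin.sum_univ_four]
  · -- `L = (1,1,1)^⊥`: ✓ p606066
    refine SymPencilPerFourRowPairSumNoJoint.not_jointFamily_four_of_row_pair_sum V' ?_ ?_
      c'' β'' hfam
    · apply hmem <;> simp [h0, h1, h2, Fin.sum_univ_four]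
    · apply hmem <;> simp [h0, h1, h2, Fin.sum_univ_four]

/-- **One normalisation step**: rows relabelled by `σ`, columns by `π.trans τ` (`π 3 = 3`), via
`jointFamily_map_prodCongr`; then `noJoint_of_rowNormal` with the weight vector `θ ∘ π`.
[folklore] -/
theorem torusDispatch_perm [CharZero K] {W : Submodule K (Fin 4 × Fin 4 → K)}
    {σ τ : Equiv.Perm (Fin 4)} {θ : Fin 4 → K}
    (hiff : ∀ x : Fin 4 × Fin 4 → K, x ∈ W ↔
      ((∀ j, x (σ 2, j) = 0) ∧ (∀ j, x (σ 3, j) = 0) ∧ x (σ 0, τ 3) = 0 ∧ x (σ 1, τ 3) = 0 ∧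
        ∑ j, θ j * x (σ 1, τ j) = 0))
    (π : Equiv.Perm (Fin 4)) (hπ : π 3 = 3)
    (hS : (θ (π 0) = 0 ∧ θ (π 1) = 0 ∧ θ (π 2) ≠ 0) ∨ (θ (π 0) ≠ 0 ∧ θ (π 1) ≠ 0 ∧ θ (π 2) = 0) ∨
      (θ (π 0) ≠ 0 ∧ θ (π 1) ≠ 0 ∧ θ (π 2) ≠ 0)) :
    ¬ HasJointFour W := by
  classical
  rintro ⟨cc, β, hJ⟩
  obtain ⟨c', β', h'⟩ := jointFamily_map_prodCongr W σ (π.trans τ) cc β hJ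
  refine noJoint_of_rowNormal _ (fun j => θ (π j)) (fun y h2 h3 h03 h13 hs => ?_) hS c' β' h'
  rw [show (LinearEquiv.funCongrLeft K K (Equiv.prodCongr σ (π.trans τ))).toLinearMap =
      ((LinearEquiv.funCongrLeft K K (Equiv.prodCongr σ (π.trans τ)) :
        (Fin 4 × Fin 4 → K) →ₗ[K] (Fin 4 × Fin 4 → K))) from rfl,
    Submodule.mem_map_equiv, hiff]
  have hπ3 : π.symm 3 = 3 := π.symm_apply_eq.mpr hπ.symm
  simp only [funCongrLeft_prodCongr_symm_apply, Equiv.symm_apply_apply, Equiv.symm_trans_apply,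
    hπ3]
  refine ⟨fun j => h2 _, fun j => h3 _, h03, h13, ?_⟩
  have : ∑ j, θ (π j) * y (1, j) = ∑ j, θ j * y (1, π.symm j) :=
    Fintype.sum_equiv π _ _ fun j => by simp only [Equiv.symm_apply_apply]
  rw [← this]; exact hs

/-- **Torus product types carry no joint family of four squares** — PLUMBING, PROVED (rev 2):
normalise by `prodCongr σ (π.trans τ)` with `π ∈ {1, (0 2), (1 2)}` chosen from the … (memo). [folklore] -/
theorem stub_torusDispatch [CharZero K] :
    ∀ W : Submodule K (Fin 4 × Fin 4 → K), VTorusType W → ¬ HasJointFour W := by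
  classical
  rintro W ⟨σ, τ, θ, hθ3, hθ, hiff⟩
  have s020 : Equiv.swap (0 : Fin 4) 2 0 = 2 := by decide
  have s021 : Equiv.swap (0 : Fin 4) 2 1 = 1 := by decide
  have s022 : Equiv.swap (0 : Fin 4) 2 2 = 0 := by decide
  have s023 : Equiv.swap (0 : Fin 4) 2 3 = 3 := by decide
  have s120 : Equiv.swap (1 : Fin 4) 2 0 = 0 := by decide
  have s121 : Equiv.swap (1 : Fin 4) 2 1 = 2 := by decide
  have s122 : Equiv.swap (1 : Fin 4) 2 2 = 1 := by decide
  have s123 : Equiv.swap (1 : Fin 4) 2 3 = 3 := by decide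
  by_cases h0 : θ 0 = 0 <;> by_cases h1 : θ 1 = 0 <;> by_cases h2 : θ 2 = 0
  · -- empty support: contradicts `θ ≠ 0`
    exfalso; apply hθ; funext j
    rcases (by decide : ∀ j : Fin 4, j = 0 ∨ j = 1 ∨ j = 2 ∨ j = 3) j with rfl | rfl | rfl | rfl
    · exact h0
    · exact h1
    · exact h2
    · exact hθ3
  · -- supp = {2}
    exact torusDispatch_perm hiff (Equiv.refl _) rfl (Or.inl ⟨h0, h1, h2⟩)
  · -- supp = {1}: π = (1 2)
    refine torusDispatch_perm hiff (Equiv.swap 1 2) s123 (Or.inl ⟨?_, ?_, ?_⟩)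
    · rw [s120]; exact h0
    · rw [s121]; exact h2
    · rw [s122]; exact h1
  · -- supp = {1,2}: π = (0 2)
    refine torusDispatch_perm hiff (Equiv.swap 0 2) s023 (Or.inr (Or.inl ⟨?_, ?_, ?_⟩))
    · rw [s020]; exact h2
    · rw [s021]; exact h1
    · rw [s022]; exact h0
  · -- supp = {0}: π = (0 2)
    refine torusDispatch_perm hiff (Equiv.swap 0 2) s023 (Or.inl ⟨?_, ?_, ?_⟩)
    · rw [s020]; exact h2
    · rw [s021]; exact h1
    · rw [s022]; exact h0
  · -- supp = {0,2}: π = (1 2)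
    refine torusDispatch_perm hiff (Equiv.swap 1 2) s123 (Or.inr (Or.inl ⟨?_, ?_, ?_⟩))
    · rw [s120]; exact h0
    · rw [s121]; exact h2
    · rw [s122]; exact h1
  · -- supp = {0,1}
    exact torusDispatch_perm hiff (Equiv.refl _) rfl (Or.inr (Or.inl ⟨h0, h1, h2⟩))
  · -- supp = {0,1,2}
    exact torusDispatch_perm hiff (Equiv.refl _) rfl (Or.inr (Or.inr ⟨h0, h1, h2⟩))

/-! ## 4. Transposition glue -/

/-- Membership in the transposed space. [folklore] -/
theorem mem_map_transposeL {W : Submodule K (Fin 4 × Fin 4 → K)} {y : Fin 4 × Fin 4 → K} :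
    y ∈ W.map (transposeL (K := K) : (Fin 4 × Fin 4 → K) →ₗ[K] (Fin 4 × Fin 4 → K)) ↔
      (fun p : Fin 4 × Fin 4 => y (p.2, p.1)) ∈ W := by
  rw [Submodule.mem_map_equiv]
  exact Iff.rfl

/-- A joint family transports to the transposed space (`jointFamily_map` with `χ = 1`). [folklore] -/
theorem hasJointFour_map_transposeL {W : Submodule K (Fin 4 × Fin 4 → K)} (h : HasJointFour W) :
    HasJointFour (W.map (transposeL (K := K) : (Fin 4 × Fin 4 → K) →ₗ[K] (Fin 4 × Fin 4 → K))) := by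
  obtain ⟨c, β, hJ⟩ := h
  obtain ⟨c', β', h'⟩ := jointFamily_map W (transposeL (K := K)) 1
    (fun z => by rw [one_mul]; exact SymPencilPerFourTwoRowsRadical.eval_perPoly_transpose z) c β hJ
  exact ⟨c', β', h'⟩

/-- Finrank is preserved by transposition. [folklore] -/
theorem finrank_map_transposeL (W : Submodule K (Fin 4 × Fin 4 → K)) :
    finrank K (W.map (transposeL (K := K) : (Fin 4 × Fin 4 → K) →ₗ[K] (Fin 4 × Fin 4 → K))) =
      finrank K W :=
  LinearEquiv.finrank_map_eq _ _

/-- A zero column becomes a zero row after transposition. [folklore] -/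
theorem zeroRow_map_transposeL {W : Submodule K (Fin 4 × Fin 4 → K)} {j : Fin 4}
    (h : ∀ x ∈ W, ∀ i : Fin 4, x (i, j) = 0) :
    ∀ x ∈ W.map (transposeL (K := K) : (Fin 4 × Fin 4 → K) →ₗ[K] (Fin 4 × Fin 4 → K)),
      ∀ i : Fin 4, x (j, i) = 0 := by
  intro x hx i
  exact h _ (mem_map_transposeL.mp hx) i

/-- Two zero columns become two zero rows after transposition. [folklore] -/
theorem twoZeroRows_map_transposeL {W : Submodule K (Fin 4 × Fin 4 → K)} (h : TwoZeroCols W) :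
    TwoZeroRows (W.map (transposeL (K := K) : (Fin 4 × Fin 4 → K) →ₗ[K] (Fin 4 × Fin 4 → K))) := by
  obtain ⟨p, q, hpq, hW⟩ := h
  refine ⟨p, q, hpq, fun x hx j => ?_⟩
  exact hW _ (mem_map_transposeL.mp hx) j

/-! ## 5. The kernel-checked dispatch -/

/-- **Two zero rows ⇒ no joint family** (R2 ∘ E ∘ torus bricks). [folklore] -/
theorem twoZeroRows_noJoint_of [CharZero K]
    (hR2 : ∀ W : Submodule K (Fin 4 × Fin 4 → K), finrank K W = 5 → TwoZeroRows W → PerDirFour W →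
      ∃ p q m : Fin 4, p ≠ q ∧ InWCol W p q m)
    (hE : ∀ W : Submodule K (Fin 4 × Fin 4 → K), finrank K W = 5 → ∀ p q m : Fin 4, p ≠ q →
      InWCol W p q m → PerPointFour W → VTorusType W)
    (hT : ∀ W : Submodule K (Fin 4 × Fin 4 → K), VTorusType W → ¬ HasJointFour W)
    (W : Submodule K (Fin 4 × Fin 4 → K)) (h5 : finrank K W = 5) (h2 : TwoZeroRows W) :
    ¬ HasJointFour W := by
  rintro ⟨c, β, hJ⟩
  obtain ⟨p, q, m, hpq, hWc⟩ := hR2 W h5 h2 (perDirFour_of_jointFour hJ)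
  exact hT W (hE W h5 p q m hpq hWc (perPointFour_of_jointFour hJ)) ⟨c, β, hJ⟩

/-- **ROW BRANCH**: a `5`-dimensional singular `W` with a zero row carries no joint family of four
squares — from the five leaves and the torus dispatch. [folklore] -/
theorem rowBranch_of [CharZero K]
    (hX : ∀ W : Submodule K (Fin 4 × Fin 4 → K), finrank K W = 5 → InCross W → PerDirFour W →
      VFiveCrossType W)
    (hR2 : ∀ W : Submodule K (Fin 4 × Fin 4 → K), finrank K W = 5 → TwoZeroRows W → PerDirFour W →
      ∃ p q m : Fin 4, p ≠ q ∧ InWCol W p q m)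
    (hE : ∀ W : Submodule K (Fin 4 × Fin 4 → K), finrank K W = 5 → ∀ p q m : Fin 4, p ≠ q →
      InWCol W p q m → PerPointFour W → VTorusType W)
    (h33 : ∀ W : Submodule K (Fin 4 × Fin 4 → K), Sing3 W → finrank K W = 5 →
      (∃ i : Fin 4, ∀ x ∈ W, ∀ j : Fin 4, x (i, j) = 0) →
      (∃ j : Fin 4, ∀ x ∈ W, ∀ i : Fin 4, x (i, j) = 0) →
      ¬ TwoZeroRows W → ¬ TwoZeroCols W → ¬ InCross W → PerDirFour W → False)
    (h34 : ∀ W : Submodule K (Fin 4 × Fin 4 → K), Sing3 W → finrank K W = 5 →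
      (∃ i : Fin 4, ∀ x ∈ W, ∀ j : Fin 4, x (i, j) = 0) →
      ¬ (∃ j : Fin 4, ∀ x ∈ W, ∀ i : Fin 4, x (i, j) = 0) →
      ¬ TwoZeroRows W → ¬ InCross W → PerDirFour W → False)
    (hT : ∀ W : Submodule K (Fin 4 × Fin 4 → K), VTorusType W → ¬ HasJointFour W) :
    ∀ W : Submodule K (Fin 4 × Fin 4 → K), Sing3 W → finrank K W = 5 →
      (∃ i : Fin 4, ∀ x ∈ W, ∀ j : Fin 4, x (i, j) = 0) → ¬ HasJointFour W := by
  intro W hS h5 hrow hHas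
  obtain ⟨c, β, hJ⟩ := hHas
  have hPD := perDirFour_of_jointFour hJ
  by_cases hXc : InCross W
  · exact noJoint_of_vFiveCrossType (hX W h5 hXc hPD) ⟨c, β, hJ⟩
  by_cases h2 : TwoZeroRows W
  · exact twoZeroRows_noJoint_of hR2 hE hT W h5 h2 ⟨c, β, hJ⟩
  by_cases h2c : TwoZeroCols W
  · -- transpose: two zero columns become two zero rows
    set W' := W.map (transposeL (K := K) : (Fin 4 × Fin 4 → K) →ₗ[K] (Fin 4 × Fin 4 → K)) with hW'
    have h5' : finrank K W' = 5 := by rw [hW', finrank_map_transposeL]; exact h5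
    exact twoZeroRows_noJoint_of hR2 hE hT W' h5' (twoZeroRows_map_transposeL h2c)
      (hasJointFour_map_transposeL ⟨c, β, hJ⟩)
  by_cases hzc : ∃ j : Fin 4, ∀ x ∈ W, ∀ i : Fin 4, x (i, j) = 0
  · exact h33 W hS h5 hrow hzc h2 h2c hXc hPD
  · exact h34 W hS h5 hrow hzc h2 hXc hPD

/-- **THE DISPATCH (kernel-checked): the five leaves + the torus plumbing ⇒ no `5`-dimensional
`W ⊆ Sing Z(per₄)` carries a joint family of four squares.**  Top split = `zeroLine` (T5) BY NAME;
a zero column is transposed into a zero row. [folklore] -/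
theorem noJointFamily_five_four_of [CharZero K]
    (hX : ∀ W : Submodule K (Fin 4 × Fin 4 → K), finrank K W = 5 → InCross W → PerDirFour W →
      VFiveCrossType W)
    (hR2 : ∀ W : Submodule K (Fin 4 × Fin 4 → K), finrank K W = 5 → TwoZeroRows W → PerDirFour W →
      ∃ p q m : Fin 4, p ≠ q ∧ InWCol W p q m)
    (hE : ∀ W : Submodule K (Fin 4 × Fin 4 → K), finrank K W = 5 → ∀ p q m : Fin 4, p ≠ q →
      InWCol W p q m → PerPointFour W → VTorusType W)
    (h33 : ∀ W : Submodule K (Fin 4 × Fin 4 → K), Sing3 W → finrank K W = 5 →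
      (∃ i : Fin 4, ∀ x ∈ W, ∀ j : Fin 4, x (i, j) = 0) →
      (∃ j : Fin 4, ∀ x ∈ W, ∀ i : Fin 4, x (i, j) = 0) →
      ¬ TwoZeroRows W → ¬ TwoZeroCols W → ¬ InCross W → PerDirFour W → False)
    (h34 : ∀ W : Submodule K (Fin 4 × Fin 4 → K), Sing3 W → finrank K W = 5 →
      (∃ i : Fin 4, ∀ x ∈ W, ∀ j : Fin 4, x (i, j) = 0) →
      ¬ (∃ j : Fin 4, ∀ x ∈ W, ∀ i : Fin 4, x (i, j) = 0) →
      ¬ TwoZeroRows W → ¬ InCross W → PerDirFour W → False)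
    (hT : ∀ W : Submodule K (Fin 4 × Fin 4 → K), VTorusType W → ¬ HasJointFour W) :
    ∀ W : Submodule K (Fin 4 × Fin 4 → K), Sing3 W → finrank K W = 5 →
      ∀ (c : Fin 4 → K) (β : Fin 4 → ((Fin 4 × Fin 4 → K) →ₗ[K] (Fin 4 × Fin 4 → K) →ₗ[K] K)),
        ¬ (∀ u : Fin 4 × Fin 4 → K, ∀ y ∈ W, ∃ e₀ e₁ : K, ∀ s : K,
          eval (u + s • y) (perPoly (Fin 4) K) = e₀ + s * e₁ + s ^ 2 * ∑ k, c k * (β k u y) ^ 2) := by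
  intro W hS h5 c β hJ
  have hHas : HasJointFour W := ⟨c, β, hJ⟩
  rcases zeroLine W hS (by rw [h5]) with hXc | ⟨i, hi⟩ | ⟨j, hj⟩
  · exact noJoint_of_vFiveCrossType (hX W h5 hXc (perDirFour_of_jointFour hJ)) hHas
  · exact rowBranch_of hX hR2 hE h33 h34 hT W hS h5 ⟨i, hi⟩ hHas
  · -- zero column: transpose
    set W' := W.map (transposeL (K := K) : (Fin 4 × Fin 4 → K) →ₗ[K] (Fin 4 × Fin 4 → K)) with hW'
    have h5' : finrank K W' = 5 := by rw [hW', finrank_map_transposeL]; exact h5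
    exact rowBranch_of hX hR2 hE h33 h34 hT W' (sing3_map_transposeL hS) h5'
      ⟨j, zeroRow_map_transposeL hj⟩ (hasJointFour_map_transposeL hHas)

/-- **THE OPEN RESIDUAL SUFFICES (kernel-checked, rev 9)**: with leaves X, R2, E, R1C, the torus
plumbing and the R1N normalisation + full-row-rank branch PROVED in this file, the cell's V-side
statement follows from exactly ONE open statement — the NARROWED leaf R1N — taken here as a
hypothesis (its signature literally that of `stub_threeRowsFourCols_residual`). [folklore] -/
theorem noJointFamily_five_four_of_open [CharZero K]
    (hR1N : ∀ W : Submodule K (Fin 4 × Fin 4 → K), Sing3 W → finrank K W = 5 →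
      (∀ x ∈ W, ∀ j : Fin 4, x (3, j) = 0) →
      ¬ (∃ j : Fin 4, ∀ x ∈ W, ∀ i : Fin 4, x (i, j) = 0) →
      ¬ TwoZeroRows W → ¬ InCross W → PerDirFour W →
      (∀ r : Fin 4, W.map (rowL (K := K) r) ≠ ⊤) → False) :
    ∀ W : Submodule K (Fin 4 × Fin 4 → K), Sing3 W → finrank K W = 5 →
      ∀ (c : Fin 4 → K) (β : Fin 4 → ((Fin 4 × Fin 4 → K) →ₗ[K] (Fin 4 × Fin 4 → K) →ₗ[K] K)),
        ¬ (∀ u : Fin 4 × Fin 4 → K, ∀ y ∈ W, ∃ e₀ e₁ : K, ∀ s : K,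
          eval (u + s • y) (perPoly (Fin 4) K) = e₀ + s * e₁ + s ^ 2 * ∑ k, c k * (β k u y) ^ 2) :=
  noJointFamily_five_four_of stub_crossFive stub_twoZeroRows stub_wcolFive stub_threeByThree
    (threeRowsFourCols_of_residual hR1N) stub_torusDispatch

/-- **THE TWO OPEN BRANCHES SUFFICE (kernel-checked, rev 10)**: the cell's V-side statement from
exactly the two remaining paper branches of leaf R1N — TORIC (memo §6.6) and PRODUCT (memo §6.5) —
taken as hypotheses; everything else (leaves X, R2, E, R1C, torus plumbing, R1N normalisation,
`n_r = 4`, and the kernel-plane dispatch with its GRAPH and PURE branches) is PROVED in this file.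
[folklore] -/
theorem noJointFamily_five_four_of_open₂ [CharZero K] (hT : R1NToric K) (hPr : R1NProduct K) :
    ∀ W : Submodule K (Fin 4 × Fin 4 → K), Sing3 W → finrank K W = 5 →
      ∀ (c : Fin 4 → K) (β : Fin 4 → ((Fin 4 × Fin 4 → K) →ₗ[K] (Fin 4 × Fin 4 → K) →ₗ[K] K)),
        ¬ (∀ u : Fin 4 × Fin 4 → K, ∀ y ∈ W, ∃ e₀ e₁ : K, ∀ s : K,
          eval (u + s • y) (perPoly (Fin 4) K) = e₀ + s * e₁ + s ^ 2 * ∑ k, c k * (β k u y) ^ 2) :=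
  noJointFamily_five_four_of_open (residual_of_toric_product hT hPr)

/-- **`noJointFamily_five_four`** — the V-side statement of cell `(11,5,4)` (LIST₅ ∘ bricks), from
the stubs of this file.  The ONLY sorry (rev 10) is `stub_R1N_residual : R1NToric K ∧ R1NProduct K`
(memo §6.6 + §6.5). [folklore] -/
theorem noJointFamily_five_four [CharZero K] :
    ∀ W : Submodule K (Fin 4 × Fin 4 → K), Sing3 W → finrank K W = 5 →
      ∀ (c : Fin 4 → K) (β : Fin 4 → ((Fin 4 × Fin 4 → K) →ₗ[K] (Fin 4 × Fin 4 → K) →ₗ[K] K)),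
        ¬ (∀ u : Fin 4 × Fin 4 → K, ∀ y ∈ W, ∃ e₀ e₁ : K, ∀ s : K,
          eval (u + s • y) (perPoly (Fin 4) K) = e₀ + s * e₁ + s ^ 2 * ∑ k, c k * (β k u y) ^ 2) :=
  noJointFamily_five_four_of stub_crossFive stub_twoZeroRows stub_wcolFive stub_threeByThree
    stub_threeRowsFourCols stub_torusDispatch

end Summit.ValiantsHypothesis.ValiantsHypothesis.Cruxes.SdcSuperquadratic.SingFive

end
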